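import Mathlib
import Literature.Analysis.PDE.DivFormStrongMaximumPrinciple
import Literature.Analysis.FunctionSpaces.MoserIteration
import Literature.Analysis.FunctionSpaces.PoincareWirtingerConvex
import Literature.Analysis.FunctionSpaces.BMOJohnNirenberg
import Literature.Analysis.FunctionSpaces.BombieriGiustiLemma
import Literature.Analysis.PDE.DivForm.Harnack
import Literature.Analysis.PDE.DivForm.Liouville
import HarnessLib

/-!
# The strong maximum principle for `div(a∇u) = 0` with bounded measurable coefficients (Gilbarg–Trudinger Thm 8.19), via the local Moser–Harnack inequality — `divFormStrongMaximumPrinciple` proved inside Literature (re-homed proofs)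

**The strong maximum principle for `div(a∇u) = 0`** (Gilbarg–Trudinger, *Elliptic Partial Differential Equations of Second Order*,
Theorem 8.19, in the rendering of the Literature named fact `Literature.Analysis.PDE.divFormStrongMaximumPrinciple`): on an open
preconnected `Ω ⊆ ℝⁿ`, a `C¹(Ω)` weak solution of a divergence-form equation with bounded measurable uniformly elliptic symmetric
coefficients which attains its supremum over `Ω` at an interior point is constant — IN EVERY DIMENSION (`StrongMaximumPrinciple.smp_all`):
for `n ≥ 3` by the LOCAL Moser–Harnack inequality on balls `B(x,4r) ⊆ Ω` (Parts 1–6: local Caccioppoli / reverse Hölder / Moser iteration /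
logarithmic oscillation / the Bombieri–Giusti crossover, `LocalHarnack.harnack_local`) applied to `M − u + ε` and a clopen argument (Part 7),
for `n ≤ 2` by the descent of `DivForm/Liouville.lean` (Part 8), assembled in Part 9 — RE-HOMED into `Literature/` by the Hodge foundations
lane (`lit-hodgefound`, seat p20, generation 36) from the cell ns-poloidal (route `PoloidalWindowDoor`, crux K2): verbatim ports, in dependency
order and each with its original module docstring, of the modules `Summits/NavierStokesRegularity/NavierStokesRegularity/Theorems/PoloidalWindowDoorPoloidalWindowRigidityDivForm{LocalCaccioppoli,
LocalReverseHolder, LocalMoser, LocalLogOsc, LocalHarnackInputs, LocalHarnack, StrongMaximumPrincipleGlobalise, StrongMaximumPrincipleDescent,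
StrongMaximumPrinciple}.lean`, namespace `Summit.NavierStokesRegularity.NavierStokesRegularity.Theorems.PoloidalWindowDoorPoloidalWindowRigidityDivForm<Step>` re-rooted as
`Literature.Analysis.PDE.DivForm.<Step>` (this file's path namespace + the source's step name).  SETTING throughout (the rendering of the
Literature named fact `Literature.Analysis.PDE.divFormLiouville`, Jost Thm 14.2.3 / Moser 1961): a measurable symmetric coefficient field
`a : ℝⁿ → Matₙ(ℝ)` with `λ|ξ|² ≤ ξ·a(y)ξ` and `|aᵢⱼ| ≤ Λ`, and `C¹` functions `u` satisfying the weak equation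
`∫ Σᵢⱼ aᵢⱼ ∂ᵢu ∂ⱼη = 0` for all `C¹` compactly supported `η` (so `u ∈ W^{1,2}_loc`; the `C¹` rendering is the fact's, see its TODO).
Theorems only unless said; no named fact; imports Mathlib/Literature only (the tree's `Literature/Analysis/FunctionSpaces/{SmoothCutoff,
MoserIteration, BMO, BMOJohnNirenberg(+Lp), PoincareWirtingerConvex, BombieriGiustiLemma}`); every declaration carries the citation of the
printed step it formalises (the originals' `[folklore]` helpers are re-tagged with the theorem they serve).  The Summits originals stay in
place (transitional duplication; twins = same short names under the Summits namespaces).  Nothing here is specific to Navier–Stokes, and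
nothing about Navier–Stokes regularity is claimed.
The last declaration is the DISCHARGE `Literature.Analysis.PDE.DivForm.divFormStrongMaximumPrinciple_holds : divFormStrongMaximumPrinciple`
of the Literature named fact (`DivFormStrongMaximumPrinciple.lean`); the fact's canonical name `Literature.Analysis.PDE.divFormStrongMaximumPrinciple_holds`
is already declared Summits-side by the source module (the gate's registry credits the fact) and cannot be re-declared here; this file makes the
proof importable from `Literature/`.
-/

noncomputable section

/-!
## Part 1 — port of `Summits/NavierStokesRegularity/NavierStokesRegularity/Theorems/PoloidalWindowDoorPoloidalWindowRigidityDivFormLocalCaccioppoli.lean`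

# Route `PoloidalWindowDoor`, crux K2 (stmt-NavierStokesRegularity-19708) — LOCAL Caccioppoli inequalities for
# `div(a∇u) = 0` on an open set `U` (towards `divFormStrongMaximumPrinciple_holds`, GT Thm 8.19, and an interior
# Harnack inequality for LOCAL weak solutions; De Giorgi–Nash–Moser)

The sibling files `…DivFormCaccioppoli`, `…DivFormCaccioppoliPowers` (seat ns-poloidal-K2-p3) prove the weighted
energy identity and the weighted / power / logarithmic Caccioppoli inequalities for ENTIRE weak solutions: their
hypothesis `hweak` asks `∫ Σᵢⱼ aᵢⱼ ∂ᵢu ∂ⱼη = 0` for EVERY `η ∈ C¹_c(ℝⁿ)`.  The named fact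
`Literature.Analysis.PDE.divFormStrongMaximumPrinciple` (Gilbarg–Trudinger Thm 8.19) and the line stub it serves
(`Cruxes/PoloidalWindowRigidity/Lines/thread_type.lean`, C1) only have the equation LOCALLY: for test functions with
`tsupport η ⊆ U`, `U` open.  This file re-runs the same five proofs VERBATIM with that weaker hypothesis; the only
change is that every cutoff `χ` now carries `tsupport χ ⊆ U`, so that the test function `η = χ² g(u)` is admissible
(`tsupport (χ² g(u)) ⊆ tsupport χ ⊆ U`).  As in the siblings, `u ∈ C¹(ℝⁿ)` with `u ≥ 1` globally and the coefficient
hypotheses are global (a local solution is put in this form by a cutoff modification OUTSIDE the ball of interest —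
done once, in the strong-maximum-principle file); nothing is assumed about `u` off `U` beyond smoothness.

* `energy_identity_weighted_local` — `∫ χ² g′(u) Du·aDu = −2 ∫ χ g(u) Du·aDχ` for `χ ∈ C¹_c`, `tsupport χ ⊆ U`;
* `caccioppoli_weighted_local` — `∫ χ² g′(u) Du·aDu ≤ 4 ∫ (g²/g′)(u) Dχ·aDχ` (`g′ > 0`);
* `caccioppoli_rpow_local` — weight `s^β/β` (Moser 1961 (4.4); Gilbarg–Trudinger (8.52));
* `caccioppoli_log_local` — weight `−1/s` (Moser 1961 §5): `∫ χ² u⁻² Du·aDu ≤ 4 ∫ Dχ·aDχ`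
  (its gradient-norm form `gradLog_estimate` is localised in the sequel file on the logarithmic oscillation).

Adapted from `…DivFormCaccioppoli` / `…DivFormCaccioppoliPowers` (proofs copied, hypothesis localised); all
algebraic and integrability helpers are imported from there, not restated.  Seat ns-in-ser-b g5 (cell pub/ns-inputs),
`ledger fact claim` #1 on `Literature.Analysis.PDE.divFormStrongMaximumPrinciple`.

WHAT THIS IS NOT: not yet a Harnack inequality or the strong maximum principle (sequel files: local reverse Hölder,
local Moser chain, the Bombieri–Giusti lemma, local Harnack, GT 8.19); nothing here is specific to Navier–Stokes and no
NS statement is touched.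
-/

section Part1

noncomputable section

open _root_.MeasureTheory _root_.Set _root_.Function _root_.Filter _root_.Topology _root_.Metric
open scoped _root_.Matrix

namespace Literature.Analysis.PDE.DivForm.LocalCaccioppoli

open Literature.Analysis.PDE.DivForm.Caccioppoli
open Literature.Analysis.PDE.DivForm.CaccioppoliPowers

variable {n : ℕ} {a : EuclideanSpace ℝ (Fin n) → Matrix (Fin n) (Fin n) ℝ} {lam Λ : ℝ}
  {u : EuclideanSpace ℝ (Fin n) → ℝ} {U : Set (EuclideanSpace ℝ (Fin n))}

/-! ### Supports of the test functions -/

/-- `tsupport (χ²) ⊆ tsupport χ`.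
[cite: GilbargTrudinger2001, Theorem 8.18/8.20 proof §8.6 (local Caccioppoli inequalities)] -/
theorem tsupport_sq_subset (χ : EuclideanSpace ℝ (Fin n) → ℝ) :
    tsupport (fun y => χ y ^ 2) ⊆ tsupport χ :=
  closure_mono fun y hy => by
    simp only [mem_support, ne_eq] at hy ⊢
    intro h; exact hy (by simp [h])

/-! ### The weighted energy identity and Caccioppoli inequality, local form -/

/-- **Weighted energy identity.**  Let `u ∈ C¹(ℝⁿ)`, `u ≥ 1`, be a weak solution (`∫ Σ aᵢⱼ ∂ᵢu ∂ⱼη = 0` for all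
`η ∈ C¹_c`), `g ∈ C¹(]½,∞[)`, `χ ∈ C¹_c`.  Then, with `Du = (∂ᵢu)ᵢ`, `Dχ = (∂ⱼχ)ⱼ`,
`∫ χ² g′(u) Du·a Du = −2 ∫ χ g(u) Du·a Dχ`.
[cite: GilbargTrudinger2001, Theorem 8.18/8.20 proof §8.6 (local Caccioppoli inequalities)] -/
theorem energy_identity_weighted_local (hsymm : ∀ y, (a y).IsSymm) (hlam : 0 < lam)
    (hmeas : ∀ i j, Measurable fun y => a y i j)
    (hell : ∀ y (ξ : Fin n → ℝ), lam * (ξ ⬝ᵥ ξ) ≤ ξ ⬝ᵥ (a y *ᵥ ξ)) (hbd : ∀ y i j, |a y i j| ≤ Λ)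
    (hu : ContDiff ℝ 1 u) (hu1 : ∀ y, 1 ≤ u y)
    (hweak : ∀ η : EuclideanSpace ℝ (Fin n) → ℝ, ContDiff ℝ 1 η → HasCompactSupport η → tsupport η ⊆ U →
      ∫ y, ∑ i, ∑ j, a y i j * fderiv ℝ u y (EuclideanSpace.single i 1) *
        fderiv ℝ η y (EuclideanSpace.single j 1) = 0)
    {g : ℝ → ℝ} (hg : ContDiffOn ℝ 1 g (Ioi (1 / 2)))
    {χ : EuclideanSpace ℝ (Fin n) → ℝ} (hχ : ContDiff ℝ 1 χ) (hχc : HasCompactSupport χ)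
    (hχU : tsupport χ ⊆ U) :
    ∫ y, χ y ^ 2 * deriv g (u y) *
        ((fun i => fderiv ℝ u y (EuclideanSpace.single i 1)) ⬝ᵥ
          (a y *ᵥ fun i => fderiv ℝ u y (EuclideanSpace.single i 1))) =
      -2 * ∫ y, χ y * g (u y) *
        ((fun i => fderiv ℝ u y (EuclideanSpace.single i 1)) ⬝ᵥ
          (a y *ᵥ fun j => fderiv ℝ χ y (EuclideanSpace.single j 1))) := by
  -- continuity facts
  have hcu := continuous_fderiv_single hu
  have hcχ := continuous_fderiv_single hχ
  have hgu : Continuous fun y => g (u y) :=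
    (contDiff_testFun hu hu1 hg (contDiff_const (c := (1 : ℝ)))).continuous.congr fun y => by simp
  have hg'u : Continuous fun y => deriv g (u y) := by
    have hg' : ContinuousOn (deriv g) (Ioi (1 / 2)) :=
      (hg.continuousOn_deriv_of_isOpen isOpen_Ioi le_rfl)
    refine hg'.comp_continuous hu.continuous fun y => ?_
    have := hu1 y; simp only [mem_Ioi]; linarith
  -- the test function and its gradient
  have hηU : tsupport (fun y => χ y ^ 2 * g (u y)) ⊆ U :=
    (tsupport_mul_subset_left (f := fun y => χ y ^ 2) (g := fun y => g (u y))).trans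
      ((tsupport_sq_subset χ).trans hχU)
  have hη := hweak _ (contDiff_testFun hu hu1 hg hχ) (hasCompactSupport_testFun hχc) hηU
  have hpt : ∀ y, ∑ i, ∑ j, a y i j * fderiv ℝ u y (EuclideanSpace.single i 1) *
        fderiv ℝ (fun y => χ y ^ 2 * g (u y)) y (EuclideanSpace.single j 1) =
      χ y ^ 2 * deriv g (u y) *
          ((fun i => fderiv ℝ u y (EuclideanSpace.single i 1)) ⬝ᵥ
            (a y *ᵥ fun i => fderiv ℝ u y (EuclideanSpace.single i 1))) +
        2 * (χ y * g (u y) *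
          ((fun i => fderiv ℝ u y (EuclideanSpace.single i 1)) ⬝ᵥ
            (a y *ᵥ fun j => fderiv ℝ χ y (EuclideanSpace.single j 1)))) := by
    intro y
    rw [← sum_sum_mul_eq_dotProduct, ← sum_sum_mul_eq_dotProduct]
    simp only [fderiv_testFun hu hu1 hg hχ y, Finset.mul_sum, ← Finset.sum_add_distrib]
    exact Finset.sum_congr rfl fun i _ => Finset.sum_congr rfl fun j _ => by ring
  simp_rw [hpt] at hη
  -- integrability of the two summands
  have hI1 : Integrable fun y => χ y ^ 2 * deriv g (u y) *
      ((fun i => fderiv ℝ u y (EuclideanSpace.single i 1)) ⬝ᵥ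
        (a y *ᵥ fun i => fderiv ℝ u y (EuclideanSpace.single i 1))) := by
    have h := integrable_mul_of_le_continuous (n := n)
      (m := fun y => (fun i => fderiv ℝ u y (EuclideanSpace.single i 1)) ⬝ᵥ
        (a y *ᵥ fun i => fderiv ℝ u y (EuclideanSpace.single i 1)))
      (M := fun y => n * Λ * (∑ i, fderiv ℝ u y (EuclideanSpace.single i 1) ^ 2 +
        ∑ j, fderiv ℝ u y (EuclideanSpace.single j 1) ^ 2) / 2)
      (φ := fun y => χ y ^ 2 * deriv g (u y))
      (measurable_dotProduct_mulVec hmeas hcu hcu) (by fun_prop)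
      (fun y => abs_dotProduct_mulVec_le hsymm hlam hell hbd y _ _) ((hχ.continuous.pow 2).mul hg'u)
      ((hasCompactSupport_testFun (u := u) (g := deriv g) hχc))
    exact h.congr (Eventually.of_forall fun y => by ring)
  have hI2 : Integrable fun y => χ y * g (u y) *
      ((fun i => fderiv ℝ u y (EuclideanSpace.single i 1)) ⬝ᵥ
        (a y *ᵥ fun j => fderiv ℝ χ y (EuclideanSpace.single j 1))) := by
    have h := integrable_mul_of_le_continuous (n := n)
      (m := fun y => (fun i => fderiv ℝ u y (EuclideanSpace.single i 1)) ⬝ᵥ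
        (a y *ᵥ fun j => fderiv ℝ χ y (EuclideanSpace.single j 1)))
      (M := fun y => n * Λ * (∑ i, fderiv ℝ u y (EuclideanSpace.single i 1) ^ 2 +
        ∑ j, fderiv ℝ χ y (EuclideanSpace.single j 1) ^ 2) / 2)
      (φ := fun y => χ y * g (u y))
      (measurable_dotProduct_mulVec hmeas hcu hcχ) (by fun_prop)
      (fun y => abs_dotProduct_mulVec_le hsymm hlam hell hbd y _ _) (hχ.continuous.mul hgu)
      (hχc.mul_right)
    exact h.congr (Eventually.of_forall fun y => by ring)
  rw [integral_add hI1 (hI2.const_mul 2), integral_const_mul] at hη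
  linarith

/-- **Weighted Caccioppoli inequality.**  In the setting of `energy_identity_weighted_local`, if moreover `g′ > 0` on
`]½,∞[`, then `∫ χ² g′(u) Du·aDu ≤ 4 ∫ (g(u)²/g′(u)) Dχ·aDχ`.
[cite: GilbargTrudinger2001, Theorem 8.18/8.20 proof §8.6 (local Caccioppoli inequalities)] -/
theorem caccioppoli_weighted_local (hsymm : ∀ y, (a y).IsSymm) (hlam : 0 < lam)
    (hmeas : ∀ i j, Measurable fun y => a y i j)
    (hell : ∀ y (ξ : Fin n → ℝ), lam * (ξ ⬝ᵥ ξ) ≤ ξ ⬝ᵥ (a y *ᵥ ξ)) (hbd : ∀ y i j, |a y i j| ≤ Λ)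
    (hu : ContDiff ℝ 1 u) (hu1 : ∀ y, 1 ≤ u y)
    (hweak : ∀ η : EuclideanSpace ℝ (Fin n) → ℝ, ContDiff ℝ 1 η → HasCompactSupport η → tsupport η ⊆ U →
      ∫ y, ∑ i, ∑ j, a y i j * fderiv ℝ u y (EuclideanSpace.single i 1) *
        fderiv ℝ η y (EuclideanSpace.single j 1) = 0)
    {g : ℝ → ℝ} (hg : ContDiffOn ℝ 1 g (Ioi (1 / 2))) (hg' : ∀ s, 1 / 2 < s → 0 < deriv g s)
    {χ : EuclideanSpace ℝ (Fin n) → ℝ} (hχ : ContDiff ℝ 1 χ) (hχc : HasCompactSupport χ)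
    (hχU : tsupport χ ⊆ U) :
    ∫ y, χ y ^ 2 * deriv g (u y) *
        ((fun i => fderiv ℝ u y (EuclideanSpace.single i 1)) ⬝ᵥ
          (a y *ᵥ fun i => fderiv ℝ u y (EuclideanSpace.single i 1))) ≤
      4 * ∫ y, g (u y) ^ 2 / deriv g (u y) *
        ((fun j => fderiv ℝ χ y (EuclideanSpace.single j 1)) ⬝ᵥ
          (a y *ᵥ fun j => fderiv ℝ χ y (EuclideanSpace.single j 1))) := by
  set Du : EuclideanSpace ℝ (Fin n) → Fin n → ℝ := fun y i => fderiv ℝ u y (EuclideanSpace.single i 1) with hDu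
  set Dχ : EuclideanSpace ℝ (Fin n) → Fin n → ℝ := fun y j => fderiv ℝ χ y (EuclideanSpace.single j 1) with hDχ
  have hid := energy_identity_weighted_local hsymm hlam hmeas hell hbd hu hu1 hweak hg hχ hχc hχU
  have hcu := continuous_fderiv_single hu
  have hcχ := continuous_fderiv_single hχ
  have hgu : Continuous fun y => g (u y) :=
    (contDiff_testFun hu hu1 hg (contDiff_const (c := (1 : ℝ)))).continuous.congr fun y => by simp
  have hg'u : Continuous fun y => deriv g (u y) := by
    have hg'c : ContinuousOn (deriv g) (Ioi (1 / 2)) := hg.continuousOn_deriv_of_isOpen isOpen_Ioi le_rfl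
    refine hg'c.comp_continuous hu.continuous fun y => ?_
    have := hu1 y; simp only [mem_Ioi]; linarith
  have hg'pos : ∀ y, 0 < deriv g (u y) := fun y => hg' _ (by have := hu1 y; linarith)
  -- pointwise Young + Cauchy–Schwarz: `2|χ g B| ≤ ½ χ² g′ Q(Du) + 2 (g²/g′) Q(Dχ)`
  have hpt : ∀ y, 2 * |χ y * g (u y) * (Du y ⬝ᵥ (a y *ᵥ Dχ y))| ≤
      (1 / 2) * (χ y ^ 2 * deriv g (u y) * (Du y ⬝ᵥ (a y *ᵥ Du y))) +
        2 * (g (u y) ^ 2 / deriv g (u y) * (Dχ y ⬝ᵥ (a y *ᵥ Dχ y))) := by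
    intro y
    have hcs := quadForm_cauchySchwarz hsymm hlam hell y (Du y) (Dχ y)
    have hQ1 : 0 ≤ Du y ⬝ᵥ (a y *ᵥ Du y) :=
      (mul_nonneg hlam.le (Finset.sum_nonneg fun i _ => sq_nonneg (Du y i))).trans (quadForm_lower hell y _)
    have hQ2 : 0 ≤ Dχ y ⬝ᵥ (a y *ᵥ Dχ y) :=
      (mul_nonneg hlam.le (Finset.sum_nonneg fun i _ => sq_nonneg (Dχ y i))).trans (quadForm_lower hell y _)
    have hgp := hg'pos y
    set A := (1 / 2) * (χ y ^ 2 * deriv g (u y) * (Du y ⬝ᵥ (a y *ᵥ Du y))) with hA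
    set Cc := 2 * (g (u y) ^ 2 / deriv g (u y) * (Dχ y ⬝ᵥ (a y *ᵥ Dχ y))) with hC
    have hA0 : 0 ≤ A := by rw [hA]; positivity
    have hC0 : 0 ≤ Cc := by rw [hC]; positivity
    set x := χ y * g (u y) * (Du y ⬝ᵥ (a y *ᵥ Dχ y)) with hx
    -- `x² ≤ A·Cc`
    have hx2 : x ^ 2 ≤ A * Cc := by
      have h1 : x ^ 2 = χ y ^ 2 * g (u y) ^ 2 * (Du y ⬝ᵥ (a y *ᵥ Dχ y)) ^ 2 := by rw [hx]; ring
      have h2 : A * Cc = χ y ^ 2 * g (u y) ^ 2 * ((Du y ⬝ᵥ (a y *ᵥ Du y)) * (Dχ y ⬝ᵥ (a y *ᵥ Dχ y))) := by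
        rw [hA, hC]; field_simp
      rw [h1, h2]
      exact mul_le_mul_of_nonneg_left hcs (by positivity)
    nlinarith [sq_nonneg (A - Cc), sq_abs x, abs_nonneg x, hx2]
  -- integrate
  have hI2 : Integrable fun y => χ y * g (u y) * (Du y ⬝ᵥ (a y *ᵥ Dχ y)) := by
    have h := integrable_mul_of_le_continuous (n := n) (m := fun y => Du y ⬝ᵥ (a y *ᵥ Dχ y))
      (M := fun y => n * Λ * (∑ i, Du y i ^ 2 + ∑ j, Dχ y j ^ 2) / 2) (φ := fun y => χ y * g (u y))
      (measurable_dotProduct_mulVec hmeas hcu hcχ) (by simp only [hDu, hDχ]; fun_prop)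
      (fun y => abs_dotProduct_mulVec_le hsymm hlam hell hbd y _ _) (hχ.continuous.mul hgu) (hχc.mul_right)
    exact h.congr (Eventually.of_forall fun y => by ring)
  have hIA : Integrable fun y => χ y ^ 2 * deriv g (u y) * (Du y ⬝ᵥ (a y *ᵥ Du y)) := by
    have h := integrable_mul_of_le_continuous (n := n) (m := fun y => Du y ⬝ᵥ (a y *ᵥ Du y))
      (M := fun y => n * Λ * (∑ i, Du y i ^ 2 + ∑ j, Du y j ^ 2) / 2) (φ := fun y => χ y ^ 2 * deriv g (u y))
      (measurable_dotProduct_mulVec hmeas hcu hcu) (by simp only [hDu]; fun_prop)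
      (fun y => abs_dotProduct_mulVec_le hsymm hlam hell hbd y _ _) ((hχ.continuous.pow 2).mul hg'u)
      (hasCompactSupport_testFun (u := u) (g := deriv g) hχc)
    exact h.congr (Eventually.of_forall fun y => by ring)
  have hIC : Integrable fun y => g (u y) ^ 2 / deriv g (u y) * (Dχ y ⬝ᵥ (a y *ᵥ Dχ y)) := by
    -- dominate by the continuous compactly supported `(g(u)²/g′(u)) · nΛ Σⱼ (∂ⱼχ)²`
    have hM : Integrable fun y => g (u y) ^ 2 / deriv g (u y) * (n * Λ * ∑ j, Dχ y j ^ 2) := by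
      have hc : Continuous fun y => g (u y) ^ 2 / deriv g (u y) * (n * Λ * ∑ j, Dχ y j ^ 2) := by
        refine ((hgu.pow 2).div hg'u fun y => (hg'pos y).ne').mul ?_
        simp only [hDχ]; fun_prop
      refine hc.integrable_of_hasCompactSupport ?_
      have hs : HasCompactSupport fun y => n * Λ * ∑ j, Dχ y j ^ 2 := by
        refine (hχc.fderiv (𝕜 := ℝ)).mono (Function.support_subset_iff'.2 fun y hy => ?_)
        simp only [Function.mem_support, not_not] at hy
        simp [hDχ, hy]
      exact hs.mul_left
    refine hM.mono' ?_ (Eventually.of_forall fun y => ?_)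
    · exact ((hgu.pow 2).div hg'u fun y => (hg'pos y).ne').aestronglyMeasurable.mul
        (measurable_dotProduct_mulVec hmeas hcχ hcχ).aestronglyMeasurable
    · have hq0 : 0 ≤ Dχ y ⬝ᵥ (a y *ᵥ Dχ y) :=
        (mul_nonneg hlam.le (Finset.sum_nonneg fun i _ => sq_nonneg (Dχ y i))).trans (quadForm_lower hell y _)
      have hfac : 0 ≤ g (u y) ^ 2 / deriv g (u y) := div_nonneg (sq_nonneg _) (hg'pos y).le
      rw [Real.norm_eq_abs, abs_of_nonneg (mul_nonneg hfac hq0)]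
      exact mul_le_mul_of_nonneg_left (quadForm_upper hbd y _) hfac
  have hint : ∫ y, χ y ^ 2 * deriv g (u y) * (Du y ⬝ᵥ (a y *ᵥ Du y)) ≤
      (1 / 2) * (∫ y, χ y ^ 2 * deriv g (u y) * (Du y ⬝ᵥ (a y *ᵥ Du y))) +
        2 * (∫ y, g (u y) ^ 2 / deriv g (u y) * (Dχ y ⬝ᵥ (a y *ᵥ Dχ y))) := by
    calc ∫ y, χ y ^ 2 * deriv g (u y) * (Du y ⬝ᵥ (a y *ᵥ Du y))
        = -2 * ∫ y, χ y * g (u y) * (Du y ⬝ᵥ (a y *ᵥ Dχ y)) := hid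
      _ ≤ ∫ y, 2 * |χ y * g (u y) * (Du y ⬝ᵥ (a y *ᵥ Dχ y))| := by
          rw [← integral_const_mul]
          refine integral_mono (hI2.const_mul _) (hI2.abs.const_mul 2) fun y => ?_
          have := neg_abs_le (χ y * g (u y) * (Du y ⬝ᵥ (a y *ᵥ Dχ y)))
          simp only; linarith
      _ ≤ ∫ y, ((1 / 2) * (χ y ^ 2 * deriv g (u y) * (Du y ⬝ᵥ (a y *ᵥ Du y))) +
            2 * (g (u y) ^ 2 / deriv g (u y) * (Dχ y ⬝ᵥ (a y *ᵥ Dχ y)))) :=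
          integral_mono (hI2.abs.const_mul 2) ((hIA.const_mul _).add (hIC.const_mul _)) hpt
      _ = (1 / 2) * (∫ y, χ y ^ 2 * deriv g (u y) * (Du y ⬝ᵥ (a y *ᵥ Du y))) +
            2 * (∫ y, g (u y) ^ 2 / deriv g (u y) * (Dχ y ⬝ᵥ (a y *ᵥ Dχ y))) := by
          rw [integral_add (hIA.const_mul _) (hIC.const_mul _), integral_const_mul, integral_const_mul]
  linarith

/-! ### Power Caccioppoli -/

/-- **POWER CACCIOPPOLI** (Moser 1961 (4.4)): for a `C¹` weak solution `u ≥ 1` of `div(a∇u) = 0`, `β ≠ 0` and `χ ∈ C¹_c`: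
`∫ χ² u^{β−1} Du·aDu ≤ (4/β²) ∫ u^{β+1} Dχ·aDχ`.
[cite: GilbargTrudinger2001, Theorem 8.18/8.20 proof §8.6 (local Caccioppoli inequalities)] -/
theorem caccioppoli_rpow_local (hsymm : ∀ y, (a y).IsSymm) (hlam : 0 < lam)
    (hmeas : ∀ i j, Measurable fun y => a y i j)
    (hell : ∀ y (ξ : Fin n → ℝ), lam * (ξ ⬝ᵥ ξ) ≤ ξ ⬝ᵥ (a y *ᵥ ξ)) (hbd : ∀ y i j, |a y i j| ≤ Λ)
    (hu : ContDiff ℝ 1 u) (hu1 : ∀ y, 1 ≤ u y)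
    (hweak : ∀ η : EuclideanSpace ℝ (Fin n) → ℝ, ContDiff ℝ 1 η → HasCompactSupport η → tsupport η ⊆ U →
      ∫ y, ∑ i, ∑ j, a y i j * fderiv ℝ u y (EuclideanSpace.single i 1) *
        fderiv ℝ η y (EuclideanSpace.single j 1) = 0)
    {β : ℝ} (hβ : β ≠ 0) {χ : EuclideanSpace ℝ (Fin n) → ℝ} (hχ : ContDiff ℝ 1 χ) (hχc : HasCompactSupport χ)
    (hχU : tsupport χ ⊆ U) :
    ∫ y, χ y ^ 2 * u y ^ (β - 1) *
        ((fun i => fderiv ℝ u y (EuclideanSpace.single i 1)) ⬝ᵥ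
          (a y *ᵥ fun i => fderiv ℝ u y (EuclideanSpace.single i 1))) ≤
      4 / β ^ 2 * ∫ y, u y ^ (β + 1) *
        ((fun j => fderiv ℝ χ y (EuclideanSpace.single j 1)) ⬝ᵥ
          (a y *ᵥ fun j => fderiv ℝ χ y (EuclideanSpace.single j 1))) := by
  have hupos : ∀ y, 0 < u y := fun y => lt_of_lt_of_le one_pos (hu1 y)
  have hg' : ∀ s : ℝ, 1 / 2 < s → 0 < deriv (fun s : ℝ => s ^ β / β) s := by
    intro s hs
    have hs0 : (0 : ℝ) < s := by linarith
    rw [deriv_rpow_div hβ hs0.ne']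
    exact Real.rpow_pos_of_pos hs0 _
  have h := caccioppoli_weighted_local hsymm hlam hmeas hell hbd hu hu1 hweak (contDiffOn_rpow_div β) hg' hχ hχc hχU
  -- rewrite the weights: `g′(u) = u^{β−1}`, `g(u)²/g′(u) = u^{β+1}/β²`
  have h1 : ∀ y, deriv (fun s : ℝ => s ^ β / β) (u y) = u y ^ (β - 1) := fun y => deriv_rpow_div hβ (hupos y).ne'
  have h2 : ∀ y, (u y ^ β / β) ^ 2 / u y ^ (β - 1) = (1 / β ^ 2) * u y ^ (β + 1) := by
    intro y
    have hy := hupos y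
    have hr : (u y ^ β) ^ 2 = u y ^ (β + 1) * u y ^ (β - 1) := by
      rw [← Real.rpow_add hy, sq, ← Real.rpow_add hy]; congr 1; ring
    have hne : u y ^ (β - 1) ≠ 0 := (Real.rpow_pos_of_pos hy _).ne'
    rw [div_pow, hr]
    field_simp
  simp_rw [h1, h2] at h
  calc ∫ y, χ y ^ 2 * u y ^ (β - 1) *
          ((fun i => fderiv ℝ u y (EuclideanSpace.single i 1)) ⬝ᵥ
            (a y *ᵥ fun i => fderiv ℝ u y (EuclideanSpace.single i 1)))
      ≤ 4 * ∫ y, 1 / β ^ 2 * u y ^ (β + 1) *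
          ((fun j => fderiv ℝ χ y (EuclideanSpace.single j 1)) ⬝ᵥ
            (a y *ᵥ fun j => fderiv ℝ χ y (EuclideanSpace.single j 1))) := h
    _ = 4 / β ^ 2 * ∫ y, u y ^ (β + 1) *
          ((fun j => fderiv ℝ χ y (EuclideanSpace.single j 1)) ⬝ᵥ
            (a y *ᵥ fun j => fderiv ℝ χ y (EuclideanSpace.single j 1))) := by
        rw [← integral_const_mul, ← integral_const_mul]
        congr 1; funext y; ring

/-! ### Logarithmic Caccioppoli -/

/-- **LOGARITHMIC CACCIOPPOLI** (Moser 1961 §5): for a `C¹` weak solution `u ≥ 1` and `χ ∈ C¹_c`: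
`∫ χ² u^{−2} Du·aDu ≤ 4 ∫ Dχ·aDχ` (note `u^{−2} Du·aDu = D(log u)·aD(log u)`).
[cite: GilbargTrudinger2001, Theorem 8.18/8.20 proof §8.6 (local Caccioppoli inequalities)] -/
theorem caccioppoli_log_local (hsymm : ∀ y, (a y).IsSymm) (hlam : 0 < lam)
    (hmeas : ∀ i j, Measurable fun y => a y i j)
    (hell : ∀ y (ξ : Fin n → ℝ), lam * (ξ ⬝ᵥ ξ) ≤ ξ ⬝ᵥ (a y *ᵥ ξ)) (hbd : ∀ y i j, |a y i j| ≤ Λ)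
    (hu : ContDiff ℝ 1 u) (hu1 : ∀ y, 1 ≤ u y)
    (hweak : ∀ η : EuclideanSpace ℝ (Fin n) → ℝ, ContDiff ℝ 1 η → HasCompactSupport η → tsupport η ⊆ U →
      ∫ y, ∑ i, ∑ j, a y i j * fderiv ℝ u y (EuclideanSpace.single i 1) *
        fderiv ℝ η y (EuclideanSpace.single j 1) = 0)
    {χ : EuclideanSpace ℝ (Fin n) → ℝ} (hχ : ContDiff ℝ 1 χ) (hχc : HasCompactSupport χ)
    (hχU : tsupport χ ⊆ U) :
    ∫ y, χ y ^ 2 * (u y ^ 2)⁻¹ *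
        ((fun i => fderiv ℝ u y (EuclideanSpace.single i 1)) ⬝ᵥ
          (a y *ᵥ fun i => fderiv ℝ u y (EuclideanSpace.single i 1))) ≤
      4 * ∫ y, ((fun j => fderiv ℝ χ y (EuclideanSpace.single j 1)) ⬝ᵥ
          (a y *ᵥ fun j => fderiv ℝ χ y (EuclideanSpace.single j 1))) := by
  have hupos : ∀ y, 0 < u y := fun y => lt_of_lt_of_le one_pos (hu1 y)
  have hg' : ∀ s : ℝ, 1 / 2 < s → 0 < deriv (fun s : ℝ => -s⁻¹) s := by
    intro s hs
    have hs0 : (0 : ℝ) < s := by linarith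
    rw [deriv_neg_inv hs0.ne']
    positivity
  have h := caccioppoli_weighted_local hsymm hlam hmeas hell hbd hu hu1 hweak contDiffOn_neg_inv hg' hχ hχc hχU
  have h1 : ∀ y, deriv (fun s : ℝ => -s⁻¹) (u y) = (u y ^ 2)⁻¹ := fun y => deriv_neg_inv (hupos y).ne'
  have h2 : ∀ y, (-(u y)⁻¹) ^ 2 / (u y ^ 2)⁻¹ = 1 := by
    intro y
    have hy := (hupos y).ne'
    field_simp
  simp_rw [h1, h2, one_mul] at h
  exact h

end Literature.Analysis.PDE.DivForm.LocalCaccioppoli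

end

end Part1

/-!
## Part 2 — port of `Summits/NavierStokesRegularity/NavierStokesRegularity/Theorems/PoloidalWindowDoorPoloidalWindowRigidityDivFormLocalReverseHolder.lean`

# Route `PoloidalWindowDoor`, crux K2 (stmt-NavierStokesRegularity-19708) — LOCAL energy estimates for the Moser test
# functions `χ w^{q/2}` of `div(a∇w) = 0` on an open set `U` (towards `divFormStrongMaximumPrinciple_holds`, GT 8.19)

Local twin of `…DivFormReverseHolder` (seat ns-poloidal-K2-p3): the same two estimates, for a `C¹` function `w ≥ 1`
that solves `div(a∇w) = 0` weakly only against test functions with `tsupport η ⊆ U` (the hypothesis of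
`Literature.Analysis.PDE.divFormStrongMaximumPrinciple` and of line stub C1 of `Cruxes/PoloidalWindowRigidity/Lines/
thread_type.lean`), the cutoff `χ` carrying `tsupport χ ⊆ U`:

* `gradPow_estimate_local` — `λ ∫ χ² ‖D(w^{q/2})‖² ≤ (q/(q−1))² nΛ ∫ w^q ‖Dχ‖²`, `q ∉ {0,1}` (Moser 1961 (4.5));
* `energy_testPow_le_local` — for a two-radius cutoff of `B(x₀,ρ') ⊂ B(x₀,ρ)` with `‖Dχ‖ ≤ C₀/(ρ−ρ')`:
  `λ ∫ ‖D(χ w^{q/2})‖² ≤ 2((q/(q−1))² nΛ + λ)(C₀/(ρ−ρ'))² ∫_{B̄(x₀,ρ)} w^q`.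

Proofs copied from the sibling with the hypothesis localised (one extra argument threaded); the calculus helpers
(`contDiff_rpow_of_one_le`, `norm_fderiv_rpow_half_sq`, `norm_fderiv_mul_sq_le`, …) are imported from it.  Seat
ns-in-ser-b g5 (cell pub/ns-inputs), `ledger fact claim` #1 on `Literature.Analysis.PDE.divFormStrongMaximumPrinciple`.

WHAT THIS IS NOT: not yet the Moser step / Harnack / strong maximum principle (sequel files); nothing NS-specific, no NS
statement is touched.
-/

section Part2

noncomputable section

open _root_.MeasureTheory _root_.Set _root_.Function _root_.Filter _root_.Topology _root_.Metric
open scoped _root_.Matrix _root_.ENNReal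

namespace Literature.Analysis.PDE.DivForm.LocalReverseHolder

open Literature.Analysis.PDE.DivForm.Caccioppoli
open Literature.Analysis.PDE.DivForm.CaccioppoliPowers
open Literature.Analysis.PDE.DivForm.ReverseHolder
open Literature.Analysis.PDE.DivForm.LocalCaccioppoli
open Literature.Analysis.FunctionSpaces

variable {n : ℕ} {w : EuclideanSpace ℝ (Fin n) → ℝ} {a : EuclideanSpace ℝ (Fin n) → Matrix (Fin n) (Fin n) ℝ}
  {lam Λ : ℝ} {U : Set (EuclideanSpace ℝ (Fin n))}

/-! ### The gradient of `w^{q/2}`: local energy estimate -/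

/-- **Energy estimate for powers** (Moser 1961 (4.5)): for an entire `C¹` weak solution `w ≥ 1`, `q ∉ {0,1}` and
`χ ∈ C¹_c`: `λ ∫ χ² ‖D(w^{q/2})‖² ≤ (q/(q−1))² · nΛ · ∫ w^q ‖Dχ‖²`.
[cite: GilbargTrudinger2001, Theorem 8.18/8.20 proof §8.6 (local reverse Hölder)] -/
theorem gradPow_estimate_local (hsymm : ∀ y, (a y).IsSymm) (hlam : 0 < lam)
    (hmeas : ∀ i j, Measurable fun y => a y i j)
    (hell : ∀ y (ξ : Fin n → ℝ), lam * (ξ ⬝ᵥ ξ) ≤ ξ ⬝ᵥ (a y *ᵥ ξ)) (hbd : ∀ y i j, |a y i j| ≤ Λ)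
    (hw : ContDiff ℝ 1 w) (hw1 : ∀ y, 1 ≤ w y)
    (hweak : ∀ η : EuclideanSpace ℝ (Fin n) → ℝ, ContDiff ℝ 1 η → HasCompactSupport η → tsupport η ⊆ U →
      ∫ y, ∑ i, ∑ j, a y i j * fderiv ℝ w y (EuclideanSpace.single i 1) *
        fderiv ℝ η y (EuclideanSpace.single j 1) = 0)
    {q : ℝ} (hq0 : q ≠ 0) (hq1 : q ≠ 1)
    {χ : EuclideanSpace ℝ (Fin n) → ℝ} (hχ : ContDiff ℝ 1 χ) (hχc : HasCompactSupport χ)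
    (hχU : tsupport χ ⊆ U) :
    lam * ∫ y, χ y ^ 2 * ‖fderiv ℝ (fun y => w y ^ (q / 2)) y‖ ^ 2 ≤
      (q / (q - 1)) ^ 2 * (n * Λ) * ∫ y, w y ^ q * ‖fderiv ℝ χ y‖ ^ 2 := by
  have hpos : ∀ y, 0 < w y := fun y => lt_of_lt_of_le one_pos (hw1 y)
  have hβ : q - 1 ≠ 0 := sub_ne_zero.2 hq1
  have hC := caccioppoli_rpow_local hsymm hlam hmeas hell hbd hw hw1 hweak hβ hχ hχc hχU
  simp only [sub_add_cancel] at hC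
  have hcw := continuous_fderiv_single hw
  have hcχ := continuous_fderiv_single hχ
  -- continuity of the weights
  have hwq : ∀ s : ℝ, Continuous fun y => w y ^ s := fun s => (contDiff_rpow_of_one_le hw hw1 s).continuous
  have hnw : Continuous fun y => ‖fderiv ℝ w y‖ ^ 2 := ((hw.continuous_fderiv one_ne_zero).norm).pow 2
  have hnχ : Continuous fun y => ‖fderiv ℝ χ y‖ ^ 2 := ((hχ.continuous_fderiv one_ne_zero).norm).pow 2
  -- (1) left side: `λ χ² ‖D(w^{q/2})‖² = (q/2)² χ² w^{q−2} · λ‖Dw‖² ≤ (q/2)² χ² w^{(q−1)−1} Q(Dw)`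
  have hgC : ContDiff ℝ 1 fun y => w y ^ (q / 2) := contDiff_rpow_of_one_le hw hw1 (q / 2)
  have hng : Continuous fun y => ‖fderiv ℝ (fun y => w y ^ (q / 2)) y‖ ^ 2 :=
    ((hgC.continuous_fderiv one_ne_zero).norm).pow 2
  have hsuppχ2 : HasCompactSupport fun y => χ y ^ 2 := hχc.comp_left (g := fun s : ℝ => s ^ 2) (by simp)
  have hsuppL : HasCompactSupport fun y => χ y ^ 2 * ‖fderiv ℝ (fun y => w y ^ (q / 2)) y‖ ^ 2 :=
    hsuppχ2.mul_right (f' := fun y => ‖fderiv ℝ (fun y => w y ^ (q / 2)) y‖ ^ 2)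
  have hL_int : Integrable fun y => χ y ^ 2 * ‖fderiv ℝ (fun y => w y ^ (q / 2)) y‖ ^ 2 :=
    ((hχ.continuous.pow 2).mul hng).integrable_of_hasCompactSupport hsuppL
  have hQ_int : Integrable fun y => χ y ^ 2 * w y ^ (q - 1 - 1) *
      ((fun i => fderiv ℝ w y (EuclideanSpace.single i 1)) ⬝ᵥ
        (a y *ᵥ fun i => fderiv ℝ w y (EuclideanSpace.single i 1))) := by
    have h' := integrable_mul_of_le_continuous (n := n)
      (m := fun y => (fun i => fderiv ℝ w y (EuclideanSpace.single i 1)) ⬝ᵥ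
        (a y *ᵥ fun i => fderiv ℝ w y (EuclideanSpace.single i 1)))
      (M := fun y => n * Λ * (∑ i, fderiv ℝ w y (EuclideanSpace.single i 1) ^ 2 +
        ∑ j, fderiv ℝ w y (EuclideanSpace.single j 1) ^ 2) / 2)
      (φ := fun y => χ y ^ 2 * w y ^ (q - 1 - 1))
      (measurable_dotProduct_mulVec hmeas hcw hcw) (by fun_prop)
      (fun y => abs_dotProduct_mulVec_le hsymm hlam hell hbd y _ _) ((hχ.continuous.pow 2).mul (hwq _))
      (hasCompactSupport_testFun (u := w) (g := fun s => s ^ (q - 1 - 1)) hχc)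
    exact h'.congr (Eventually.of_forall fun y => by ring)
  have hL : lam * ∫ y, χ y ^ 2 * ‖fderiv ℝ (fun y => w y ^ (q / 2)) y‖ ^ 2 ≤
      (q / 2) ^ 2 * ∫ y, χ y ^ 2 * w y ^ (q - 1 - 1) *
        ((fun i => fderiv ℝ w y (EuclideanSpace.single i 1)) ⬝ᵥ
          (a y *ᵥ fun i => fderiv ℝ w y (EuclideanSpace.single i 1))) := by
    rw [← integral_const_mul, ← integral_const_mul]
    refine integral_mono (hL_int.const_mul lam) (hQ_int.const_mul _) fun y => ?_
    have hq := quadForm_lower hell y (fun i => fderiv ℝ w y (EuclideanSpace.single i 1))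
    rw [sum_fderiv_single_sq] at hq
    rw [norm_fderiv_rpow_half_sq hw hw1 q y, show q - 1 - 1 = q - 2 by ring]
    have hw0 : 0 ≤ χ y ^ 2 * w y ^ (q - 2) * (q / 2) ^ 2 :=
      mul_nonneg (mul_nonneg (sq_nonneg _) (Real.rpow_nonneg (hpos y).le _)) (sq_nonneg _)
    have hm := mul_le_mul_of_nonneg_left hq hw0
    calc lam * (χ y ^ 2 * ((q / 2) ^ 2 * w y ^ (q - 2) * ‖fderiv ℝ w y‖ ^ 2))
        = χ y ^ 2 * w y ^ (q - 2) * (q / 2) ^ 2 * (lam * ‖fderiv ℝ w y‖ ^ 2) := by ring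
      _ ≤ χ y ^ 2 * w y ^ (q - 2) * (q / 2) ^ 2 *
          ((fun i => fderiv ℝ w y (EuclideanSpace.single i 1)) ⬝ᵥ
            (a y *ᵥ fun i => fderiv ℝ w y (EuclideanSpace.single i 1))) := hm
      _ = (q / 2) ^ 2 * (χ y ^ 2 * w y ^ (q - 2) *
          ((fun i => fderiv ℝ w y (EuclideanSpace.single i 1)) ⬝ᵥ
            (a y *ᵥ fun i => fderiv ℝ w y (EuclideanSpace.single i 1)))) := by ring
  -- (2) right side: `Q(Dχ) ≤ nΛ ‖Dχ‖²`
  have hR_int : Integrable fun y => w y ^ q * ‖fderiv ℝ χ y‖ ^ 2 := by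
    refine ((hwq q).mul hnχ).integrable_of_hasCompactSupport ?_
    exact ((hχc.fderiv (𝕜 := ℝ)).norm.comp_left (g := fun s : ℝ => s ^ 2) (by simp)).mul_left
  have hRq_int : Integrable fun y => w y ^ q *
      ((fun j => fderiv ℝ χ y (EuclideanSpace.single j 1)) ⬝ᵥ
        (a y *ᵥ fun j => fderiv ℝ χ y (EuclideanSpace.single j 1))) := by
    refine (hR_int.const_mul (n * Λ)).mono'
      ((hwq q).aestronglyMeasurable.mul (measurable_dotProduct_mulVec hmeas hcχ hcχ).aestronglyMeasurable)
      (Eventually.of_forall fun y => ?_)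
    have hq0' : 0 ≤ ((fun j => fderiv ℝ χ y (EuclideanSpace.single j 1)) ⬝ᵥ
        (a y *ᵥ fun j => fderiv ℝ χ y (EuclideanSpace.single j 1))) :=
      (mul_nonneg hlam.le (Finset.sum_nonneg fun i _ => sq_nonneg _)).trans (quadForm_lower hell y _)
    have hup := quadForm_upper hbd y (fun j => fderiv ℝ χ y (EuclideanSpace.single j 1))
    rw [sum_fderiv_single_sq] at hup
    rw [Real.norm_eq_abs, abs_of_nonneg (mul_nonneg (Real.rpow_nonneg (hpos y).le _) hq0')]
    calc w y ^ q * ((fun j => fderiv ℝ χ y (EuclideanSpace.single j 1)) ⬝ᵥ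
          (a y *ᵥ fun j => fderiv ℝ χ y (EuclideanSpace.single j 1)))
        ≤ w y ^ q * (n * Λ * ‖fderiv ℝ χ y‖ ^ 2) := mul_le_mul_of_nonneg_left hup (Real.rpow_nonneg (hpos y).le _)
      _ = n * Λ * (w y ^ q * ‖fderiv ℝ χ y‖ ^ 2) := by ring
  have hR : ∫ y, w y ^ q * ((fun j => fderiv ℝ χ y (EuclideanSpace.single j 1)) ⬝ᵥ
        (a y *ᵥ fun j => fderiv ℝ χ y (EuclideanSpace.single j 1))) ≤
      n * Λ * ∫ y, w y ^ q * ‖fderiv ℝ χ y‖ ^ 2 := by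
    rw [← integral_const_mul]
    refine integral_mono hRq_int (hR_int.const_mul _) fun y => ?_
    have hup := quadForm_upper hbd y (fun j => fderiv ℝ χ y (EuclideanSpace.single j 1))
    rw [sum_fderiv_single_sq] at hup
    calc w y ^ q * ((fun j => fderiv ℝ χ y (EuclideanSpace.single j 1)) ⬝ᵥ
          (a y *ᵥ fun j => fderiv ℝ χ y (EuclideanSpace.single j 1)))
        ≤ w y ^ q * (n * Λ * ‖fderiv ℝ χ y‖ ^ 2) := mul_le_mul_of_nonneg_left hup (Real.rpow_nonneg (hpos y).le _)
      _ = n * Λ * (w y ^ q * ‖fderiv ℝ χ y‖ ^ 2) := by ring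
  -- assemble: `λ∫χ²‖Dg‖² ≤ (q/2)² · (4/(q−1)²) ∫ w^q Q(Dχ) ≤ (q/(q−1))² nΛ ∫ w^q ‖Dχ‖²`
  have hq2 : 0 ≤ (q / 2) ^ 2 := sq_nonneg _
  calc lam * ∫ y, χ y ^ 2 * ‖fderiv ℝ (fun y => w y ^ (q / 2)) y‖ ^ 2
      ≤ (q / 2) ^ 2 * ∫ y, χ y ^ 2 * w y ^ (q - 1 - 1) *
          ((fun i => fderiv ℝ w y (EuclideanSpace.single i 1)) ⬝ᵥ
            (a y *ᵥ fun i => fderiv ℝ w y (EuclideanSpace.single i 1))) := hL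
    _ ≤ (q / 2) ^ 2 * (4 / (q - 1) ^ 2 * ∫ y, w y ^ q *
          ((fun j => fderiv ℝ χ y (EuclideanSpace.single j 1)) ⬝ᵥ
            (a y *ᵥ fun j => fderiv ℝ χ y (EuclideanSpace.single j 1)))) :=
        mul_le_mul_of_nonneg_left hC hq2
    _ ≤ (q / 2) ^ 2 * (4 / (q - 1) ^ 2 * (n * Λ * ∫ y, w y ^ q * ‖fderiv ℝ χ y‖ ^ 2)) :=
        mul_le_mul_of_nonneg_left (mul_le_mul_of_nonneg_left hR (by positivity)) hq2
    _ = (q / (q - 1)) ^ 2 * (n * Λ) * ∫ y, w y ^ q * ‖fderiv ℝ χ y‖ ^ 2 := by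
        field_simp
        ring

/-- **Energy of the Moser test function.**  For an entire `C¹` weak solution `w ≥ 1`, `q ∉ {0,1}`, and a two-radius cutoff
`χ` of `B(x₀,ρ') ⊂ B(x₀,ρ)` with `‖Dχ‖ ≤ C₀/(ρ−ρ')` and `χ = 0` off `B(x₀,ρ)`:
`λ ∫ ‖D(χ w^{q/2})‖² ≤ 2 ((q/(q−1))² nΛ + λ) (C₀/(ρ−ρ'))² ∫_{B̄(x₀,ρ)} w^q`.
[cite: GilbargTrudinger2001, Theorem 8.18/8.20 proof §8.6 (local reverse Hölder)] -/
theorem energy_testPow_le_local (hsymm : ∀ y, (a y).IsSymm) (hlam : 0 < lam)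
    (hmeas : ∀ i j, Measurable fun y => a y i j)
    (hell : ∀ y (ξ : Fin n → ℝ), lam * (ξ ⬝ᵥ ξ) ≤ ξ ⬝ᵥ (a y *ᵥ ξ)) (hbd : ∀ y i j, |a y i j| ≤ Λ)
    (hw : ContDiff ℝ 1 w) (hw1 : ∀ y, 1 ≤ w y)
    (hweak : ∀ η : EuclideanSpace ℝ (Fin n) → ℝ, ContDiff ℝ 1 η → HasCompactSupport η → tsupport η ⊆ U →
      ∫ y, ∑ i, ∑ j, a y i j * fderiv ℝ w y (EuclideanSpace.single i 1) *
        fderiv ℝ η y (EuclideanSpace.single j 1) = 0)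
    {q : ℝ} (hq0 : q ≠ 0) (hq1 : q ≠ 1) {x₀ : EuclideanSpace ℝ (Fin n)} {ρ' ρ C₀ : ℝ}
    {χ : EuclideanSpace ℝ (Fin n) → ℝ} (hχ : ContDiff ℝ 1 χ) (hχc : HasCompactSupport χ) (hχU : tsupport χ ⊆ U)
    (hχ0 : ∀ x, x ∉ ball x₀ ρ → χ x = 0) (hχD : ∀ x, ‖fderiv ℝ χ x‖ ≤ C₀ / (ρ - ρ')) :
    lam * ∫ y, ‖fderiv ℝ (fun y => χ y * w y ^ (q / 2)) y‖ ^ 2 ≤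
      2 * ((q / (q - 1)) ^ 2 * (n * Λ) + lam) * (C₀ / (ρ - ρ')) ^ 2 * ∫ y in closedBall x₀ ρ, w y ^ q := by
  have hpos : ∀ y, 0 < w y := fun y => lt_of_lt_of_le one_pos (hw1 y)
  have hG := gradPow_estimate_local hsymm hlam hmeas hell hbd hw hw1 hweak hq0 hq1 hχ hχc hχU
  have hgC : ContDiff ℝ 1 fun y => w y ^ (q / 2) := contDiff_rpow_of_one_le hw hw1 (q / 2)
  have hwq : ∀ s : ℝ, Continuous fun y => w y ^ s := fun s => (contDiff_rpow_of_one_le hw hw1 s).continuous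
  have hng : Continuous fun y => ‖fderiv ℝ (fun y => w y ^ (q / 2)) y‖ ^ 2 :=
    ((hgC.continuous_fderiv one_ne_zero).norm).pow 2
  have hnχ : Continuous fun y => ‖fderiv ℝ χ y‖ ^ 2 := ((hχ.continuous_fderiv one_ne_zero).norm).pow 2
  have hg2 : ∀ y, (w y ^ (q / 2)) ^ 2 = w y ^ q := fun y => by
    rw [← Real.rpow_natCast, ← Real.rpow_mul (hpos y).le]; congr 1; push_cast; ring
  -- compact supports
  have hsuppχ2 : HasCompactSupport fun y => χ y ^ 2 := hχc.comp_left (g := fun s : ℝ => s ^ 2) (by simp)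
  have hsuppDχ : HasCompactSupport fun y => ‖fderiv ℝ χ y‖ ^ 2 :=
    (hχc.fderiv (𝕜 := ℝ)).norm.comp_left (g := fun s : ℝ => s ^ 2) (by simp)
  have hsuppφ : HasCompactSupport fun y => χ y * w y ^ (q / 2) := hχc.mul_right (f' := fun y => w y ^ (q / 2))
  -- integrability
  have hI1 : Integrable fun y => χ y ^ 2 * ‖fderiv ℝ (fun y => w y ^ (q / 2)) y‖ ^ 2 :=
    ((hχ.continuous.pow 2).mul hng).integrable_of_hasCompactSupport
      (hsuppχ2.mul_right (f' := fun y => ‖fderiv ℝ (fun y => w y ^ (q / 2)) y‖ ^ 2))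
  have hI2 : Integrable fun y => w y ^ q * ‖fderiv ℝ χ y‖ ^ 2 :=
    ((hwq q).mul hnχ).integrable_of_hasCompactSupport (hsuppDχ.mul_left (f := fun y => w y ^ q))
  have hφC : ContDiff ℝ 1 fun y => χ y * w y ^ (q / 2) := hχ.mul hgC
  have hnφ : Continuous fun y => ‖fderiv ℝ (fun y => χ y * w y ^ (q / 2)) y‖ ^ 2 :=
    ((hφC.continuous_fderiv one_ne_zero).norm).pow 2
  have hsuppDφ0 : HasCompactSupport (fderiv ℝ fun y => χ y * w y ^ (q / 2)) := hsuppφ.fderiv (𝕜 := ℝ)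
  have hsuppDφ : HasCompactSupport fun y => ‖fderiv ℝ (fun y => χ y * w y ^ (q / 2)) y‖ ^ 2 := by
    refine hsuppDφ0.norm.mono (Function.support_subset_iff'.2 fun y hy => ?_)
    simp only [Function.mem_support, not_not] at hy
    simp [hy]
  have hIφ : Integrable fun y => ‖fderiv ℝ (fun y => χ y * w y ^ (q / 2)) y‖ ^ 2 :=
    hnφ.integrable_of_hasCompactSupport hsuppDφ
  -- (1) `∫ ‖Dφ‖² ≤ 2 ∫ χ²‖Dg‖² + 2 ∫ w^q ‖Dχ‖²`
  have h1 : ∫ y, ‖fderiv ℝ (fun y => χ y * w y ^ (q / 2)) y‖ ^ 2 ≤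
      2 * (∫ y, χ y ^ 2 * ‖fderiv ℝ (fun y => w y ^ (q / 2)) y‖ ^ 2) + 2 * (∫ y, w y ^ q * ‖fderiv ℝ χ y‖ ^ 2) := by
    rw [← integral_const_mul, ← integral_const_mul, ← integral_add (hI1.const_mul 2) (hI2.const_mul 2)]
    refine integral_mono hIφ ((hI1.const_mul 2).add (hI2.const_mul 2)) fun y => ?_
    have h := norm_fderiv_mul_sq_le hχ hgC y
    rw [hg2 y] at h
    simp only
    linarith
  -- (2) `∫ w^q ‖Dχ‖² ≤ (C₀/(ρ−ρ'))² ∫_{B̄(x₀,ρ)} w^q`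
  have hDχ_out : ∀ x, x ∉ closedBall x₀ ρ → fderiv ℝ χ x = 0 := by
    intro x hx
    have hev : χ =ᶠ[𝓝 x] fun _ => 0 := by
      filter_upwards [isClosed_closedBall.isOpen_compl.mem_nhds hx] with z hz
      exact hχ0 z fun hz' => hz (ball_subset_closedBall hz')
    rw [hev.fderiv_eq, fderiv_const_apply]
  have h2 : ∫ y, w y ^ q * ‖fderiv ℝ χ y‖ ^ 2 ≤ (C₀ / (ρ - ρ')) ^ 2 * ∫ y in closedBall x₀ ρ, w y ^ q := by
    have heq : ∫ y, w y ^ q * ‖fderiv ℝ χ y‖ ^ 2 = ∫ y in closedBall x₀ ρ, w y ^ q * ‖fderiv ℝ χ y‖ ^ 2 := by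
      refine (setIntegral_eq_integral_of_forall_compl_eq_zero fun y hy => ?_).symm
      rw [hDχ_out y hy, norm_zero, zero_pow two_ne_zero, mul_zero]
    rw [heq, ← integral_const_mul]
    have hIw : IntegrableOn (fun y => w y ^ q) (closedBall x₀ ρ) :=
      (hwq q).continuousOn.integrableOn_compact (isCompact_closedBall _ _)
    refine setIntegral_mono_on hI2.integrableOn (hIw.const_mul _) measurableSet_closedBall fun y _ => ?_
    have hwq0 : 0 ≤ w y ^ q := Real.rpow_nonneg (hpos y).le _
    calc w y ^ q * ‖fderiv ℝ χ y‖ ^ 2 ≤ w y ^ q * (C₀ / (ρ - ρ')) ^ 2 :=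
          mul_le_mul_of_nonneg_left (pow_le_pow_left₀ (norm_nonneg _) (hχD y) 2) hwq0
      _ = (C₀ / (ρ - ρ')) ^ 2 * w y ^ q := mul_comm _ _
  -- assemble
  have hI0 : 0 ≤ ∫ y in closedBall x₀ ρ, w y ^ q :=
    setIntegral_nonneg measurableSet_closedBall fun y _ => Real.rpow_nonneg (hpos y).le _
  have hnΛq : 0 ≤ (q / (q - 1)) ^ 2 * (n * Λ) := by
    rcases Nat.eq_zero_or_pos n with hn | hn
    · simp [hn]
    · exact mul_nonneg (sq_nonneg _) (mul_nonneg (Nat.cast_nonneg n) ((abs_nonneg _).trans (hbd x₀ ⟨0, hn⟩ ⟨0, hn⟩)))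
  calc lam * ∫ y, ‖fderiv ℝ (fun y => χ y * w y ^ (q / 2)) y‖ ^ 2
      ≤ lam * (2 * (∫ y, χ y ^ 2 * ‖fderiv ℝ (fun y => w y ^ (q / 2)) y‖ ^ 2) +
          2 * (∫ y, w y ^ q * ‖fderiv ℝ χ y‖ ^ 2)) := mul_le_mul_of_nonneg_left h1 hlam.le
    _ = 2 * (lam * ∫ y, χ y ^ 2 * ‖fderiv ℝ (fun y => w y ^ (q / 2)) y‖ ^ 2) +
          2 * lam * (∫ y, w y ^ q * ‖fderiv ℝ χ y‖ ^ 2) := by ring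
    _ ≤ 2 * ((q / (q - 1)) ^ 2 * (n * Λ) * ∫ y, w y ^ q * ‖fderiv ℝ χ y‖ ^ 2) +
          2 * lam * (∫ y, w y ^ q * ‖fderiv ℝ χ y‖ ^ 2) := by
        have := mul_le_mul_of_nonneg_left hG (by norm_num : (0 : ℝ) ≤ 2)
        linarith
    _ = 2 * ((q / (q - 1)) ^ 2 * (n * Λ) + lam) * ∫ y, w y ^ q * ‖fderiv ℝ χ y‖ ^ 2 := by ring
    _ ≤ 2 * ((q / (q - 1)) ^ 2 * (n * Λ) + lam) * ((C₀ / (ρ - ρ')) ^ 2 * ∫ y in closedBall x₀ ρ, w y ^ q) :=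
        mul_le_mul_of_nonneg_left h2 (by positivity)
    _ = 2 * ((q / (q - 1)) ^ 2 * (n * Λ) + lam) * (C₀ / (ρ - ρ')) ^ 2 * ∫ y in closedBall x₀ ρ, w y ^ q := by
        ring

end Literature.Analysis.PDE.DivForm.LocalReverseHolder

end

end Part2

/-!
## Part 3 — port of `Summits/NavierStokesRegularity/NavierStokesRegularity/Theorems/PoloidalWindowDoorPoloidalWindowRigidityDivFormLocalMoser.lean`

# Route `PoloidalWindowDoor`, crux K2 (stmt-NavierStokesRegularity-19708) — LOCAL Moser iteration for `div(a∇w) = 0`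
# on an open set `U`: reverse Hölder step and the sup/inf chain between two balls (towards
# `divFormStrongMaximumPrinciple_holds`, GT 8.19, via an interior Harnack inequality)

Local twin of `…DivFormMoserStep.moser_step` / `…DivFormMoserChain.moser_chain_sup` (seat ns-poloidal-K2-p3), `n ≥ 3`,
`κ = n/(n−2)`: the weak equation is assumed only against test functions with `tsupport η ⊆ U` (hypothesis of
`Literature.Analysis.PDE.divFormStrongMaximumPrinciple`), and the balls carry `B̄(x₀,ρ) ⊆ U`; in exchange the chain is
stated between two ARBITRARY concentric balls `B̄(x₀,r') ⊂ B̄(x₀,r)` with the constant `(K/(r−r')²)^{κ/(p₀(κ−1))}` —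
the `(r−r')^{−n/p₀}` blow-up is what the Bombieri–Giusti lemma of the sequel consumes in place of the John–Nirenberg
crossover (which does not localise).

* `moser_step_local` — `‖w^σ‖_{L^{pκ}(B̄(x₀,ρ'))} ≤ (C_S²·2((q/(q−1))²nΛ+λ)/λ·(C₀/(ρ−ρ'))²)^{1/p} ‖w^σ‖_{L^p(B̄(x₀,ρ))}`;
* `moser_chain_local` — `‖w^σ‖_{L^∞(B̄(x₀,r'))} ≤ (K/(r−r')²)^{κ/(p₀(κ−1))} 4^{κ/(p₀(κ−1)²)} ‖w^σ‖_{L^{p₀}(B̄(x₀,r))}`.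

Proofs copied from the siblings with the hypothesis localised and the radii `R(1+2^{−k})` replaced by
`r' + (r−r')2^{−k}`; `eLpNorm_rpow_eq`, `lintegral_enorm_fderiv_sq`, `contDiff_rpow_of_one_le` and the abstract iteration
lemma `Literature.Analysis.FunctionSpaces.eLpNorm_top_le_of_moser_chain` are imported.  Seat ns-in-ser-b g5 (cell
pub/ns-inputs), `ledger fact claim` #1 on `Literature.Analysis.PDE.divFormStrongMaximumPrinciple`.

WHAT THIS IS NOT: not yet Harnack / the strong maximum principle; nothing NS-specific, no NS statement is touched.
-/

section Part3

noncomputable section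

open _root_.MeasureTheory _root_.Set _root_.Function _root_.Filter _root_.Topology _root_.Metric _root_.Module
open scoped _root_.Matrix _root_.ENNReal _root_.NNReal

namespace Literature.Analysis.PDE.DivForm.LocalMoser

open Literature.Analysis.PDE.DivForm.Caccioppoli
open Literature.Analysis.PDE.DivForm.ReverseHolder
open Literature.Analysis.PDE.DivForm.MoserStep
open Literature.Analysis.PDE.DivForm.LocalReverseHolder
open Literature.Analysis.FunctionSpaces

variable {n : ℕ} {a : EuclideanSpace ℝ (Fin n) → Matrix (Fin n) (Fin n) ℝ} {lam Λ : ℝ}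
  {w : EuclideanSpace ℝ (Fin n) → ℝ} {U : Set (EuclideanSpace ℝ (Fin n))}

/-! ### The local reverse Hölder step -/

/-- **MOSER'S REVERSE HÖLDER STEP** (Moser 1961 §4; Gilbarg–Trudinger, proof of Thm 8.18), `n ≥ 3`, `κ = n/(n−2)`:
for a `C¹` function `w ≥ 1` solving `div(a∇w) = 0` weakly against tests supported in `U ⊇ B̄(x₀,ρ)`, `σ = ±1`, `p > 0` with `σp ≠ 1`, `0 < ρ' < ρ`, and a cutoff constant `C₀`
as in `exists_closedBall_cutoff`,
`‖w^σ‖_{L^{pκ}(B̄(x₀,ρ'))} ≤ (C_S² · 2((q/(q−1))²nΛ+λ)/λ · (C₀/(ρ−ρ'))²)^{1/p} ‖w^σ‖_{L^p(B̄(x₀,ρ))}`, `q = σp`,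
`C_S` = Mathlib's Sobolev constant `eLpNormLESNormFDerivOfEqInnerConst volume 2`.
[cite: GilbargTrudinger2001, Theorem 8.18/8.20 proof §8.6 (local Moser iteration)] -/
theorem moser_step_local (hn : 3 ≤ n) (hsymm : ∀ y, (a y).IsSymm) (hlam : 0 < lam)
    (hmeas : ∀ i j, Measurable fun y => a y i j)
    (hell : ∀ y (ξ : Fin n → ℝ), lam * (ξ ⬝ᵥ ξ) ≤ ξ ⬝ᵥ (a y *ᵥ ξ)) (hbd : ∀ y i j, |a y i j| ≤ Λ)
    (hw : ContDiff ℝ 1 w) (hw1 : ∀ y, 1 ≤ w y)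
    (hweak : ∀ η : EuclideanSpace ℝ (Fin n) → ℝ, ContDiff ℝ 1 η → HasCompactSupport η → tsupport η ⊆ U →
      ∫ y, ∑ i, ∑ j, a y i j * fderiv ℝ w y (EuclideanSpace.single i 1) *
        fderiv ℝ η y (EuclideanSpace.single j 1) = 0)
    {σ : ℝ} (hσ : σ = 1 ∨ σ = -1) {p : ℝ} (hp : 0 < p) (hq1 : σ * p ≠ 1)
    {C₀ : ℝ} (hcut : ∀ (x₀ : EuclideanSpace ℝ (Fin n)) (ρ' ρ : ℝ), 0 < ρ' → ρ' < ρ →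
      ∃ χ : EuclideanSpace ℝ (Fin n) → ℝ, ContDiff ℝ 1 χ ∧ HasCompactSupport χ ∧ (∀ x, 0 ≤ χ x ∧ χ x ≤ 1) ∧
        (∀ x ∈ closedBall x₀ ρ', χ x = 1) ∧ (∀ x, x ∉ ball x₀ ρ → χ x = 0) ∧ ∀ x, ‖fderiv ℝ χ x‖ ≤ C₀ / (ρ - ρ'))
    (x₀ : EuclideanSpace ℝ (Fin n)) {ρ' ρ : ℝ} (hρ' : 0 < ρ') (hρ : ρ' < ρ)
    (hU : closedBall x₀ ρ ⊆ U) :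
    eLpNorm (fun y => w y ^ σ) (ENNReal.ofReal (p * (n / (n - 2 : ℝ)))) (volume.restrict (closedBall x₀ ρ')) ≤
      ENNReal.ofReal ((eLpNormLESNormFDerivOfEqInnerConst (volume : Measure (EuclideanSpace ℝ (Fin n))) 2 : ℝ) ^ 2 *
          (2 * ((σ * p / (σ * p - 1)) ^ 2 * (n * Λ) + lam) / lam * (C₀ / (ρ - ρ')) ^ 2)) ^ (1 / p) *
        eLpNorm (fun y => w y ^ σ) (ENNReal.ofReal p) (volume.restrict (closedBall x₀ ρ)) := by
  -- notation and positivity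
  set q : ℝ := σ * p with hq
  set κ : ℝ := n / (n - 2 : ℝ) with hκ
  set CS : ℝ≥0 := eLpNormLESNormFDerivOfEqInnerConst (volume : Measure (EuclideanSpace ℝ (Fin n))) 2 with hCS
  set M₀ : ℝ := 2 * ((q / (q - 1)) ^ 2 * (n * Λ) + lam) / lam * (C₀ / (ρ - ρ')) ^ 2 with hM₀
  have hn2 : (0 : ℝ) < n - 2 := by
    have : (3 : ℝ) ≤ n := by exact_mod_cast hn
    linarith
  have hnpos : (0 : ℝ) < n := by linarith
  have hκpos : 0 < κ := by rw [hκ]; positivity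
  have hpos : ∀ y, 0 < w y := fun y => lt_of_lt_of_le one_pos (hw1 y)
  have hq0 : q ≠ 0 := by
    rw [hq]; rcases hσ with h | h <;> simp [h, hp.ne']
  have hnΛ : 0 ≤ (n : ℝ) * Λ :=
    mul_nonneg (Nat.cast_nonneg n) ((abs_nonneg _).trans (hbd x₀ ⟨0, by omega⟩ ⟨0, by omega⟩))
  have hM₀nn : 0 ≤ M₀ := by rw [hM₀]; positivity
  -- the cutoff and the test function
  obtain ⟨χ, hχ, hχc, hχ01, hχ1, hχ0, hχD⟩ := hcut x₀ ρ' ρ hρ' hρ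
  have hχU : tsupport χ ⊆ U := by
    refine (closure_minimal (fun x hx => ?_) isClosed_closedBall).trans hU
    by_contra h
    exact hx (hχ0 x fun hb => h (ball_subset_closedBall hb))
  have hgC : ContDiff ℝ 1 fun y => w y ^ (q / 2) := contDiff_rpow_of_one_le hw hw1 (q / 2)
  have hφC : ContDiff ℝ 1 fun y => χ y * w y ^ (q / 2) := hχ.mul hgC
  have hφc : HasCompactSupport fun y => χ y * w y ^ (q / 2) := hχc.mul_right (f' := fun y => w y ^ (q / 2))
  -- (E) energy: `λ ∫ ‖Dφ‖² ≤ λ M₀ ∫_{B̄ρ} w^q`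
  have hE := energy_testPow_le_local hsymm hlam hmeas hell hbd hw hw1 hweak hq0 hq1 hχ hχc hχU hχ0 hχD (x₀ := x₀)
  have hY0 : 0 ≤ ∫ y in closedBall x₀ ρ, w y ^ q :=
    setIntegral_nonneg measurableSet_closedBall fun y _ => Real.rpow_nonneg (hpos y).le _
  have hE' : ∫ y, ‖fderiv ℝ (fun y => χ y * w y ^ (q / 2)) y‖ ^ 2 ≤ M₀ * ∫ y in closedBall x₀ ρ, w y ^ q := by
    rw [← le_div_iff₀' hlam] at hE
    refine hE.trans (le_of_eq ?_)
    rw [hM₀]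
    field_simp
  -- (S) Sobolev: `‖φ‖_{2κ} ≤ C_S ‖Dφ‖₂`
  have hfin : finrank ℝ (EuclideanSpace ℝ (Fin n)) = n := finrank_euclideanSpace_fin
  have hp'inv : ((Real.toNNReal (2 * κ) : ℝ≥0) : ℝ)⁻¹ = (2 : ℝ≥0)⁻¹ - (finrank ℝ (EuclideanSpace ℝ (Fin n)) : ℝ)⁻¹ := by
    rw [Real.coe_toNNReal _ (by positivity), hfin, hκ]
    push_cast
    field_simp
  have hS := eLpNorm_le_eLpNorm_fderiv_of_eq_inner (μ := (volume : Measure (EuclideanSpace ℝ (Fin n)))) hφC hφc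
    (p := 2) (p' := Real.toNNReal (2 * κ)) (by norm_num) (by rw [hfin]; omega) hp'inv
  -- (A) `‖Dφ‖₂ ≤ (M₀ · Z)^{1/2}`, `Z = ∫⁻_{B̄ρ} w^q`
  set Z : ℝ≥0∞ := ∫⁻ y in closedBall x₀ ρ, ENNReal.ofReal (w y ^ q) with hZ
  have hZeq : ENNReal.ofReal (∫ y in closedBall x₀ ρ, w y ^ q) = Z := by
    rw [hZ, ofReal_integral_eq_lintegral_ofReal]
    · exact ((contDiff_rpow_of_one_le hw hw1 q).continuous.continuousOn.integrableOn_compact (isCompact_closedBall _ _))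
    · exact Eventually.of_forall fun y => Real.rpow_nonneg (hpos y).le _
  have hA : eLpNorm (fderiv ℝ fun y => χ y * w y ^ (q / 2)) 2 volume ≤ (ENNReal.ofReal M₀ * Z) ^ (1 / 2 : ℝ) := by
    rw [eLpNorm_eq_lintegral_rpow_enorm_toReal two_ne_zero ENNReal.ofNat_ne_top, ENNReal.toReal_ofNat,
      lintegral_enorm_fderiv_sq hφC hφc]
    refine ENNReal.rpow_le_rpow ?_ (by norm_num)
    rw [← hZeq, ← ENNReal.ofReal_mul hM₀nn]
    exact ENNReal.ofReal_le_ofReal hE'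
  -- (B) `X^{1/(2κ)} ≤ ‖φ‖_{2κ}`, `X = ∫⁻_{B̄ρ'} w^{qκ}`
  set X : ℝ≥0∞ := ∫⁻ y in closedBall x₀ ρ', ENNReal.ofReal (w y ^ (q * κ)) with hX
  have hcoe : ((Real.toNNReal (2 * κ) : ℝ≥0) : ℝ≥0∞) = ENNReal.ofReal (2 * κ) := rfl
  have hB : X ^ (1 / (2 * κ)) ≤ eLpNorm (fun y => χ y * w y ^ (q / 2)) (Real.toNNReal (2 * κ)) volume := by
    have hres : eLpNorm (fun y => χ y * w y ^ (q / 2)) (Real.toNNReal (2 * κ)) (volume.restrict (closedBall x₀ ρ')) ≤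
        eLpNorm (fun y => χ y * w y ^ (q / 2)) (Real.toNNReal (2 * κ)) volume :=
      eLpNorm_mono_measure _ Measure.restrict_le_self
    refine le_trans (le_of_eq ?_) hres
    rw [hcoe, eLpNorm_eq_lintegral_rpow_enorm_toReal (ENNReal.ofReal_pos.2 (by positivity)).ne' ENNReal.ofReal_ne_top,
      ENNReal.toReal_ofReal (by positivity), hX]
    congr 1
    refine setLIntegral_congr_fun measurableSet_closedBall fun y hy => ?_
    rw [hχ1 y hy, one_mul, Real.enorm_eq_ofReal (Real.rpow_nonneg (hpos y).le _),
      ENNReal.ofReal_rpow_of_nonneg (Real.rpow_nonneg (hpos y).le _) (by positivity), ← Real.rpow_mul (hpos y).le]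
    congr 2
    ring
  -- (C) combine: `X^{1/(2κ)} ≤ C_S (M₀ Z)^{1/2}`
  have hC : X ^ (1 / (2 * κ)) ≤ (CS : ℝ≥0∞) * (ENNReal.ofReal M₀ * Z) ^ (1 / 2 : ℝ) :=
    hB.trans (hS.trans (mul_le_mul' le_rfl hA))
  -- (D) raise to the power `2/p` and identify the `eLpNorm`s
  have hD := ENNReal.rpow_le_rpow hC (by positivity : (0 : ℝ) ≤ 2 / p)
  have hL : eLpNorm (fun y => w y ^ σ) (ENNReal.ofReal (p * κ)) (volume.restrict (closedBall x₀ ρ')) =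
      (X ^ (1 / (2 * κ))) ^ (2 / p) := by
    rw [eLpNorm_rpow_eq _ hpos σ (by positivity : 0 < p * κ), ← ENNReal.rpow_mul, hX]
    have h1 : σ * (p * κ) = q * κ := by rw [hq]; ring
    have h2 : 1 / (p * κ) = 1 / (2 * κ) * (2 / p) := by field_simp
    rw [h1, h2]
  have hR : eLpNorm (fun y => w y ^ σ) (ENNReal.ofReal p) (volume.restrict (closedBall x₀ ρ)) = Z ^ (1 / p) := by
    rw [eLpNorm_rpow_eq _ hpos σ hp, hZ]
  have hCS2 : ENNReal.ofReal ((CS : ℝ) ^ 2 * M₀) = (CS : ℝ≥0∞) ^ 2 * ENNReal.ofReal M₀ := by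
    rw [ENNReal.ofReal_mul (sq_nonneg _), ENNReal.ofReal_pow (NNReal.coe_nonneg _), ENNReal.ofReal_coe_nnreal]
  have key : ∀ m z : ℝ≥0∞, ((CS : ℝ≥0∞) * (m * z) ^ (1 / 2 : ℝ)) ^ (2 / p) =
      ((CS : ℝ≥0∞) ^ 2 * m) ^ (1 / p) * z ^ (1 / p) := by
    intro m z
    rw [ENNReal.mul_rpow_of_nonneg _ _ (by positivity : (0 : ℝ) ≤ 2 / p), ← ENNReal.rpow_mul,
      show (1 / 2 : ℝ) * (2 / p) = 1 / p by field_simp,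
      ENNReal.mul_rpow_of_nonneg m z (by positivity : (0 : ℝ) ≤ 1 / p),
      ENNReal.mul_rpow_of_nonneg _ m (by positivity : (0 : ℝ) ≤ 1 / p), ← mul_assoc]
    congr 2
    rw [← ENNReal.rpow_natCast, ← ENNReal.rpow_mul]
    congr 1
    push_cast
    field_simp
  rw [hL, hR, hCS2, ← key]
  exact hD

/-! ### The Moser chain between two concentric balls -/

/-- **MOSER ITERATION, local boundedness of `w^σ`** (Moser 1961 §4; Gilbarg–Trudinger Thm 8.18, proof), `n ≥ 3`,
`κ = n/(n−2)`, LOCAL form with two free radii: for a `C¹` function `w ≥ 1` solving `div(a∇w) = 0` weakly against tests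
supported in `U ⊇ B̄(x₀,r)`, `σ = ±1`, `p₀ > 0` such that along the chain `p_k = p₀κ^k` no `σp_k` equals `1` and
`(σp_k/(σp_k−1))² ≤ D`, and radii `0 < r' < r`:
`‖w^σ‖_{L^∞(B̄(x₀,r'))} ≤ (K/(r−r')²)^{κ/(p₀(κ−1))} 4^{κ/(p₀(κ−1)²)} ‖w^σ‖_{L^{p₀}(B̄(x₀,r))}`,
`K = max(C_S,1)² · 2(DnΛ + λ)/λ · 4C₀²` (`C_S` Mathlib's Sobolev constant, `C₀` the cutoff constant).
[cite: GilbargTrudinger2001, Theorem 8.18/8.20 proof §8.6 (local Moser iteration)] -/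
theorem moser_chain_local (hn : 3 ≤ n) (hsymm : ∀ y, (a y).IsSymm) (hlam : 0 < lam)
    (hmeas : ∀ i j, Measurable fun y => a y i j)
    (hell : ∀ y (ξ : Fin n → ℝ), lam * (ξ ⬝ᵥ ξ) ≤ ξ ⬝ᵥ (a y *ᵥ ξ)) (hbd : ∀ y i j, |a y i j| ≤ Λ)
    (hw : ContDiff ℝ 1 w) (hw1 : ∀ y, 1 ≤ w y)
    (hweak : ∀ η : EuclideanSpace ℝ (Fin n) → ℝ, ContDiff ℝ 1 η → HasCompactSupport η → tsupport η ⊆ U →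
      ∫ y, ∑ i, ∑ j, a y i j * fderiv ℝ w y (EuclideanSpace.single i 1) *
        fderiv ℝ η y (EuclideanSpace.single j 1) = 0)
    {σ : ℝ} (hσ : σ = 1 ∨ σ = -1) {p₀ : ℝ} (hp₀ : 0 < p₀) {D : ℝ} (hD0 : 0 ≤ D)
    (hne : ∀ k : ℕ, σ * (p₀ * (n / (n - 2 : ℝ)) ^ k) ≠ 1)
    (hD : ∀ k : ℕ, (σ * (p₀ * (n / (n - 2 : ℝ)) ^ k) / (σ * (p₀ * (n / (n - 2 : ℝ)) ^ k) - 1)) ^ 2 ≤ D)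
    {C₀ : ℝ} (hC₀ : 0 < C₀) (hcut : ∀ (x₀ : EuclideanSpace ℝ (Fin n)) (ρ' ρ : ℝ), 0 < ρ' → ρ' < ρ →
      ∃ χ : EuclideanSpace ℝ (Fin n) → ℝ, ContDiff ℝ 1 χ ∧ HasCompactSupport χ ∧ (∀ x, 0 ≤ χ x ∧ χ x ≤ 1) ∧
        (∀ x ∈ closedBall x₀ ρ', χ x = 1) ∧ (∀ x, x ∉ ball x₀ ρ → χ x = 0) ∧ ∀ x, ‖fderiv ℝ χ x‖ ≤ C₀ / (ρ - ρ'))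
    (x₀ : EuclideanSpace ℝ (Fin n)) {r' r : ℝ} (hr' : 0 < r') (hr'r : r' < r) (hU : closedBall x₀ r ⊆ U) :
    eLpNorm (fun y => w y ^ σ) ∞ (volume.restrict (closedBall x₀ r')) ≤
      ENNReal.ofReal ((max (eLpNormLESNormFDerivOfEqInnerConst (volume : Measure (EuclideanSpace ℝ (Fin n))) 2 : ℝ) 1) ^ 2
            * (2 * (D * (n * Λ) + lam) / lam * (4 * C₀ ^ 2)) / (r - r') ^ 2) ^
          ((n / (n - 2 : ℝ)) / (p₀ * ((n / (n - 2 : ℝ)) - 1))) *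
        (4 : ℝ≥0∞) ^ ((n / (n - 2 : ℝ)) / (p₀ * ((n / (n - 2 : ℝ)) - 1) ^ 2)) *
        eLpNorm (fun y => w y ^ σ) (ENNReal.ofReal p₀) (volume.restrict (closedBall x₀ r)) := by
  -- notation
  set κ : ℝ := n / (n - 2 : ℝ) with hκ
  set CS : ℝ≥0 := eLpNormLESNormFDerivOfEqInnerConst (volume : Measure (EuclideanSpace ℝ (Fin n))) 2 with hCS
  set K : ℝ := (max (CS : ℝ) 1) ^ 2 * (2 * (D * (n * Λ) + lam) / lam * (4 * C₀ ^ 2)) with hK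
  have hn2 : (0 : ℝ) < n - 2 := by
    have : (3 : ℝ) ≤ n := by exact_mod_cast hn
    linarith
  have hκ1 : 1 < κ := by
    rw [hκ, lt_div_iff₀ hn2]; linarith
  have hκ0 : 0 < κ := zero_lt_one.trans hκ1
  have hpos : ∀ y, 0 < w y := fun y => lt_of_lt_of_le one_pos (hw1 y)
  have hnΛ : 0 ≤ (n : ℝ) * Λ :=
    mul_nonneg (Nat.cast_nonneg n) ((abs_nonneg _).trans (hbd x₀ ⟨0, by omega⟩ ⟨0, by omega⟩))
  have hmax : (1 : ℝ) ≤ max (CS : ℝ) 1 := le_max_right _ _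
  have hKpos : 0 < K := by rw [hK]; positivity
  -- radii and sets
  have hδ : 0 < r - r' := sub_pos.2 hr'r
  set ρ : ℕ → ℝ := fun k => r' + (r - r') * (2 : ℝ)⁻¹ ^ k with hρ
  set A : ℕ → Set (EuclideanSpace ℝ (Fin n)) := fun k => closedBall x₀ (ρ k) with hA
  have hrpos : ∀ k, 0 < ρ k := fun k => by positivity
  have hrdiff : ∀ k, ρ k - ρ (k + 1) = (r - r') * (2 : ℝ)⁻¹ ^ (k + 1) := fun k => by
    simp only [hρ, pow_succ]; ring
  have hrlt : ∀ k, ρ (k + 1) < ρ k := fun k => by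
    have h := hrdiff k
    have : (0 : ℝ) < (r - r') * (2 : ℝ)⁻¹ ^ (k + 1) := by positivity
    linarith
  have hρle : ∀ k, ρ k ≤ r := fun k => by
    have h1 : (2 : ℝ)⁻¹ ^ k ≤ 1 := pow_le_one₀ (by norm_num) (by norm_num)
    have h2 : (r - r') * (2 : ℝ)⁻¹ ^ k ≤ (r - r') * 1 := mul_le_mul_of_nonneg_left h1 hδ.le
    simp only [hρ]; linarith
  -- the chain constants
  set Cch : ℝ≥0 := Real.toNNReal (K / (r - r') ^ 2) with hCch
  have hCch0 : Cch ≠ 0 := by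
    rw [hCch]; exact (Real.toNNReal_pos.2 (by positivity)).ne'
  have hb : (4 : ℝ≥0) ≠ 0 := by norm_num
  have hcoeC : ((Cch : ℝ≥0) : ℝ≥0∞) = ENNReal.ofReal (K / (r - r') ^ 2) := rfl
  have hcoe4 : ((4 : ℝ≥0) : ℝ≥0∞) = 4 := by norm_num
  -- the reverse Hölder chain
  have H : ∀ k : ℕ, eLpNorm (fun y => w y ^ σ) (ENNReal.ofReal (p₀ * κ ^ (k + 1))) (volume.restrict (A (k + 1))) ≤
      (((Cch : ℝ≥0) : ℝ≥0∞) * ((4 : ℝ≥0) : ℝ≥0∞) ^ k) ^ (1 / (p₀ * κ ^ k)) *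
        eLpNorm (fun y => w y ^ σ) (ENNReal.ofReal (p₀ * κ ^ k)) (volume.restrict (A k)) := by
    intro k
    have hpk : 0 < p₀ * κ ^ k := by positivity
    have hstep := moser_step_local hn hsymm hlam hmeas hell hbd hw hw1 hweak hσ hpk (hne k) hcut x₀ (hrpos (k + 1)) (hrlt k)
      ((closedBall_subset_closedBall (hρle k)).trans hU)
    rw [pow_succ, ← mul_assoc]
    refine hstep.trans (mul_le_mul' (ENNReal.rpow_le_rpow ?_ (by positivity)) le_rfl)
    -- the step constant is at most `Cch · 4^k`
    rw [hcoeC, hcoe4, show (4 : ℝ≥0∞) ^ k = ENNReal.ofReal (4 ^ k) by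
      rw [ENNReal.ofReal_pow (by norm_num : (0:ℝ) ≤ 4)]; norm_num, ← ENNReal.ofReal_mul (by positivity)]
    refine ENNReal.ofReal_le_ofReal ?_
    set q : ℝ := σ * (p₀ * κ ^ k) with hq
    have h1 : (q / (q - 1)) ^ 2 * (n * Λ) ≤ D * (n * Λ) := mul_le_mul_of_nonneg_right (hD k) hnΛ
    have h2 : (C₀ / (ρ k - ρ (k + 1))) ^ 2 = 4 * C₀ ^ 2 * 4 ^ k / (r - r') ^ 2 := by
      rw [hrdiff, inv_pow, show (4 : ℝ) ^ k = (2 ^ k) ^ 2 by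
        rw [show (4 : ℝ) = 2 ^ 2 by norm_num, ← pow_mul, ← pow_mul, mul_comm]]
      field_simp
      ring
    have h3 : (CS : ℝ) ^ 2 ≤ (max (CS : ℝ) 1) ^ 2 := pow_le_pow_left₀ (NNReal.coe_nonneg _) (le_max_left _ _) 2
    have h4 : 2 * ((q / (q - 1)) ^ 2 * (n * Λ) + lam) / lam ≤ 2 * (D * (n * Λ) + lam) / lam := by
      refine div_le_div_of_nonneg_right ?_ hlam.le
      linarith
    have h4' : 0 ≤ 2 * ((q / (q - 1)) ^ 2 * (n * Λ) + lam) / lam := by positivity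
    calc (CS : ℝ) ^ 2 * (2 * ((q / (q - 1)) ^ 2 * (n * Λ) + lam) / lam * (C₀ / (ρ k - ρ (k + 1))) ^ 2)
        = (CS : ℝ) ^ 2 * (2 * ((q / (q - 1)) ^ 2 * (n * Λ) + lam) / lam) * (4 * C₀ ^ 2 * 4 ^ k / (r - r') ^ 2) := by
          rw [h2]; ring
      _ ≤ (max (CS : ℝ) 1) ^ 2 * (2 * (D * (n * Λ) + lam) / lam) * (4 * C₀ ^ 2 * 4 ^ k / (r - r') ^ 2) := by
          have h5 : 0 ≤ 4 * C₀ ^ 2 * 4 ^ k / (r - r') ^ 2 := by positivity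
          exact mul_le_mul_of_nonneg_right (mul_le_mul h3 h4 h4' (by positivity)) h5
      _ = K / (r - r') ^ 2 * 4 ^ k := by rw [hK]; ring
  -- Moser's iteration lemma
  have hf : AEStronglyMeasurable (fun y => w y ^ σ) (volume : Measure (EuclideanSpace ℝ (Fin n))) :=
    (contDiff_rpow_of_one_le hw hw1 σ).continuous.aestronglyMeasurable
  have hchain := eLpNorm_top_le_of_moser_chain (μ := (volume : Measure (EuclideanSpace ℝ (Fin n)))) hf
    (A := A) hp₀ hκ1 hCch0 hb H
  -- `B̄(x₀,r') ⊆ ⋂ A_k` and `A 0 = B̄(x₀,r)`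
  have hsub : closedBall x₀ r' ⊆ ⋂ k, A k := by
    refine subset_iInter fun k => closedBall_subset_closedBall ?_
    have : (0 : ℝ) ≤ (r - r') * (2 : ℝ)⁻¹ ^ k := by positivity
    simp only [hρ]; linarith
  have hA0 : A 0 = closedBall x₀ r := by
    simp only [hA, hρ, pow_zero]; ring_nf
  calc eLpNorm (fun y => w y ^ σ) ∞ (volume.restrict (closedBall x₀ r'))
      ≤ eLpNorm (fun y => w y ^ σ) ∞ (volume.restrict (⋂ k, A k)) :=
        eLpNorm_mono_measure _ (Measure.restrict_mono hsub le_rfl)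
    _ ≤ ((Cch : ℝ≥0) : ℝ≥0∞) ^ (κ / (p₀ * (κ - 1))) * ((4 : ℝ≥0) : ℝ≥0∞) ^ (κ / (p₀ * (κ - 1) ^ 2)) *
          eLpNorm (fun y => w y ^ σ) (ENNReal.ofReal p₀) (volume.restrict (A 0)) := hchain
    _ = ENNReal.ofReal (K / (r - r') ^ 2) ^ (κ / (p₀ * (κ - 1))) * (4 : ℝ≥0∞) ^ (κ / (p₀ * (κ - 1) ^ 2)) *
          eLpNorm (fun y => w y ^ σ) (ENNReal.ofReal p₀) (volume.restrict (closedBall x₀ r)) := by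
        rw [hcoeC, hcoe4, hA0]

end Literature.Analysis.PDE.DivForm.LocalMoser

end

end Part3

/-!
## Part 4 — port of `Summits/NavierStokesRegularity/NavierStokesRegularity/Theorems/PoloidalWindowDoorPoloidalWindowRigidityDivFormLocalLogOsc.lean`

# Route `PoloidalWindowDoor`, crux K2 (stmt-NavierStokesRegularity-19708) — LOCAL logarithmic oscillation estimate for
# `div(a∇u) = 0` on an open set `U` (towards `divFormStrongMaximumPrinciple_holds`, GT 8.19, via an interior Harnack
# inequality)

Local twin of the gradient half of `…DivFormLogBMO` (seat ns-poloidal-K2-p3): for a `C¹` function `u ≥ 1` solving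
`div(a∇u) = 0` weakly against test functions with `tsupport η ⊆ U` (hypothesis of
`Literature.Analysis.PDE.divFormStrongMaximumPrinciple`), on balls `B(x₀,r)` with `B̄(x₀,2r) ⊆ U`:

* `gradLog_estimate_local` — `λ ∫ χ² ‖Du‖²/u² ≤ 4nΛ ∫ ‖Dχ‖²` for cutoffs with `tsupport χ ⊆ U` (Moser 1961 §5);
* `lintegral_ball_gradLog_sq_le_local` — `∫⁻_{B(x₀,r)} ‖D log u‖ₑ² ≤ (4nΛC₀²2ⁿ/λ) r⁻² |B(x₀,r)|`;
* `lintegral_ball_logOsc_sq_le_local` — `∫⁻_{B(x₀,r)} ‖log u − (log u)_B‖ₑ² ≤ (16·4ⁿ nΛC₀²/λ) |B(x₀,r)|`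
  (Poincaré–Wirtinger, tree `PoincareWirtingerConvex`);
* `measure_ball_logOsc_gt_le_local` — the weak-`L¹` consequence `|{t < |log u − (log u)_B|} ∩ B| ≤ ((K+1)/t)|B|`,
  which is hypothesis (A) of the Bombieri–Giusti lemma (sequel) — the local replacement for the global `BMO` +
  John–Nirenberg crossover of `…DivFormCrossover`, which does not localise.

Proofs of the first two copied from the siblings with the hypothesis localised; helpers (`contDiff_log`,
`norm_fderiv_log_sq`, cutoffs) imported.  Seat ns-in-ser-b g5 (cell pub/ns-inputs), `ledger fact claim` #1 on
`Literature.Analysis.PDE.divFormStrongMaximumPrinciple`.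

WHAT THIS IS NOT: not yet Harnack / the strong maximum principle; nothing NS-specific, no NS statement is touched.
-/

section Part4

noncomputable section

open _root_.MeasureTheory _root_.Set _root_.Function _root_.Filter _root_.Topology _root_.Metric _root_.Module
open scoped _root_.Matrix _root_.ENNReal

namespace Literature.Analysis.PDE.DivForm.LocalLogOsc

open Literature.Analysis.PDE.DivForm.Caccioppoli
open Literature.Analysis.PDE.DivForm.CaccioppoliPowers
open Literature.Analysis.PDE.DivForm.LogBMO
open Literature.Analysis.PDE.DivForm.LocalCaccioppoli
open Literature.Analysis.FunctionSpaces

variable {n : ℕ} {a : EuclideanSpace ℝ (Fin n) → Matrix (Fin n) (Fin n) ℝ} {lam Λ : ℝ}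
  {u : EuclideanSpace ℝ (Fin n) → ℝ} {U : Set (EuclideanSpace ℝ (Fin n))}

/-! ### The logarithmic Caccioppoli inequality in gradient-norm form, local -/

/-- `λ Σᵢ (∂ᵢu)² ≤ Du·aDu` and `Dχ·aDχ ≤ nΛ ‖Dχ‖²` turn the logarithmic Caccioppoli inequality into
**`λ ∫ χ² ‖D u‖²/u² ≤ 4 n Λ ∫ ‖Dχ‖²`** — the `BMO` input of M2 (`‖D u‖/u = ‖D log u‖`).
[cite: GilbargTrudinger2001, Theorem 8.18 proof §8.6 (logarithmic oscillation estimate)] -/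
theorem gradLog_estimate_local (hsymm : ∀ y, (a y).IsSymm) (hlam : 0 < lam)
    (hmeas : ∀ i j, Measurable fun y => a y i j)
    (hell : ∀ y (ξ : Fin n → ℝ), lam * (ξ ⬝ᵥ ξ) ≤ ξ ⬝ᵥ (a y *ᵥ ξ)) (hbd : ∀ y i j, |a y i j| ≤ Λ)
    (hu : ContDiff ℝ 1 u) (hu1 : ∀ y, 1 ≤ u y)
    (hweak : ∀ η : EuclideanSpace ℝ (Fin n) → ℝ, ContDiff ℝ 1 η → HasCompactSupport η → tsupport η ⊆ U →
      ∫ y, ∑ i, ∑ j, a y i j * fderiv ℝ u y (EuclideanSpace.single i 1) *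
        fderiv ℝ η y (EuclideanSpace.single j 1) = 0)
    {χ : EuclideanSpace ℝ (Fin n) → ℝ} (hχ : ContDiff ℝ 1 χ) (hχc : HasCompactSupport χ)
    (hχU : tsupport χ ⊆ U) :
    lam * ∫ y, χ y ^ 2 * (u y ^ 2)⁻¹ * ‖fderiv ℝ u y‖ ^ 2 ≤
      4 * (n * Λ) * ∫ y, ‖fderiv ℝ χ y‖ ^ 2 := by
  have hupos : ∀ y, 0 < u y := fun y => lt_of_lt_of_le one_pos (hu1 y)
  have h := caccioppoli_log_local hsymm hlam hmeas hell hbd hu hu1 hweak hχ hχc hχU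
  have hcu := continuous_fderiv_single hu
  have hcχ := continuous_fderiv_single hχ
  -- continuity of the two norm integrands, compact support
  have hnu : Continuous fun y => ‖fderiv ℝ u y‖ ^ 2 := ((hu.continuous_fderiv one_ne_zero).norm).pow 2
  have hnχ : Continuous fun y => ‖fderiv ℝ χ y‖ ^ 2 := ((hχ.continuous_fderiv one_ne_zero).norm).pow 2
  have hinvu : Continuous fun y => (u y ^ 2)⁻¹ :=
    ((hu.continuous.pow 2).inv₀ fun y => (pow_pos (hupos y) 2).ne')
  have hIl : Integrable fun y => χ y ^ 2 * (u y ^ 2)⁻¹ * ‖fderiv ℝ u y‖ ^ 2 := by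
    have hc : Continuous fun y => χ y ^ 2 * (u y ^ 2)⁻¹ * ‖fderiv ℝ u y‖ ^ 2 :=
      ((hχ.continuous.pow 2).mul hinvu).mul hnu
    refine hc.integrable_of_hasCompactSupport ?_
    exact ((hasCompactSupport_testFun (u := u) (g := fun s => (s ^ 2)⁻¹) hχc).mul_right)
  have hIr : Integrable fun y => ‖fderiv ℝ χ y‖ ^ 2 := by
    refine hnχ.integrable_of_hasCompactSupport ?_
    exact (hχc.fderiv (𝕜 := ℝ)).norm.comp_left (g := fun s : ℝ => s ^ 2) (by simp)
  -- lower bound on the left integrand, upper bound on the right integrand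
  have hle_l : ∀ y, lam * (χ y ^ 2 * (u y ^ 2)⁻¹ * ‖fderiv ℝ u y‖ ^ 2) ≤
      χ y ^ 2 * (u y ^ 2)⁻¹ *
        ((fun i => fderiv ℝ u y (EuclideanSpace.single i 1)) ⬝ᵥ
          (a y *ᵥ fun i => fderiv ℝ u y (EuclideanSpace.single i 1))) := by
    intro y
    have hq := quadForm_lower hell y (fun i => fderiv ℝ u y (EuclideanSpace.single i 1))
    rw [sum_fderiv_single_sq] at hq
    have hw : 0 ≤ χ y ^ 2 * (u y ^ 2)⁻¹ := by positivity
    nlinarith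
  have hle_r : ∀ y, ((fun j => fderiv ℝ χ y (EuclideanSpace.single j 1)) ⬝ᵥ
          (a y *ᵥ fun j => fderiv ℝ χ y (EuclideanSpace.single j 1))) ≤ n * Λ * ‖fderiv ℝ χ y‖ ^ 2 := by
    intro y
    have hq := quadForm_upper hbd y (fun j => fderiv ℝ χ y (EuclideanSpace.single j 1))
    rwa [sum_fderiv_single_sq] at hq
  -- integrability of the coefficient-form integrands (from the Caccioppoli file's lemmas)
  have hIql : Integrable fun y => χ y ^ 2 * (u y ^ 2)⁻¹ *
      ((fun i => fderiv ℝ u y (EuclideanSpace.single i 1)) ⬝ᵥ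
        (a y *ᵥ fun i => fderiv ℝ u y (EuclideanSpace.single i 1))) := by
    have h' := integrable_mul_of_le_continuous (n := n)
      (m := fun y => (fun i => fderiv ℝ u y (EuclideanSpace.single i 1)) ⬝ᵥ
        (a y *ᵥ fun i => fderiv ℝ u y (EuclideanSpace.single i 1)))
      (M := fun y => n * Λ * (∑ i, fderiv ℝ u y (EuclideanSpace.single i 1) ^ 2 +
        ∑ j, fderiv ℝ u y (EuclideanSpace.single j 1) ^ 2) / 2)
      (φ := fun y => χ y ^ 2 * (u y ^ 2)⁻¹)
      (measurable_dotProduct_mulVec hmeas hcu hcu) (by fun_prop)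
      (fun y => abs_dotProduct_mulVec_le hsymm hlam hell hbd y _ _) ((hχ.continuous.pow 2).mul hinvu)
      (hasCompactSupport_testFun (u := u) (g := fun s => (s ^ 2)⁻¹) hχc)
    exact h'.congr (Eventually.of_forall fun y => by ring)
  have hIqr : Integrable fun y => ((fun j => fderiv ℝ χ y (EuclideanSpace.single j 1)) ⬝ᵥ
      (a y *ᵥ fun j => fderiv ℝ χ y (EuclideanSpace.single j 1))) := by
    refine (hIr.const_mul (n * Λ)).mono' (measurable_dotProduct_mulVec hmeas hcχ hcχ).aestronglyMeasurable
      (Eventually.of_forall fun y => ?_)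
    have hq0 : 0 ≤ ((fun j => fderiv ℝ χ y (EuclideanSpace.single j 1)) ⬝ᵥ
        (a y *ᵥ fun j => fderiv ℝ χ y (EuclideanSpace.single j 1))) :=
      (mul_nonneg hlam.le (Finset.sum_nonneg fun i _ => sq_nonneg _)).trans (quadForm_lower hell y _)
    rw [Real.norm_eq_abs, abs_of_nonneg hq0]
    exact hle_r y
  calc lam * ∫ y, χ y ^ 2 * (u y ^ 2)⁻¹ * ‖fderiv ℝ u y‖ ^ 2
      = ∫ y, lam * (χ y ^ 2 * (u y ^ 2)⁻¹ * ‖fderiv ℝ u y‖ ^ 2) := (integral_const_mul _ _).symm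
    _ ≤ ∫ y, χ y ^ 2 * (u y ^ 2)⁻¹ *
          ((fun i => fderiv ℝ u y (EuclideanSpace.single i 1)) ⬝ᵥ
            (a y *ᵥ fun i => fderiv ℝ u y (EuclideanSpace.single i 1))) :=
        integral_mono (hIl.const_mul lam) hIql hle_l
    _ ≤ 4 * ∫ y, ((fun j => fderiv ℝ χ y (EuclideanSpace.single j 1)) ⬝ᵥ
          (a y *ᵥ fun j => fderiv ℝ χ y (EuclideanSpace.single j 1))) := h
    _ ≤ 4 * ∫ y, n * Λ * ‖fderiv ℝ χ y‖ ^ 2 :=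
        mul_le_mul_of_nonneg_left (integral_mono hIqr (hIr.const_mul _) hle_r) (by norm_num)
    _ = 4 * (n * Λ) * ∫ y, ‖fderiv ℝ χ y‖ ^ 2 := by rw [integral_const_mul]; ring

/-! ### The gradient of `log u` on a ball, local form -/

/-- **The gradient of `log u` on a ball**: `∫⁻_{B(x₀,r)} ‖D log u‖ₑ² ≤ (4nΛC₀²2ⁿ/λ) · r⁻² · |B(x₀,r)|`, for a cutoff
constant `C₀` as in `exists_ball_cutoff`.
[cite: GilbargTrudinger2001, Theorem 8.18 proof §8.6 (logarithmic oscillation estimate)] -/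
theorem lintegral_ball_gradLog_sq_le_local (hsymm : ∀ y, (a y).IsSymm) (hlam : 0 < lam)
    (hmeas : ∀ i j, Measurable fun y => a y i j)
    (hell : ∀ y (ξ : Fin n → ℝ), lam * (ξ ⬝ᵥ ξ) ≤ ξ ⬝ᵥ (a y *ᵥ ξ)) (hbd : ∀ y i j, |a y i j| ≤ Λ)
    (hu : ContDiff ℝ 1 u) (hu1 : ∀ y, 1 ≤ u y)
    (hweak : ∀ η : EuclideanSpace ℝ (Fin n) → ℝ, ContDiff ℝ 1 η → HasCompactSupport η → tsupport η ⊆ U →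
      ∫ y, ∑ i, ∑ j, a y i j * fderiv ℝ u y (EuclideanSpace.single i 1) *
        fderiv ℝ η y (EuclideanSpace.single j 1) = 0)
    {C₀ : ℝ} {x₀ : EuclideanSpace ℝ (Fin n)} {r : ℝ} (hr : 0 < r)
    {χ : EuclideanSpace ℝ (Fin n) → ℝ} (hχ : ContDiff ℝ 1 χ) (hχc : HasCompactSupport χ) (hχU : tsupport χ ⊆ U)
    (hχ1 : ∀ x ∈ ball x₀ r, χ x = 1) (hχ0 : ∀ x, x ∉ ball x₀ (2 * r) → χ x = 0)
    (hχD : ∀ x, ‖fderiv ℝ χ x‖ ≤ C₀ / r) :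
    ∫⁻ y in ball x₀ r, ‖fderiv ℝ (fun y => Real.log (u y)) y‖ₑ ^ 2 ≤
      ENNReal.ofReal (4 * (n * Λ) * C₀ ^ 2 * 2 ^ n / lam / r ^ 2) * volume (ball x₀ r) := by
  have hupos : ∀ y, 0 < u y := fun y => lt_of_lt_of_le one_pos (hu1 y)
  have hnΛ : 0 ≤ (n : ℝ) * Λ := by
    rcases Nat.eq_zero_or_pos n with hn | hn
    · simp [hn]
    · exact mul_nonneg (Nat.cast_nonneg n) ((abs_nonneg _).trans (hbd x₀ ⟨0, hn⟩ ⟨0, hn⟩))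
  -- (1) the logarithmic Caccioppoli inequality with this cutoff
  have h1 := gradLog_estimate_local hsymm hlam hmeas hell hbd hu hu1 hweak hχ hχc hχU
  -- (2) the cutoff gradient: `∫ ‖Dχ‖² ≤ (C₀/r)² |B(x₀, 2r)|`
  have hDχ_out : ∀ x, x ∉ closedBall x₀ (2 * r) → fderiv ℝ χ x = 0 := by
    intro x hx
    have hopen : IsOpen (closedBall x₀ (2 * r))ᶜ := isClosed_closedBall.isOpen_compl
    have hev : χ =ᶠ[𝓝 x] fun _ => 0 := by
      filter_upwards [hopen.mem_nhds hx] with z hz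
      exact hχ0 z fun hz' => hz (ball_subset_closedBall hz')
    rw [hev.fderiv_eq, fderiv_const_apply]
  have hint_Dχ : ∫ y, ‖fderiv ℝ χ y‖ ^ 2 ≤ (C₀ / r) ^ 2 * (volume (closedBall x₀ (2 * r))).toReal := by
    have hcont : Continuous fun y => ‖fderiv ℝ χ y‖ ^ 2 := ((hχ.continuous_fderiv one_ne_zero).norm).pow 2
    have heq : ∫ y, ‖fderiv ℝ χ y‖ ^ 2 = ∫ y in closedBall x₀ (2 * r), ‖fderiv ℝ χ y‖ ^ 2 := by
      refine (setIntegral_eq_integral_of_forall_compl_eq_zero fun y hy => ?_).symm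
      rw [hDχ_out y hy, norm_zero, zero_pow two_ne_zero]
    rw [heq]
    calc ∫ y in closedBall x₀ (2 * r), ‖fderiv ℝ χ y‖ ^ 2
        ≤ ∫ y in closedBall x₀ (2 * r), (C₀ / r) ^ 2 := by
          refine setIntegral_mono_on (hcont.continuousOn.integrableOn_compact (isCompact_closedBall _ _))
            (by simp [measure_closedBall_lt_top]) measurableSet_closedBall fun y _ => ?_
          exact pow_le_pow_left₀ (norm_nonneg _) (hχD y) 2
      _ = (C₀ / r) ^ 2 * (volume (closedBall x₀ (2 * r))).toReal := by
          rw [setIntegral_const, smul_eq_mul, mul_comm]; rfl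
  -- (3) volumes: `|B̄(x₀,2r)| = 2ⁿ |B(x₀,r)|`
  have hvol : volume (closedBall x₀ (2 * r)) = ENNReal.ofReal (2 ^ n) * volume (ball x₀ r) := by
    rcases Nat.eq_zero_or_pos n with hn | hn
    · subst hn
      have h0 : ∀ s : Set (EuclideanSpace ℝ (Fin 0)), s.Nonempty → s = univ := fun s hs => by
        obtain ⟨p, hp⟩ := hs; exact eq_univ_of_forall fun q => by rwa [Subsingleton.elim q p]
      rw [h0 _ ⟨x₀, mem_closedBall_self (by positivity)⟩, h0 _ ⟨x₀, mem_ball_self hr⟩]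
      simp
    · haveI : Nonempty (Fin n) := ⟨⟨0, hn⟩⟩
      rw [Measure.addHaar_closedBall_eq_addHaar_ball, Measure.addHaar_ball_of_pos _ _ (by positivity : 0 < 2 * r),
        Measure.addHaar_ball_of_pos _ _ hr, ← mul_assoc, ← ENNReal.ofReal_mul (by positivity), mul_pow,
        finrank_euclideanSpace, Fintype.card_fin]
  -- (4) the left side: on the ball `χ = 1` and `‖D log u‖² = ‖Du‖²/u²`
  have hcontL : Continuous fun y => (u y ^ 2)⁻¹ * ‖fderiv ℝ u y‖ ^ 2 :=
    ((hu.continuous.pow 2).inv₀ fun y => (pow_pos (hupos y) 2).ne').mul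
      (((hu.continuous_fderiv one_ne_zero).norm).pow 2)
  have hinvu : Continuous fun y => (u y ^ 2)⁻¹ := (hu.continuous.pow 2).inv₀ fun y => (pow_pos (hupos y) 2).ne'
  have hnu : Continuous fun y => ‖fderiv ℝ u y‖ ^ 2 := ((hu.continuous_fderiv one_ne_zero).norm).pow 2
  have hIfull : Integrable fun y => χ y ^ 2 * (u y ^ 2)⁻¹ * ‖fderiv ℝ u y‖ ^ 2 := by
    have hc : Continuous fun y => χ y ^ 2 * (u y ^ 2)⁻¹ * ‖fderiv ℝ u y‖ ^ 2 :=
      ((hχ.continuous.pow 2).mul hinvu).mul hnu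
    exact hc.integrable_of_hasCompactSupport
      ((hasCompactSupport_testFun (u := u) (g := fun s => (s ^ 2)⁻¹) hχc).mul_right)
  have hball : ∫ y in ball x₀ r, (u y ^ 2)⁻¹ * ‖fderiv ℝ u y‖ ^ 2 ≤
      ∫ y, χ y ^ 2 * (u y ^ 2)⁻¹ * ‖fderiv ℝ u y‖ ^ 2 := by
    calc ∫ y in ball x₀ r, (u y ^ 2)⁻¹ * ‖fderiv ℝ u y‖ ^ 2
        = ∫ y in ball x₀ r, χ y ^ 2 * (u y ^ 2)⁻¹ * ‖fderiv ℝ u y‖ ^ 2 :=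
          setIntegral_congr_fun measurableSet_ball fun y hy => by rw [hχ1 y hy]; ring
      _ ≤ ∫ y, χ y ^ 2 * (u y ^ 2)⁻¹ * ‖fderiv ℝ u y‖ ^ 2 :=
          setIntegral_le_integral hIfull (Eventually.of_forall fun y => by positivity)
  -- assemble in `ℝ`
  have hreal : ∫ y in ball x₀ r, ‖fderiv ℝ (fun y => Real.log (u y)) y‖ ^ 2 ≤
      4 * (n * Λ) * C₀ ^ 2 * 2 ^ n / lam / r ^ 2 * (volume (ball x₀ r)).toReal := by
    have hv : (volume (closedBall x₀ (2 * r))).toReal = 2 ^ n * (volume (ball x₀ r)).toReal := by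
      rw [hvol, ENNReal.toReal_mul, ENNReal.toReal_ofReal (by positivity)]
    have hL : ∫ y in ball x₀ r, ‖fderiv ℝ (fun y => Real.log (u y)) y‖ ^ 2 =
        ∫ y in ball x₀ r, (u y ^ 2)⁻¹ * ‖fderiv ℝ u y‖ ^ 2 :=
      setIntegral_congr_fun measurableSet_ball fun y _ => norm_fderiv_log_sq hu hu1 y
    rw [hL]
    have h2 : lam * ∫ y in ball x₀ r, (u y ^ 2)⁻¹ * ‖fderiv ℝ u y‖ ^ 2 ≤
        4 * (n * Λ) * ((C₀ / r) ^ 2 * (2 ^ n * (volume (ball x₀ r)).toReal)) := by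
      calc lam * ∫ y in ball x₀ r, (u y ^ 2)⁻¹ * ‖fderiv ℝ u y‖ ^ 2
          ≤ lam * ∫ y, χ y ^ 2 * (u y ^ 2)⁻¹ * ‖fderiv ℝ u y‖ ^ 2 := mul_le_mul_of_nonneg_left hball hlam.le
        _ ≤ 4 * (n * Λ) * ∫ y, ‖fderiv ℝ χ y‖ ^ 2 := h1
        _ ≤ 4 * (n * Λ) * ((C₀ / r) ^ 2 * (2 ^ n * (volume (ball x₀ r)).toReal)) := by
            rw [← hv]; exact mul_le_mul_of_nonneg_left hint_Dχ (by positivity)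
    rw [← le_div_iff₀' hlam] at h2
    refine h2.trans (le_of_eq ?_)
    field_simp
  -- convert to `ℝ≥0∞`
  have hnn : 0 ≤ᵐ[volume.restrict (ball x₀ r)] fun y => ‖fderiv ℝ (fun y => Real.log (u y)) y‖ ^ 2 :=
    Eventually.of_forall fun y => by positivity
  have hIball : IntegrableOn (fun y => ‖fderiv ℝ (fun y => Real.log (u y)) y‖ ^ 2) (ball x₀ r) :=
    ((((contDiff_log hu hu1).continuous_fderiv one_ne_zero).norm).pow 2).continuousOn.integrableOn_compact
      (isCompact_closedBall x₀ r) |>.mono_set ball_subset_closedBall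
  calc ∫⁻ y in ball x₀ r, ‖fderiv ℝ (fun y => Real.log (u y)) y‖ₑ ^ 2
      = ∫⁻ y in ball x₀ r, ENNReal.ofReal (‖fderiv ℝ (fun y => Real.log (u y)) y‖ ^ 2) := by
        refine lintegral_congr fun y => ?_
        rw [← ofReal_norm, ← ENNReal.ofReal_pow (norm_nonneg _)]
    _ = ENNReal.ofReal (∫ y in ball x₀ r, ‖fderiv ℝ (fun y => Real.log (u y)) y‖ ^ 2) :=
        (ofReal_integral_eq_lintegral_ofReal hIball hnn).symm
    _ ≤ ENNReal.ofReal (4 * (n * Λ) * C₀ ^ 2 * 2 ^ n / lam / r ^ 2 * (volume (ball x₀ r)).toReal) :=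
        ENNReal.ofReal_le_ofReal hreal
    _ = ENNReal.ofReal (4 * (n * Λ) * C₀ ^ 2 * 2 ^ n / lam / r ^ 2) * volume (ball x₀ r) := by
        rw [ENNReal.ofReal_mul (by positivity), ENNReal.ofReal_toReal measure_ball_lt_top.ne]

/-! ### The logarithmic oscillation on a ball -/

/-- **`L²` oscillation of `log u` over a ball** (Moser 1961 §5, localised): if `B̄(x₀,2r) ⊆ U` and `C₀` is a cutoff
constant as in `…DivFormLogBMO.exists_ball_cutoff`, then
`∫⁻_{B(x₀,r)} ‖log u − (log u)_{B(x₀,r)}‖ₑ² ≤ (16 · 4ⁿ · nΛ C₀² / λ) · |B(x₀,r)|`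
(logarithmic Caccioppoli + the Poincaré–Wirtinger inequality of the tree, `PoincareWirtingerConvex`).
[cite: GilbargTrudinger2001, Theorem 8.18 proof §8.6 (logarithmic oscillation estimate)] -/
theorem lintegral_ball_logOsc_sq_le_local (hsymm : ∀ y, (a y).IsSymm) (hlam : 0 < lam)
    (hmeas : ∀ i j, Measurable fun y => a y i j)
    (hell : ∀ y (ξ : Fin n → ℝ), lam * (ξ ⬝ᵥ ξ) ≤ ξ ⬝ᵥ (a y *ᵥ ξ)) (hbd : ∀ y i j, |a y i j| ≤ Λ)
    (hu : ContDiff ℝ 1 u) (hu1 : ∀ y, 1 ≤ u y)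
    (hweak : ∀ η : EuclideanSpace ℝ (Fin n) → ℝ, ContDiff ℝ 1 η → HasCompactSupport η → tsupport η ⊆ U →
      ∫ y, ∑ i, ∑ j, a y i j * fderiv ℝ u y (EuclideanSpace.single i 1) *
        fderiv ℝ η y (EuclideanSpace.single j 1) = 0)
    {C₀ : ℝ}
    (hcut : ∀ (x₀ : EuclideanSpace ℝ (Fin n)) (r : ℝ), 0 < r →
      ∃ χ : EuclideanSpace ℝ (Fin n) → ℝ, ContDiff ℝ 1 χ ∧ HasCompactSupport χ ∧ (∀ x, 0 ≤ χ x ∧ χ x ≤ 1) ∧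
        (∀ x ∈ ball x₀ r, χ x = 1) ∧ (∀ x, x ∉ ball x₀ (2 * r) → χ x = 0) ∧ ∀ x, ‖fderiv ℝ χ x‖ ≤ C₀ / r)
    (x₀ : EuclideanSpace ℝ (Fin n)) {r : ℝ} (hr : 0 < r) (hU : closedBall x₀ (2 * r) ⊆ U) :
    ∫⁻ y in ball x₀ r, ‖Real.log (u y) - ⨍ z in ball x₀ r, Real.log (u z)‖ₑ ^ 2 ∂volume ≤
      ENNReal.ofReal (16 * 4 ^ n * (n * Λ) * C₀ ^ 2 / lam) * volume (ball x₀ r) := by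
  obtain ⟨χ, hχ, hχc, hχ01, hχ1, hχ0, hχD⟩ := hcut x₀ r hr
  have hχU : tsupport χ ⊆ U := by
    refine (closure_minimal (fun x hx => ?_) isClosed_closedBall).trans hU
    by_contra h
    exact hx (hχ0 x fun hb => h (ball_subset_closedBall hb))
  set f : EuclideanSpace ℝ (Fin n) → ℝ := fun y => Real.log (u y) with hf
  have hfC : ContDiff ℝ 1 f := contDiff_log hu hu1
  have hB0 : volume (ball x₀ r) ≠ 0 := (measure_ball_pos volume x₀ hr).ne'
  have hBt : volume (ball x₀ r) ≠ ∞ := measure_ball_lt_top.ne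
  have hnΛ : 0 ≤ (n : ℝ) * Λ := by
    rcases Nat.eq_zero_or_pos n with hn | hn
    · simp [hn]
    · exact mul_nonneg (Nat.cast_nonneg n) ((abs_nonneg _).trans (hbd x₀ ⟨0, hn⟩ ⟨0, hn⟩))
  -- Poincaré–Wirtinger on the ball (diameter `2r`)
  have hP := lintegral_enorm_sub_setAverage_sq_le (μ := (volume : Measure (EuclideanSpace ℝ (Fin n)))) hfC
    (convex_ball x₀ r) measurableSet_ball hB0 hBt
    ((hfC.continuous.continuousOn.integrableOn_compact (isCompact_closedBall x₀ r)).mono_set ball_subset_closedBall)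
    (D := 2 * r) (fun y hy z hz => by
      rw [← dist_eq_norm]
      calc dist y z ≤ dist y x₀ + dist z x₀ := dist_triangle_right _ _ _
        _ ≤ 2 * r := by rw [mem_ball] at hy hz; linarith)
  rw [finrank_euclideanSpace, Fintype.card_fin] at hP
  -- the gradient bound
  have hG := lintegral_ball_gradLog_sq_le_local hsymm hlam hmeas hell hbd hu hu1 hweak hr hχ hχc hχU hχ1 hχ0 hχD
  refine hP.trans ?_
  calc ENNReal.ofReal (2 ^ n * (2 * r) ^ 2) * ∫⁻ y in ball x₀ r, ‖fderiv ℝ f y‖ₑ ^ 2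
      ≤ ENNReal.ofReal (2 ^ n * (2 * r) ^ 2) *
          (ENNReal.ofReal (4 * (n * Λ) * C₀ ^ 2 * 2 ^ n / lam / r ^ 2) * volume (ball x₀ r)) := by
        gcongr
    _ = ENNReal.ofReal (16 * 4 ^ n * (n * Λ) * C₀ ^ 2 / lam) * volume (ball x₀ r) := by
        rw [← mul_assoc, ← ENNReal.ofReal_mul (by positivity)]
        congr 2
        rw [show (4 : ℝ) ^ n = 2 ^ n * 2 ^ n by rw [← mul_pow]; norm_num]
        field_simp
        ring

/-- **Weak-`L¹` form of the logarithmic oscillation** (the hypothesis `(A)` of the Bombieri–Giusti lemma): with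
`c = (log u)_{B(x₀,r)}` and `K = 16·4ⁿ·nΛC₀²/λ`, for every `t > 0`,
`|{y ∈ B(x₀,r) : t < |log u(y) − c|}| ≤ ((K + 1)/t) · |B(x₀,r)|` (Chebyshev on the `L²` bound for `t ≥ 1`, the
trivial bound for `t ≤ 1`).
[cite: GilbargTrudinger2001, Theorem 8.18 proof §8.6 (logarithmic oscillation estimate)] -/
theorem measure_ball_logOsc_gt_le_local (hsymm : ∀ y, (a y).IsSymm) (hlam : 0 < lam)
    (hmeas : ∀ i j, Measurable fun y => a y i j)
    (hell : ∀ y (ξ : Fin n → ℝ), lam * (ξ ⬝ᵥ ξ) ≤ ξ ⬝ᵥ (a y *ᵥ ξ)) (hbd : ∀ y i j, |a y i j| ≤ Λ)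
    (hu : ContDiff ℝ 1 u) (hu1 : ∀ y, 1 ≤ u y)
    (hweak : ∀ η : EuclideanSpace ℝ (Fin n) → ℝ, ContDiff ℝ 1 η → HasCompactSupport η → tsupport η ⊆ U →
      ∫ y, ∑ i, ∑ j, a y i j * fderiv ℝ u y (EuclideanSpace.single i 1) *
        fderiv ℝ η y (EuclideanSpace.single j 1) = 0)
    {C₀ : ℝ}
    (hcut : ∀ (x₀ : EuclideanSpace ℝ (Fin n)) (r : ℝ), 0 < r →
      ∃ χ : EuclideanSpace ℝ (Fin n) → ℝ, ContDiff ℝ 1 χ ∧ HasCompactSupport χ ∧ (∀ x, 0 ≤ χ x ∧ χ x ≤ 1) ∧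
        (∀ x ∈ ball x₀ r, χ x = 1) ∧ (∀ x, x ∉ ball x₀ (2 * r) → χ x = 0) ∧ ∀ x, ‖fderiv ℝ χ x‖ ≤ C₀ / r)
    (x₀ : EuclideanSpace ℝ (Fin n)) {r : ℝ} (hr : 0 < r) (hU : closedBall x₀ (2 * r) ⊆ U) {t : ℝ} (ht : 0 < t) :
    volume {y ∈ ball x₀ r | t < |Real.log (u y) - ⨍ z in ball x₀ r, Real.log (u z)|} ≤
      ENNReal.ofReal ((16 * 4 ^ n * (n * Λ) * C₀ ^ 2 / lam + 1) / t) * volume (ball x₀ r) := by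
  set K : ℝ := 16 * 4 ^ n * (n * Λ) * C₀ ^ 2 / lam with hK
  set c : ℝ := ⨍ z in ball x₀ r, Real.log (u z) with hc
  set E : Set (EuclideanSpace ℝ (Fin n)) := {y ∈ ball x₀ r | t < |Real.log (u y) - c|} with hE
  have hnΛ : 0 ≤ (n : ℝ) * Λ := by
    rcases Nat.eq_zero_or_pos n with hn | hn
    · simp [hn]
    · exact mul_nonneg (Nat.cast_nonneg n) ((abs_nonneg _).trans (hbd x₀ ⟨0, hn⟩ ⟨0, hn⟩))
  have hKnn : 0 ≤ K := by rw [hK]; positivity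
  have hEsub : E ⊆ ball x₀ r := fun y hy => hy.1
  -- Chebyshev: `t² |E| ≤ ∫⁻_B osc² ≤ K |B|`
  have hosc := lintegral_ball_logOsc_sq_le_local hsymm hlam hmeas hell hbd hu hu1 hweak hcut x₀ hr hU
  have hcont : Continuous fun y => Real.log (u y) - c := (contDiff_log hu hu1).continuous.sub continuous_const
  have hcheb : ENNReal.ofReal (t ^ 2) * volume E ≤ ENNReal.ofReal K * volume (ball x₀ r) := by
    have hmeasg : AEMeasurable (fun y => ‖Real.log (u y) - c‖ₑ ^ 2) (volume.restrict (ball x₀ r)) :=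
      (hcont.measurable.enorm.pow_const _).aemeasurable
    have h1 := mul_meas_ge_le_lintegral₀ hmeasg (ENNReal.ofReal (t ^ 2))
    have h2 : volume E ≤ (volume.restrict (ball x₀ r)) {y | ENNReal.ofReal (t ^ 2) ≤ ‖Real.log (u y) - c‖ₑ ^ 2} := by
      rw [Measure.restrict_apply' measurableSet_ball]
      refine measure_mono fun y hy => ⟨?_, hy.1⟩
      have hlt : t < |Real.log (u y) - c| := hy.2
      show ENNReal.ofReal (t ^ 2) ≤ ‖Real.log (u y) - c‖ₑ ^ 2
      rw [Real.enorm_eq_ofReal_abs, ← ENNReal.ofReal_pow (abs_nonneg _)]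
      exact ENNReal.ofReal_le_ofReal (pow_le_pow_left₀ ht.le hlt.le 2)
    calc ENNReal.ofReal (t ^ 2) * volume E
        ≤ ENNReal.ofReal (t ^ 2) *
            (volume.restrict (ball x₀ r)) {y | ENNReal.ofReal (t ^ 2) ≤ ‖Real.log (u y) - c‖ₑ ^ 2} :=
          mul_le_mul' le_rfl h2
      _ ≤ ∫⁻ y in ball x₀ r, ‖Real.log (u y) - c‖ₑ ^ 2 := h1
      _ ≤ ENNReal.ofReal K * volume (ball x₀ r) := hosc
  -- the two cases
  rcases le_or_gt 1 t with h1t | ht1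
  · -- `t ≥ 1`: `|E| ≤ K|B|/t² ≤ (K+1)|B|/t`
    have ht2 : 0 < t ^ 2 := by positivity
    have hE1 : volume E ≤ ENNReal.ofReal (K / t ^ 2) * volume (ball x₀ r) := by
      have hne : ENNReal.ofReal (t ^ 2) ≠ 0 := (ENNReal.ofReal_pos.2 ht2).ne'
      calc volume E = (ENNReal.ofReal (t ^ 2))⁻¹ * (ENNReal.ofReal (t ^ 2) * volume E) := by
            rw [← mul_assoc, ENNReal.inv_mul_cancel hne ENNReal.ofReal_ne_top, one_mul]
        _ ≤ (ENNReal.ofReal (t ^ 2))⁻¹ * (ENNReal.ofReal K * volume (ball x₀ r)) := mul_le_mul' le_rfl hcheb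
        _ = ENNReal.ofReal (K / t ^ 2) * volume (ball x₀ r) := by
            rw [← mul_assoc, ← ENNReal.ofReal_inv_of_pos ht2, ← ENNReal.ofReal_mul (inv_nonneg.2 ht2.le),
              inv_mul_eq_div]
    refine hE1.trans (mul_le_mul' (ENNReal.ofReal_le_ofReal ?_) le_rfl)
    rw [div_le_div_iff₀ ht2 ht]
    have hKt : 0 ≤ K * t * (t - 1) := mul_nonneg (mul_nonneg hKnn ht.le) (sub_nonneg.2 h1t)
    nlinarith
  · -- `t < 1`: `|E| ≤ |B| ≤ (K+1)|B|/t`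
    calc volume E ≤ volume (ball x₀ r) := measure_mono hEsub
      _ = 1 * volume (ball x₀ r) := (one_mul _).symm
      _ ≤ ENNReal.ofReal ((K + 1) / t) * volume (ball x₀ r) := by
          refine mul_le_mul' ?_ le_rfl
          rw [← ENNReal.ofReal_one]
          refine ENNReal.ofReal_le_ofReal ?_
          rw [le_div_iff₀ ht]
          nlinarith

end Literature.Analysis.PDE.DivForm.LocalLogOsc

end

end Part4

/-!
## Part 5 — port of `Summits/NavierStokesRegularity/NavierStokesRegularity/Theorems/PoloidalWindowDoorPoloidalWindowRigidityDivFormLocalHarnackInputs.lean`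

# Route `PoloidalWindowDoor`, crux K2 (stmt-NavierStokesRegularity-19708) — the two inputs of the Bombieri–Giusti lemma
# for LOCAL weak solutions of `div(a∇w) = 0` (towards `divFormStrongMaximumPrinciple_holds`, GT 8.19)

For a `C¹` function `w ≥ 1` solving `div(a∇w) = 0` weakly against test functions supported in `U ⊇ B̄(x₀,4R)`
(hypothesis of `Literature.Analysis.PDE.divFormStrongMaximumPrinciple`), `n ≥ 3`, this file packages, in exactly the
form consumed by `Literature.Analysis.FunctionSpaces.bombieriGiusti` with `S θ = B̄(x₀, 2θR)`:

* `exists_chain_exponent_between` — admissible Moser exponents are log-dense: for every `p > 0` some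
  `p₁ ∈ [p/κ, p]` of the form `κ^{j+½}` has a chain `p₁κ^k` avoiding `1` (refines `…DivFormHarnack.exists_chain_exponent`);
* `local_sup_bound` — hypothesis (B): from `moser_chain_local` between `B̄(x₀,2θ'R) ⊂ B̄(x₀,2θR)`,
  `(m w(x)^σ)^{p₁} ≤ C₁/(θ−θ')^n · |B̄(x₀,2R)|⁻¹ ∫_{B̄(x₀,2θR)} (m w^σ)^{p₁}` for `x ∈ B̄(x₀,2θ'R)`, `σ = ±1`, `m > 0`,
  with `C₁ = C₁(n, λ, Λ)` free of `R`, `p₁`, `m`;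
* `local_log_levelset` — hypothesis (A): `|{t < log f} ∩ B̄(x₀,2R)| ≤ (C_A/t)|B̄(x₀,2R)|` whenever
  `log f ≤ |log w − (log w)_{B(x₀,2R)}|` (from `measure_ball_logOsc_gt_le_local`).

Seat ns-in-ser-b g5 (cell pub/ns-inputs), `ledger fact claim` #1 on `Literature.Analysis.PDE.divFormStrongMaximumPrinciple`.
WHAT THIS IS NOT: the Harnack inequality itself is assembled in the sequel file; nothing NS-specific, no NS statement is
touched.
-/

section Part5

noncomputable section

open _root_.MeasureTheory _root_.Set _root_.Function _root_.Filter _root_.Topology _root_.Metric _root_.Module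
open scoped _root_.Matrix _root_.ENNReal _root_.NNReal

namespace Literature.Analysis.PDE.DivForm.LocalHarnackInputs

open Literature.Analysis.PDE.DivForm.Caccioppoli
open Literature.Analysis.PDE.DivForm.ReverseHolder
open Literature.Analysis.PDE.DivForm.MoserStep
open Literature.Analysis.PDE.DivForm.LogBMO
open Literature.Analysis.PDE.DivForm.Harnack
open Literature.Analysis.PDE.DivForm.LocalMoser
open Literature.Analysis.PDE.DivForm.LocalLogOsc
open Literature.Analysis.FunctionSpaces

variable {n : ℕ}

/-! ### Admissible exponents are log-dense -/

/-- For `κ > 1` and `p₀ > 0` there is `p₁ ∈ [p₀/κ, p₀]` whose Moser chain `p₁κ^k` never meets `1`, with the uniform bound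
`(t/(t−1))² ≤ (√κ/(√κ−1))²`, `t = p₁κ^k` (shift the exponent of `exists_chain_exponent` up by the largest admissible
power of `κ`). [cite: GilbargTrudinger2001, Theorem 8.20 proof (inputs of the local Harnack inequality)] -/
theorem exists_chain_exponent_between {κ : ℝ} (hκ : 1 < κ) {p₀ : ℝ} (hp₀ : 0 < p₀) :
    ∃ p₁ : ℝ, p₀ / κ ≤ p₁ ∧ p₁ ≤ p₀ ∧ ∀ k : ℕ, 1 * (p₁ * κ ^ k) ≠ 1 ∧
      (1 * (p₁ * κ ^ k) / (1 * (p₁ * κ ^ k) - 1)) ^ 2 ≤ (Real.sqrt κ / (Real.sqrt κ - 1)) ^ 2 := by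
  obtain ⟨q, hq0, hqp₀, hq⟩ := exists_chain_exponent hκ hp₀
  have hκ0 : 0 < κ := zero_lt_one.trans hκ
  -- the first `m` with `p₀ < q κ^{m+1}`
  have hex : ∃ m : ℕ, p₀ < q * κ ^ (m + 1) := by
    obtain ⟨m, hm⟩ := pow_unbounded_of_one_lt (p₀ / q) hκ
    refine ⟨m, ?_⟩
    rw [div_lt_iff₀ hq0] at hm
    calc p₀ < κ ^ m * q := hm
      _ ≤ q * κ ^ (m + 1) := by
          rw [mul_comm, pow_succ]
          exact mul_le_mul_of_nonneg_left (le_mul_of_one_le_right (pow_nonneg hκ0.le m) hκ.le) hq0.le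
  classical
  set m := Nat.find hex with hm
  have hm1 : p₀ < q * κ ^ (m + 1) := Nat.find_spec hex
  have hm0 : q * κ ^ m ≤ p₀ := by
    rcases Nat.eq_zero_or_pos m with h0 | hpos
    · rw [h0, pow_zero, mul_one]; exact hqp₀
    · have h := Nat.find_min hex (m := m - 1) (by omega)
      rw [not_lt, show m - 1 + 1 = m by omega] at h
      exact h
  refine ⟨q * κ ^ m, ?_, hm0, fun k => ?_⟩
  · rw [div_le_iff₀ hκ0, mul_assoc, ← pow_succ]; exact hm1.le
  · have h := hq (m + k)
    simp only [pow_add, one_mul, ← mul_assoc] at h ⊢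
    exact h

/-! ### Hypothesis (B): the local sup bound in Bombieri–Giusti form -/

variable {a : EuclideanSpace ℝ (Fin n) → Matrix (Fin n) (Fin n) ℝ} {lam Λ : ℝ} {w : EuclideanSpace ℝ (Fin n) → ℝ}
  {U : Set (EuclideanSpace ℝ (Fin n))}

/-- **Hypothesis (B) of the Bombieri–Giusti lemma for a local weak solution** (`n ≥ 3`): with `K` the constant of
`moser_chain_local` (for the chain bound `D` and cutoff constant `C₀`), `V₀ = |B(0,1)|` and
`C₁ = max 1 (K^{n/2} · 4^{κ/(κ−1)²} · V₀)`, for `σ = ±1`, an admissible exponent `p₁`, `m > 0`, `0 < R`,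
`½ ≤ θ' < θ ≤ 1` and `B̄(x₀,2R) ⊆ U`: for every `x ∈ B̄(x₀,2θ'R)`,
`ofReal ((m w(x)^σ)^{p₁}) ≤ ofReal (C₁/(θ−θ')^n) · |B̄(x₀,2R)|⁻¹ · ∫⁻_{B̄(x₀,2θR)} ofReal ((m w^σ)^{p₁})`.
[cite: GilbargTrudinger2001, Theorem 8.20 proof (inputs of the local Harnack inequality)] -/
theorem local_sup_bound (hn : 3 ≤ n) (hsymm : ∀ y, (a y).IsSymm) (hlam : 0 < lam)
    (hmeas : ∀ i j, Measurable fun y => a y i j)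
    (hell : ∀ y (ξ : Fin n → ℝ), lam * (ξ ⬝ᵥ ξ) ≤ ξ ⬝ᵥ (a y *ᵥ ξ)) (hbd : ∀ y i j, |a y i j| ≤ Λ)
    (hw : ContDiff ℝ 1 w) (hw1 : ∀ y, 1 ≤ w y)
    (hweak : ∀ η : EuclideanSpace ℝ (Fin n) → ℝ, ContDiff ℝ 1 η → HasCompactSupport η → tsupport η ⊆ U →
      ∫ y, ∑ i, ∑ j, a y i j * fderiv ℝ w y (EuclideanSpace.single i 1) *
        fderiv ℝ η y (EuclideanSpace.single j 1) = 0)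
    {σ : ℝ} (hσ : σ = 1 ∨ σ = -1) {p₁ : ℝ} (hp₁ : 0 < p₁) {D : ℝ} (hD0 : 0 ≤ D)
    (hne : ∀ k : ℕ, σ * (p₁ * (n / (n - 2 : ℝ)) ^ k) ≠ 1)
    (hD : ∀ k : ℕ, (σ * (p₁ * (n / (n - 2 : ℝ)) ^ k) / (σ * (p₁ * (n / (n - 2 : ℝ)) ^ k) - 1)) ^ 2 ≤ D)
    {C₀ : ℝ} (hC₀ : 0 < C₀) (hcut : ∀ (x₀ : EuclideanSpace ℝ (Fin n)) (ρ' ρ : ℝ), 0 < ρ' → ρ' < ρ →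
      ∃ χ : EuclideanSpace ℝ (Fin n) → ℝ, ContDiff ℝ 1 χ ∧ HasCompactSupport χ ∧ (∀ x, 0 ≤ χ x ∧ χ x ≤ 1) ∧
        (∀ x ∈ closedBall x₀ ρ', χ x = 1) ∧ (∀ x, x ∉ ball x₀ ρ → χ x = 0) ∧ ∀ x, ‖fderiv ℝ χ x‖ ≤ C₀ / (ρ - ρ'))
    (x₀ : EuclideanSpace ℝ (Fin n)) {R : ℝ} (hR : 0 < R) (hU : closedBall x₀ (2 * R) ⊆ U)
    {θ' θ : ℝ} (hθ' : 1 / 2 ≤ θ') (hθ'θ : θ' < θ) (hθ : θ ≤ 1) {m : ℝ} (hm : 0 < m) :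
    ∀ x ∈ closedBall x₀ (2 * θ' * R),
      ENNReal.ofReal ((m * w x ^ σ) ^ p₁) ≤
        ENNReal.ofReal (max 1 (((max (eLpNormLESNormFDerivOfEqInnerConst
              (volume : Measure (EuclideanSpace ℝ (Fin n))) 2 : ℝ) 1) ^ 2 *
              (2 * (D * (n * Λ) + lam) / lam * (4 * C₀ ^ 2))) ^ ((n : ℝ) / 2) *
            (4 : ℝ) ^ ((n / (n - 2 : ℝ)) / ((n / (n - 2 : ℝ)) - 1) ^ 2) *
            (volume (ball (0 : EuclideanSpace ℝ (Fin n)) 1)).toReal) / (θ - θ') ^ (n : ℝ)) *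
          (volume (closedBall x₀ (2 * R)))⁻¹ *
          ∫⁻ y in closedBall x₀ (2 * θ * R), ENNReal.ofReal ((m * w y ^ σ) ^ p₁) := by
  intro x hx
  -- notation
  set κ : ℝ := n / (n - 2 : ℝ) with hκ
  set K : ℝ := (max (eLpNormLESNormFDerivOfEqInnerConst (volume : Measure (EuclideanSpace ℝ (Fin n))) 2 : ℝ) 1) ^ 2 *
    (2 * (D * (n * Λ) + lam) / lam * (4 * C₀ ^ 2)) with hK
  set e₂ : ℝ := κ / (κ - 1) ^ 2 with he₂
  set V₀ : ℝ≥0∞ := volume (ball (0 : EuclideanSpace ℝ (Fin n)) 1) with hV₀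
  set C₁ : ℝ := max 1 (K ^ ((n : ℝ) / 2) * (4 : ℝ) ^ e₂ * V₀.toReal) with hC₁
  set δ : ℝ := θ - θ' with hδ
  set r' : ℝ := 2 * θ' * R with hr'
  set r : ℝ := 2 * θ * R with hr
  have hn2 : (0 : ℝ) < n - 2 := by
    have : (3 : ℝ) ≤ n := by exact_mod_cast hn
    linarith
  have hnpos : (0 : ℝ) < n := by linarith
  have hκ1 : 1 < κ := by rw [hκ, lt_div_iff₀ hn2]; linarith
  have hκ0 : 0 < κ := zero_lt_one.trans hκ1
  have he₁ : κ / (κ - 1) = (n : ℝ) / 2 := by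
    rw [hκ]; field_simp; ring
  have hpos : ∀ y, 0 < w y := fun y => lt_of_lt_of_le one_pos (hw1 y)
  have hnΛ : 0 ≤ (n : ℝ) * Λ :=
    mul_nonneg (Nat.cast_nonneg n) ((abs_nonneg _).trans (hbd x₀ ⟨0, by omega⟩ ⟨0, by omega⟩))
  have hKnn : 0 ≤ K := by rw [hK]; positivity
  have hδpos : 0 < δ := by rw [hδ]; linarith
  have hr'pos : 0 < r' := by rw [hr']; nlinarith
  have hr'r : r' < r := by rw [hr', hr]; nlinarith
  have hrr' : r - r' = 2 * R * δ := by rw [hr, hr', hδ]; ring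
  have hrU : closedBall x₀ r ⊆ U := by
    refine (closedBall_subset_closedBall ?_).trans hU
    rw [hr]; nlinarith
  have hV₀0 : V₀ ≠ 0 := (measure_ball_pos volume _ one_pos).ne'
  have hV₀t : V₀ ≠ ⊤ := measure_ball_lt_top.ne
  have hV₀r : 0 < V₀.toReal := ENNReal.toReal_pos hV₀0 hV₀t
  -- (1) the local Moser chain between `B̄(x₀,r')` and `B̄(x₀,r)`
  have hchain := moser_chain_local hn hsymm hlam hmeas hell hbd hw hw1 hweak hσ hp₁ hD0 hne hD hC₀ hcut x₀
    hr'pos hr'r hrU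
  -- (2) pointwise value and the `L^{p₁}` norm as a lintegral
  set I : ℝ≥0∞ := ∫⁻ y in closedBall x₀ r, ENNReal.ofReal (w y ^ (σ * p₁)) with hI
  have hgcont : Continuous fun y => w y ^ σ := (contDiff_rpow_of_one_le hw hw1 σ).continuous
  have hxv : ENNReal.ofReal (w x ^ σ) ≤ eLpNorm (fun y => w y ^ σ) ∞ (volume.restrict (closedBall x₀ r')) := by
    have h := enorm_le_eLpNorm_top hgcont x₀ hr'pos hx
    rwa [Real.enorm_eq_ofReal (Real.rpow_nonneg (hpos x).le _)] at h
  have hNp : eLpNorm (fun y => w y ^ σ) (ENNReal.ofReal p₁) (volume.restrict (closedBall x₀ r)) = I ^ (1 / p₁) := by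
    rw [eLpNorm_rpow_eq _ hpos σ hp₁]
  -- the `p₁`-free constant `G`
  set G : ℝ≥0∞ := ENNReal.ofReal (K / (r - r') ^ 2) ^ (κ / (κ - 1)) * (4 : ℝ≥0∞) ^ e₂ with hG
  have hstep : ENNReal.ofReal (w x ^ σ) ≤ G ^ (1 / p₁) * I ^ (1 / p₁) := by
    refine hxv.trans (hchain.trans (le_of_eq ?_))
    rw [hNp, hG, ENNReal.mul_rpow_of_nonneg _ _ (by positivity : (0 : ℝ) ≤ 1 / p₁), ← ENNReal.rpow_mul,
      ← ENNReal.rpow_mul]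
    congr 2
    · congr 1; rw [hκ]; field_simp
    · congr 1; rw [he₂, hκ]; field_simp
  -- raise to the power `p₁`
  have hpow : ENNReal.ofReal (w x ^ (σ * p₁)) ≤ G * I := by
    have h := ENNReal.rpow_le_rpow hstep hp₁.le
    rw [ENNReal.mul_rpow_of_nonneg _ _ hp₁.le, ← ENNReal.rpow_mul, ← ENNReal.rpow_mul,
      show 1 / p₁ * p₁ = 1 by field_simp, ENNReal.rpow_one, ENNReal.rpow_one,
      ENNReal.ofReal_rpow_of_pos (Real.rpow_pos_of_pos (hpos x) σ), ← Real.rpow_mul (hpos x).le] at h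
    exact h
  -- (3) the constant: `G ≤ ofReal (C₁/δ^n) · |B̄(x₀,2R)|⁻¹`
  have hfin : finrank ℝ (EuclideanSpace ℝ (Fin n)) = n := finrank_euclideanSpace_fin
  have hV : volume (closedBall x₀ (2 * R)) = ENNReal.ofReal ((2 * R) ^ n) * V₀ := by
    rw [Measure.addHaar_closedBall volume x₀ (by positivity : (0 : ℝ) ≤ 2 * R), hfin]
  have h2R : 0 < (2 * R) ^ n := by positivity
  have hGeq : G = ENNReal.ofReal (K ^ ((n : ℝ) / 2) * (4 : ℝ) ^ e₂ / δ ^ (n : ℝ) / (2 * R) ^ n) := by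
    rw [hG, he₁, ENNReal.ofReal_rpow_of_nonneg (by positivity) (by positivity), hrr',
      show (4 : ℝ≥0∞) = ENNReal.ofReal 4 by norm_num, ENNReal.ofReal_rpow_of_pos (by norm_num : (0:ℝ) < 4),
      ← ENNReal.ofReal_mul (by positivity)]
    congr 1
    rw [Real.div_rpow hKnn (sq_nonneg _), show ((2 * R * δ) ^ 2) ^ ((n : ℝ) / 2) = (2 * R) ^ n * δ ^ (n : ℝ) by
      rw [← Real.rpow_natCast (2 * R * δ) 2, ← Real.rpow_mul (by positivity),
        show ((2 : ℕ) : ℝ) * ((n : ℝ) / 2) = (n : ℝ) by push_cast; ring, Real.mul_rpow (by positivity) hδpos.le,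
        Real.rpow_natCast]]
    field_simp
  have hC₁ge : K ^ ((n : ℝ) / 2) * (4 : ℝ) ^ e₂ ≤ C₁ / V₀.toReal := by
    rw [le_div_iff₀ hV₀r, hC₁]; exact le_max_right _ _
  have hconst : G ≤ ENNReal.ofReal (C₁ / δ ^ (n : ℝ)) * (volume (closedBall x₀ (2 * R)))⁻¹ := by
    rw [hGeq, hV, ENNReal.mul_inv (Or.inl (ENNReal.ofReal_pos.2 h2R).ne') (Or.inl ENNReal.ofReal_ne_top),
      ← ENNReal.ofReal_toReal hV₀t, ← ENNReal.ofReal_inv_of_pos h2R, ← ENNReal.ofReal_inv_of_pos hV₀r,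
      ← ENNReal.ofReal_mul (by positivity), ← ENNReal.ofReal_mul (by positivity)]
    refine ENNReal.ofReal_le_ofReal ?_
    have hδn : 0 < δ ^ (n : ℝ) := Real.rpow_pos_of_pos hδpos _
    have hrhs : C₁ / δ ^ (n : ℝ) * (((2 * R) ^ n)⁻¹ * V₀.toReal⁻¹) = C₁ / V₀.toReal / δ ^ (n : ℝ) / (2 * R) ^ n := by
      field_simp
    rw [hrhs]
    exact div_le_div_of_nonneg_right (div_le_div_of_nonneg_right hC₁ge hδn.le) h2R.le
  -- (4) assemble, inserting the factor `m^{p₁}`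
  have hmσ : ∀ y, (m * w y ^ σ) ^ p₁ = m ^ p₁ * w y ^ (σ * p₁) := fun y => by
    rw [Real.mul_rpow hm.le (Real.rpow_nonneg (hpos y).le _), ← Real.rpow_mul (hpos y).le]
  have hIm : ∫⁻ y in closedBall x₀ r, ENNReal.ofReal ((m * w y ^ σ) ^ p₁) = ENNReal.ofReal (m ^ p₁) * I := by
    rw [hI, ← lintegral_const_mul' _ _ ENNReal.ofReal_ne_top]
    refine lintegral_congr fun y => ?_
    rw [hmσ, ENNReal.ofReal_mul (Real.rpow_nonneg hm.le _)]
  rw [show closedBall x₀ (2 * θ * R) = closedBall x₀ r by rw [hr], hIm, hmσ,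
    ENNReal.ofReal_mul (Real.rpow_nonneg hm.le _)]
  calc ENNReal.ofReal (m ^ p₁) * ENNReal.ofReal (w x ^ (σ * p₁))
      ≤ ENNReal.ofReal (m ^ p₁) * (G * I) := mul_le_mul' le_rfl hpow
    _ ≤ ENNReal.ofReal (m ^ p₁) * (ENNReal.ofReal (C₁ / δ ^ (n : ℝ)) * (volume (closedBall x₀ (2 * R)))⁻¹ * I) :=
        mul_le_mul' le_rfl (mul_le_mul' hconst le_rfl)
    _ = ENNReal.ofReal (C₁ / δ ^ (n : ℝ)) * (volume (closedBall x₀ (2 * R)))⁻¹ * (ENNReal.ofReal (m ^ p₁) * I) := by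
        ring

/-! ### Hypothesis (A): the logarithmic level sets -/

/-- **Hypothesis (A) of the Bombieri–Giusti lemma for a local weak solution**: if `B̄(x₀,4R) ⊆ U` and
`log f ≤ |log w − c|` pointwise, `c = (log w)_{B(x₀,2R)}`, then for `t > 0`
`|{z ∈ B̄(x₀,2R) : t < log f z}| ≤ ((K+1)/t) |B̄(x₀,2R)|`, `K = 16·4ⁿ nΛC₀²/λ` (`C₀` a ball-cutoff constant).
[cite: GilbargTrudinger2001, Theorem 8.20 proof (inputs of the local Harnack inequality)] -/
theorem local_log_levelset (hsymm : ∀ y, (a y).IsSymm) (hlam : 0 < lam)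
    (hmeas : ∀ i j, Measurable fun y => a y i j)
    (hell : ∀ y (ξ : Fin n → ℝ), lam * (ξ ⬝ᵥ ξ) ≤ ξ ⬝ᵥ (a y *ᵥ ξ)) (hbd : ∀ y i j, |a y i j| ≤ Λ)
    (hw : ContDiff ℝ 1 w) (hw1 : ∀ y, 1 ≤ w y)
    (hweak : ∀ η : EuclideanSpace ℝ (Fin n) → ℝ, ContDiff ℝ 1 η → HasCompactSupport η → tsupport η ⊆ U →
      ∫ y, ∑ i, ∑ j, a y i j * fderiv ℝ w y (EuclideanSpace.single i 1) *
        fderiv ℝ η y (EuclideanSpace.single j 1) = 0)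
    {C₀ : ℝ}
    (hcut : ∀ (x₀ : EuclideanSpace ℝ (Fin n)) (r : ℝ), 0 < r →
      ∃ χ : EuclideanSpace ℝ (Fin n) → ℝ, ContDiff ℝ 1 χ ∧ HasCompactSupport χ ∧ (∀ x, 0 ≤ χ x ∧ χ x ≤ 1) ∧
        (∀ x ∈ ball x₀ r, χ x = 1) ∧ (∀ x, x ∉ ball x₀ (2 * r) → χ x = 0) ∧ ∀ x, ‖fderiv ℝ χ x‖ ≤ C₀ / r)
    (x₀ : EuclideanSpace ℝ (Fin n)) {R : ℝ} (hR : 0 < R) (hU : closedBall x₀ (4 * R) ⊆ U)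
    {f : EuclideanSpace ℝ (Fin n) → ℝ}
    (hf : ∀ z, Real.log (f z) ≤ |Real.log (w z) - ⨍ y in ball x₀ (2 * R), Real.log (w y)|) {t : ℝ} (ht : 0 < t) :
    volume {z ∈ closedBall x₀ (2 * R) | t < Real.log (f z)} ≤
      ENNReal.ofReal ((16 * 4 ^ n * (n * Λ) * C₀ ^ 2 / lam + 1) / t) * volume (closedBall x₀ (2 * R)) := by
  have h2R : 0 < 2 * R := by positivity
  have hU' : closedBall x₀ (2 * (2 * R)) ⊆ U := by rw [show 2 * (2 * R) = 4 * R by ring]; exact hU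
  have hD := measure_ball_logOsc_gt_le_local hsymm hlam hmeas hell hbd hw hw1 hweak hcut x₀ h2R hU' ht
  rw [JohnNirenberg.volume_closedBall_eq_volume_ball x₀ h2R]
  refine le_trans ?_ hD
  -- closed ball versus open ball: a null sphere
  have hae := JohnNirenberg.closedBall_ae_eq_ball (E := EuclideanSpace ℝ (Fin n)) x₀ h2R
  have hsub : {z ∈ closedBall x₀ (2 * R) | t < Real.log (f z)} ⊆
      {z ∈ ball x₀ (2 * R) | t < |Real.log (w z) - ⨍ y in ball x₀ (2 * R), Real.log (w y)|} ∪
        (closedBall x₀ (2 * R) \ ball x₀ (2 * R)) := by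
    intro z hz
    by_cases hzb : z ∈ ball x₀ (2 * R)
    · exact Or.inl ⟨hzb, hz.2.trans_le (hf z)⟩
    · exact Or.inr ⟨hz.1, hzb⟩
  refine (measure_mono hsub).trans ((measure_union_le _ _).trans ?_)
  have h0 : volume (closedBall x₀ (2 * R) \ ball x₀ (2 * R)) = 0 := (ae_eq_set.1 hae).1
  rw [h0, add_zero]

end Literature.Analysis.PDE.DivForm.LocalHarnackInputs

end

end Part5

/-!
## Part 6 — port of `Summits/NavierStokesRegularity/NavierStokesRegularity/Theorems/PoloidalWindowDoorPoloidalWindowRigidityDivFormLocalHarnack.lean`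

# Route `PoloidalWindowDoor`, crux K2 (stmt-NavierStokesRegularity-19708) — the INTERIOR HARNACK INEQUALITY for LOCAL
# weak solutions of `div(a∇w) = 0`, `n ≥ 3` (Moser 1961 Thm 1 / Gilbarg–Trudinger Thm 8.20, localised; towards
# `divFormStrongMaximumPrinciple_holds`, GT 8.19)

`harnack_local`: there is `C_H = C_H(n, λ, Λ)` such that for every coefficient field `a` (measurable, symmetric,
`λ|ξ|² ≤ ξ·aξ`, `|aᵢⱼ| ≤ Λ`), every open `U`, every `C¹` function `w ≥ 1` solving `div(a∇w) = 0` weakly against the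
test functions supported in `U` (the hypothesis of `Literature.Analysis.PDE.divFormStrongMaximumPrinciple`), and every
ball with `B̄(x₀,4R) ⊆ U`:  `w(x) ≤ C_H · w(y)` for all `x, y ∈ B̄(x₀,R)`.

Proof (Moser 1971 / Bombieri–Giusti, no `BMO`): apply `Literature.Analysis.FunctionSpaces.bombieriGiusti` on the balls
`S θ = B̄(x₀,2θR)` to `f₁ = e^{−c} w` and `f₂ = e^{c}/w`, `c = (log w)_{B(x₀,2R)}`: hypothesis (A) is
`…LocalHarnackInputs.local_log_levelset` (Poincaré–Wirtinger + logarithmic Caccioppoli), hypothesis (B) is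
`…LocalHarnackInputs.local_sup_bound` (the local Moser chains, `σ = ±1`, at the log-dense admissible exponents of
`exists_chain_exponent_between`).  Then `log w − c ≤ A₀` and `c − log w ≤ A₀` on `B̄(x₀,R)`, i.e. `C_H = e^{2A₀}`.

Seat ns-in-ser-b g5 (cell pub/ns-inputs), `ledger fact claim` #1 on `Literature.Analysis.PDE.divFormStrongMaximumPrinciple`.
WHAT THIS IS NOT: not yet the strong maximum principle (sequel: globalisation of a local solution, clopen argument,
descent to `n ≤ 2`); nothing NS-specific, no NS statement is touched.
-/

section Part6

noncomputable section

open _root_.MeasureTheory _root_.Set _root_.Function _root_.Filter _root_.Topology _root_.Metric _root_.Module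
open scoped _root_.Matrix _root_.ENNReal _root_.NNReal

namespace Literature.Analysis.PDE.DivForm.LocalHarnack

open Literature.Analysis.PDE.DivForm.Caccioppoli
open Literature.Analysis.PDE.DivForm.ReverseHolder
open Literature.Analysis.PDE.DivForm.MoserStep
open Literature.Analysis.PDE.DivForm.LogBMO
open Literature.Analysis.PDE.DivForm.LocalHarnackInputs
open Literature.Analysis.FunctionSpaces

variable {n : ℕ}

/-- **INTERIOR HARNACK INEQUALITY for local weak solutions** (Moser 1961, Thm 1; Gilbarg–Trudinger Thm 8.20 — here for
`C¹` weak solutions and via Moser 1971 / Bombieri–Giusti instead of John–Nirenberg), `n ≥ 3`: there is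
`C_H = C_H(n,λ,Λ) ≥ 0` such that for every admissible coefficient field `a`, every set `U`, every `C¹` function `w ≥ 1`
with `∫ Σ aᵢⱼ ∂ᵢw ∂ⱼη = 0` for all `η ∈ C¹_c` with `tsupport η ⊆ U`, and every ball with `B̄(x₀,4R) ⊆ U`, `R > 0`:
`w x ≤ C_H · w y` for all `x, y ∈ B̄(x₀,R)`.
[cite: GilbargTrudinger2001, Theorem 8.20 pp.199–200 (local Harnack inequality)] -/
theorem harnack_local (hn : 3 ≤ n) {lam : ℝ} (hlam : 0 < lam) (Λ : ℝ) :
    ∃ C_H : ℝ, 0 ≤ C_H ∧ ∀ (a : EuclideanSpace ℝ (Fin n) → Matrix (Fin n) (Fin n) ℝ),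
      (∀ i j, Measurable fun y => a y i j) → (∀ y, (a y).IsSymm) →
      (∀ y (ξ : Fin n → ℝ), lam * (ξ ⬝ᵥ ξ) ≤ ξ ⬝ᵥ (a y *ᵥ ξ)) → (∀ y i j, |a y i j| ≤ Λ) →
      ∀ (U : Set (EuclideanSpace ℝ (Fin n))) (w : EuclideanSpace ℝ (Fin n) → ℝ), ContDiff ℝ 1 w → (∀ y, 1 ≤ w y) →
        (∀ η : EuclideanSpace ℝ (Fin n) → ℝ, ContDiff ℝ 1 η → HasCompactSupport η → tsupport η ⊆ U →
          ∫ y, ∑ i, ∑ j, a y i j * fderiv ℝ w y (EuclideanSpace.single i 1) *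
            fderiv ℝ η y (EuclideanSpace.single j 1) = 0) →
        ∀ (x₀ : EuclideanSpace ℝ (Fin n)) (R : ℝ), 0 < R → closedBall x₀ (4 * R) ⊆ U →
          ∀ x ∈ closedBall x₀ R, ∀ y ∈ closedBall x₀ R, w x ≤ C_H * w y := by
  -- structural constants
  set κ : ℝ := n / (n - 2 : ℝ) with hκ
  have hn2 : (0 : ℝ) < n - 2 := by
    have : (3 : ℝ) ≤ n := by exact_mod_cast hn
    linarith
  have hnpos : (0 : ℝ) < n := by linarith
  have hκ1 : 1 < κ := by rw [hκ, lt_div_iff₀ hn2]; linarith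
  have hκ0 : 0 < κ := zero_lt_one.trans hκ1
  obtain ⟨C₀c, hC₀c0, hcutc⟩ := exists_closedBall_cutoff n
  obtain ⟨C₀b, -, hcutb⟩ := exists_ball_cutoff n
  set C₁c : ℝ := C₀c + 1 with hC₁c
  have hC₁cpos : 0 < C₁c := by rw [hC₁c]; linarith
  have hcut' : ∀ (x₀ : EuclideanSpace ℝ (Fin n)) (ρ' ρ : ℝ), 0 < ρ' → ρ' < ρ →
      ∃ χ : EuclideanSpace ℝ (Fin n) → ℝ, ContDiff ℝ 1 χ ∧ HasCompactSupport χ ∧ (∀ x, 0 ≤ χ x ∧ χ x ≤ 1) ∧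
        (∀ x ∈ closedBall x₀ ρ', χ x = 1) ∧ (∀ x, x ∉ ball x₀ ρ → χ x = 0) ∧
        ∀ x, ‖fderiv ℝ χ x‖ ≤ C₁c / (ρ - ρ') := by
    intro x₀ ρ' ρ hρ' hρ
    obtain ⟨χ, h1, h2, h3, h4, h5, h6⟩ := hcutc x₀ ρ' ρ hρ' hρ
    refine ⟨χ, h1, h2, h3, h4, h5, fun x => (h6 x).trans ?_⟩
    exact div_le_div_of_nonneg_right (by rw [hC₁c]; linarith) (by linarith)
  set D₁ : ℝ := (Real.sqrt κ / (Real.sqrt κ - 1)) ^ 2 with hD₁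
  set CS : ℝ := max (eLpNormLESNormFDerivOfEqInnerConst (volume : Measure (EuclideanSpace ℝ (Fin n))) 2 : ℝ) 1 with hCS
  set V₀r : ℝ := (volume (ball (0 : EuclideanSpace ℝ (Fin n)) 1)).toReal with hV₀r
  set e₂ : ℝ := κ / (κ - 1) ^ 2 with he₂
  set C₁p : ℝ := max 1 ((CS ^ 2 * (2 * (D₁ * (n * Λ) + lam) / lam * (4 * C₁c ^ 2))) ^ ((n : ℝ) / 2) *
    (4 : ℝ) ^ e₂ * V₀r) with hC₁p
  set C₁m : ℝ := max 1 ((CS ^ 2 * (2 * (1 * (n * Λ) + lam) / lam * (4 * C₁c ^ 2))) ^ ((n : ℝ) / 2) *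
    (4 : ℝ) ^ e₂ * V₀r) with hC₁m
  set C₁ : ℝ := max C₁p C₁m with hC₁
  have hC₁1 : 1 ≤ C₁ := (le_max_left _ _).trans (le_max_left _ _)
  set C_A : ℝ := 16 * 4 ^ n * (n * Λ) * C₀b ^ 2 / lam + 1 with hC_A
  set C₀g : ℝ := max C_A 1 with hC₀g
  have hC₀gpos : 0 < C₀g := lt_of_lt_of_le one_pos (le_max_right _ _)
  set A₀ : ℝ := 4 * C₀g * (2 * C₁) ^ (2 * κ) * 4 ^ ((n : ℝ) * κ) * (16 * ((n : ℝ) * κ)) ^ (4 * ((n : ℝ) * κ))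
    with hA₀
  refine ⟨Real.exp (2 * A₀), (Real.exp_pos _).le,
    fun a hmeas hsymm hell hbd U w hw hw1 hweak x₀ R hR hU x hx y hy => ?_⟩
  -- inside: positivity and the two balls
  have hpos : ∀ z, 0 < w z := fun z => lt_of_lt_of_le one_pos (hw1 z)
  have hU2 : closedBall x₀ (2 * R) ⊆ U := (closedBall_subset_closedBall (by linarith)).trans hU
  -- Bombieri–Giusti data: the balls `S θ = B̄(x₀, 2θR)`
  set S : ℝ → Set (EuclideanSpace ℝ (Fin n)) := fun θ => closedBall x₀ (2 * θ * R) with hSdef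
  have hS : ∀ ⦃θ' θ : ℝ⦄, θ' ≤ θ → S θ' ⊆ S θ := fun θ' θ h =>
    closedBall_subset_closedBall (by nlinarith)
  have hSm : ∀ θ, MeasurableSet (S θ) := fun θ => measurableSet_closedBall
  have hS1 : S 1 = closedBall x₀ (2 * R) := by simp only [hSdef]; ring_nf
  have hShalf : S (1 / 2) = closedBall x₀ R := by simp only [hSdef]; ring_nf
  have hV0 : volume (S 1) ≠ 0 := by rw [hS1]; exact (measure_closedBall_pos volume x₀ (by positivity)).ne'
  have hVt : volume (S 1) ≠ ⊤ := by rw [hS1]; exact measure_closedBall_lt_top.ne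
  -- the two functions
  set c : ℝ := ⨍ z in ball x₀ (2 * R), Real.log (w z) with hc
  set f₁ : EuclideanSpace ℝ (Fin n) → ℝ := fun z => Real.exp (-c) * w z ^ (1 : ℝ) with hf₁
  set f₂ : EuclideanSpace ℝ (Fin n) → ℝ := fun z => Real.exp c * w z ^ (-1 : ℝ) with hf₂
  have hf₁pos : ∀ z, 0 < f₁ z := fun z => mul_pos (Real.exp_pos _) (Real.rpow_pos_of_pos (hpos z) _)
  have hf₂pos : ∀ z, 0 < f₂ z := fun z => mul_pos (Real.exp_pos _) (Real.rpow_pos_of_pos (hpos z) _)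
  have hlog₁ : ∀ z, Real.log (f₁ z) = Real.log (w z) - c := fun z => by
    show Real.log (Real.exp (-c) * w z ^ (1 : ℝ)) = _
    rw [Real.rpow_one, Real.log_mul (Real.exp_pos _).ne' (hpos z).ne', Real.log_exp]; ring
  have hlog₂ : ∀ z, Real.log (f₂ z) = c - Real.log (w z) := fun z => by
    show Real.log (Real.exp c * w z ^ (-1 : ℝ)) = _
    rw [Real.rpow_neg_one, Real.log_mul (Real.exp_pos _).ne' (inv_pos.2 (hpos z)).ne', Real.log_exp,
      Real.log_inv]; ring
  have hcont : ∀ s : ℝ, Continuous fun z => w z ^ s := fun s => (contDiff_rpow_of_one_le hw hw1 s).continuous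
  have hf₁m : Measurable f₁ := (continuous_const.mul (hcont 1)).measurable
  have hf₂m : Measurable f₂ := (continuous_const.mul (hcont (-1))).measurable
  -- qualitative bounds on `S 1` (compactness)
  have hbound : ∀ {f : EuclideanSpace ℝ (Fin n) → ℝ}, Continuous f → (∀ z, 0 < f z) →
      ∃ L : ℝ, ∀ z ∈ S 1, Real.log (f z) ≤ L := by
    intro f hf hfp
    obtain ⟨M, hM⟩ := (isCompact_closedBall x₀ (2 * 1 * R)).exists_bound_of_continuousOn hf.continuousOn
    refine ⟨M, fun z hz => ?_⟩
    have h1 : Real.log (f z) ≤ f z := (Real.log_le_sub_one_of_pos (hfp z)).trans (by linarith)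
    exact h1.trans ((le_abs_self _).trans ((Real.norm_eq_abs _).symm.le.trans (hM z hz)))
  obtain ⟨L₁, hL₁⟩ := hbound (continuous_const.mul (hcont 1)) hf₁pos
  obtain ⟨L₂, hL₂⟩ := hbound (continuous_const.mul (hcont (-1))) hf₂pos
  -- hypothesis (A) for both functions
  have hA : ∀ {f : EuclideanSpace ℝ (Fin n) → ℝ}, (∀ z, Real.log (f z) ≤ |Real.log (w z) - c|) →
      ∀ t : ℝ, 0 < t → volume {z ∈ S 1 | t < Real.log (f z)} ≤ ENNReal.ofReal (C₀g / t) * volume (S 1) := by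
    intro f hf t ht
    have h := local_log_levelset hsymm hlam hmeas hell hbd hw hw1 hweak hcutb x₀ hR hU hf ht
    rw [hS1]
    refine h.trans (mul_le_mul' (ENNReal.ofReal_le_ofReal ?_) le_rfl)
    exact div_le_div_of_nonneg_right (le_max_left _ _) ht.le
  have hA₁ := hA (f := f₁) (fun z => by rw [hlog₁]; exact le_abs_self _)
  have hA₂ := hA (f := f₂) (fun z => by rw [hlog₂, abs_sub_comm]; exact le_abs_self _)
  -- hypothesis (B): sup side (`σ = 1`)
  have hB₁ : ∀ (θ' θ p : ℝ), 1 / 2 ≤ θ' → θ' < θ → θ ≤ 1 → 0 < p → p ≤ 1 → ∃ p' : ℝ, p / κ ≤ p' ∧ p' ≤ p ∧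
      ∀ z ∈ S θ', ENNReal.ofReal (f₁ z ^ p') ≤
        ENNReal.ofReal (C₁ / (θ - θ') ^ (n : ℝ)) * (volume (S 1))⁻¹ * ∫⁻ y in S θ, ENNReal.ofReal (f₁ y ^ p') := by
    intro θ' θ p hθ' hθ'θ hθ hp _
    obtain ⟨p₁, hlo, hhi, hch⟩ := exists_chain_exponent_between hκ1 hp
    have hp₁ : 0 < p₁ := lt_of_lt_of_le (div_pos hp hκ0) hlo
    refine ⟨p₁, hlo, hhi, fun z hz => ?_⟩
    have h := local_sup_bound hn hsymm hlam hmeas hell hbd hw hw1 hweak (σ := 1) (Or.inl rfl) hp₁ (D := D₁)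
      (by positivity) (fun k => (hch k).1) (fun k => (hch k).2) hC₁cpos hcut' x₀ hR hU2 hθ' hθ'θ hθ
      (m := Real.exp (-c)) (Real.exp_pos _) z hz
    rw [hS1]
    refine h.trans (mul_le_mul' (mul_le_mul' (ENNReal.ofReal_le_ofReal
      (div_le_div_of_nonneg_right ?_ (Real.rpow_nonneg (by linarith) _))) le_rfl) le_rfl)
    show C₁p ≤ C₁
    exact le_max_left _ _
  -- hypothesis (B): inf side (`σ = -1`; every exponent is admissible)
  have hB₂ : ∀ (θ' θ p : ℝ), 1 / 2 ≤ θ' → θ' < θ → θ ≤ 1 → 0 < p → p ≤ 1 → ∃ p' : ℝ, p / κ ≤ p' ∧ p' ≤ p ∧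
      ∀ z ∈ S θ', ENNReal.ofReal (f₂ z ^ p') ≤
        ENNReal.ofReal (C₁ / (θ - θ') ^ (n : ℝ)) * (volume (S 1))⁻¹ * ∫⁻ y in S θ, ENNReal.ofReal (f₂ y ^ p') := by
    intro θ' θ p hθ' hθ'θ hθ hp _
    refine ⟨p, div_le_self hp.le hκ1.le, le_rfl, fun z hz => ?_⟩
    have hne : ∀ k : ℕ, (-1 : ℝ) * (p * (n / (n - 2 : ℝ)) ^ k) ≠ 1 := fun k => by
      have : 0 < p * (n / (n - 2 : ℝ)) ^ k := by rw [← hκ]; positivity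
      linarith
    have hD : ∀ k : ℕ, ((-1 : ℝ) * (p * (n / (n - 2 : ℝ)) ^ k) / ((-1 : ℝ) * (p * (n / (n - 2 : ℝ)) ^ k) - 1)) ^ 2 ≤ 1 := by
      intro k
      have hq : (-1 : ℝ) * (p * (n / (n - 2 : ℝ)) ^ k) < 0 := by
        have : 0 < p * (n / (n - 2 : ℝ)) ^ k := by rw [← hκ]; positivity
        linarith
      set q : ℝ := -1 * (p * (n / (n - 2 : ℝ)) ^ k)
      have h1 : 0 < q / (q - 1) := div_pos_of_neg_of_neg hq (by linarith)
      have h2 : q / (q - 1) ≤ 1 := by rw [div_le_one_of_neg (by linarith)]; linarith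
      nlinarith
    have h := local_sup_bound hn hsymm hlam hmeas hell hbd hw hw1 hweak (σ := -1) (Or.inr rfl) hp (D := 1)
      zero_le_one hne hD hC₁cpos hcut' x₀ hR hU2 hθ' hθ'θ hθ (m := Real.exp c) (Real.exp_pos _) z hz
    rw [hS1]
    refine h.trans (mul_le_mul' (mul_le_mul' (ENNReal.ofReal_le_ofReal
      (div_le_div_of_nonneg_right ?_ (Real.rpow_nonneg (by linarith) _))) le_rfl) le_rfl)
    show C₁m ≤ C₁
    exact le_max_right _ _
  -- the lemma, twice
  have hγ : (0 : ℝ) < n := hnpos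
  have hC₀p : 1 ≤ C₀g * 1 := by rw [mul_one]; exact le_max_right _ _
  have hxS : x ∈ S (1 / 2) := by rw [hShalf]; exact hx
  have hyS : y ∈ S (1 / 2) := by rw [hShalf]; exact hy
  have h₁ := bombieriGiusti (μ := volume) hS hSm hV0 hVt hf₁m (fun z _ => hf₁pos z) hL₁ hC₀gpos hC₀p hC₁1 hγ
    hκ1.le hA₁ hB₁ x hxS
  have h₂ := bombieriGiusti (μ := volume) hS hSm hV0 hVt hf₂m (fun z _ => hf₂pos z) hL₂ hC₀gpos hC₀p hC₁1 hγ
    hκ1.le hA₂ hB₂ y hyS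
  rw [hlog₁] at h₁
  rw [hlog₂] at h₂
  -- `log w x - log w y ≤ 2 A₀`
  have hxy : Real.log (w x) ≤ 2 * A₀ + Real.log (w y) := by rw [hA₀]; linarith
  calc w x = Real.exp (Real.log (w x)) := (Real.exp_log (hpos x)).symm
    _ ≤ Real.exp (2 * A₀ + Real.log (w y)) := Real.exp_le_exp.2 hxy
    _ = Real.exp (2 * A₀) * w y := by rw [Real.exp_add, Real.exp_log (hpos y)]

end Literature.Analysis.PDE.DivForm.LocalHarnack

end

end Part6

/-!
## Part 7 — port of `Summits/NavierStokesRegularity/NavierStokesRegularity/Theorems/PoloidalWindowDoorPoloidalWindowRigidityDivFormStrongMaximumPrincipleGlobalise.lean`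

# Route `PoloidalWindowDoor`, crux K2 (stmt-NavierStokesRegularity-19708) — GLOBALISATION of a local weak solution of
# `div(a∇v) = 0` (towards `divFormStrongMaximumPrinciple_holds`, Gilbarg–Trudinger Thm 8.19)

The named fact `Literature.Analysis.PDE.divFormStrongMaximumPrinciple` (GT Thm 8.19) and the line stub it serves have
their data only on an open set `Ω`: coefficients `a` symmetric / `λ`-elliptic / `Λ`-bounded for `y ∈ Ω`, a solution
`v ∈ C¹(Ω)` (`ContDiffOn`), and the weak equation `∫ Σᵢⱼ aᵢⱼ ∂ᵢv ∂ⱼη = 0` for tests with `tsupport η ⊆ Ω`.  The local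
De Giorgi–Nash–Moser files of this chain (`…DivFormLocalCaccioppoli` and its sequels, seat ns-in-ser-b) are written —
like their entire-solution siblings `…DivFormCaccioppoli…` — for a GLOBALLY `C¹` function `w ≥ 1` and GLOBAL coefficient
hypotheses, with the equation against tests supported in an open set `U`.  This file is the one-time cutoff
modification that puts local data in that form (`globalise_local_solution`; the coefficient part alone is
`exists_global_coeff`, and `integrand_congr_coeff` says the weak-form integrand only sees the coefficients on
`tsupport η`): given `closedBall x₁ ρ ⊆ Ω` (`ρ > 0`) and `v ≥ 1` on `Ω`,

* `aG := a` on `Ω`, `aG := λ·1` off `Ω` — measurable entries, symmetric, `λ`-elliptic and `|aGᵢⱼ| ≤ max Λ λ` EVERYWHERE;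
* `w := 1 + χ (v - 1)` with a `C¹` cutoff `χ`, `0 ≤ χ ≤ 1`, `χ = 1` on `closedBall x₁ ρ`, `tsupport χ ⊆ Ω` (the margin
  `closedBall x₁ (ρ + δ) ⊆ Ω` exists because a compact set inside an open set has a closed thickening inside it) —
  `w ∈ C¹(ℝⁿ)`, `w ≥ 1`, `w = v` on `closedBall x₁ ρ`;
* the weak equation for `(aG, w)` against EVERY `C¹_c` test with `tsupport η ⊆ ball x₁ ρ` (there `aG = a`,
  `Dw = Dv` on the open ball, and `Dη = 0` off `tsupport η`).

Seat ns-in-ser-a g7 (cell pub/ns-inputs), width piece W2 of ns-in-ser-b g5's programme for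
`divFormStrongMaximumPrinciple_holds` (interfaces fixed on pub/ns-inputs/STATUS 2026-08-28T18:22:32Z); the cutoff is
`exists_closedBall_cutoff` of `…DivFormMoserStep`.

WHAT THIS IS NOT: no estimate, no Harnack inequality, no maximum principle; nothing here is specific to Navier–Stokes
and no NS statement is touched.
-/

section Part7

noncomputable section

open _root_.MeasureTheory _root_.Set _root_.Function _root_.Filter _root_.Topology _root_.Metric
open scoped _root_.Matrix

namespace Literature.Analysis.PDE.DivForm.StrongMaximumPrincipleGlobalise

open Literature.Analysis.PDE.DivForm.MoserStep

variable {n : ℕ}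

/-- **Globalisation of the coefficients.**  If `a` has measurable entries and is symmetric, `λ`-elliptic (`λ > 0`)
and `Λ`-bounded on a measurable set `Ω`, then `aG := a` on `Ω`, `aG := λ·1` off `Ω` has measurable entries and is
symmetric, `λ`-elliptic and `(max Λ λ)`-bounded EVERYWHERE, and agrees with `a` on `Ω`.
[cite: GilbargTrudinger2001, Theorem 8.19 pp.198–199 (proof: from local Harnack to the strong maximum principle)] -/
theorem exists_global_coeff {Ω : Set (EuclideanSpace ℝ (Fin n))} (hΩ : MeasurableSet Ω)
    {a : EuclideanSpace ℝ (Fin n) → Matrix (Fin n) (Fin n) ℝ} {lam Λ : ℝ} (hlam : 0 < lam)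
    (hmeas : ∀ i j, Measurable fun y => a y i j) (hsymm : ∀ y ∈ Ω, (a y).IsSymm)
    (hell : ∀ y ∈ Ω, ∀ ξ : Fin n → ℝ, lam * (ξ ⬝ᵥ ξ) ≤ ξ ⬝ᵥ (a y *ᵥ ξ))
    (hbd : ∀ y ∈ Ω, ∀ i j, |a y i j| ≤ Λ) :
    ∃ aG : EuclideanSpace ℝ (Fin n) → Matrix (Fin n) (Fin n) ℝ,
      (∀ i j, Measurable fun y => aG y i j) ∧ (∀ y, (aG y).IsSymm) ∧
      (∀ y (ξ : Fin n → ℝ), lam * (ξ ⬝ᵥ ξ) ≤ ξ ⬝ᵥ (aG y *ᵥ ξ)) ∧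
      (∀ y i j, |aG y i j| ≤ max Λ lam) ∧ (∀ y ∈ Ω, aG y = a y) := by
  classical
  obtain ⟨aG, haG⟩ : ∃ aG : EuclideanSpace ℝ (Fin n) → Matrix (Fin n) (Fin n) ℝ,
      ∀ y, aG y = if y ∈ Ω then a y else lam • (1 : Matrix (Fin n) (Fin n) ℝ) := ⟨_, fun _ => rfl⟩
  have haGΩ : ∀ y ∈ Ω, aG y = a y := fun y hy => by rw [haG, if_pos hy]
  have haGc : ∀ y, y ∉ Ω → aG y = lam • (1 : Matrix (Fin n) (Fin n) ℝ) := fun y hy => by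
    rw [haG, if_neg hy]
  refine ⟨aG, ?_, ?_, ?_, ?_, haGΩ⟩
  · -- measurable entries
    intro i j
    have h : (fun y => aG y i j) =
        fun y => if y ∈ Ω then a y i j else (lam • (1 : Matrix (Fin n) (Fin n) ℝ)) i j := by
      funext y; rw [haG]; split_ifs <;> rfl
    rw [h]
    exact Measurable.ite hΩ (hmeas i j) measurable_const
  · -- symmetric
    intro y
    by_cases hy : y ∈ Ω
    · rw [haGΩ y hy]; exact hsymm y hy
    · rw [haGc y hy]; exact Matrix.isSymm_one.smul lam
  · -- elliptic
    intro y ξ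
    by_cases hy : y ∈ Ω
    · rw [haGΩ y hy]; exact hell y hy ξ
    · rw [haGc y hy, Matrix.smul_mulVec, Matrix.one_mulVec, dotProduct_smul, smul_eq_mul]
  · -- bounded
    intro y i j
    by_cases hy : y ∈ Ω
    · rw [haGΩ y hy]; exact (hbd y hy i j).trans (le_max_left _ _)
    · rw [haGc y hy, Matrix.smul_apply, Matrix.one_apply, smul_eq_mul]
      refine le_trans ?_ (le_max_right _ _)
      split_ifs <;> simp [abs_of_pos hlam, hlam.le]

/-- **The weak-form integrand only sees the coefficients on `tsupport η`.**  If `aG = a` on `Ω ⊇ tsupport η`, the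
integrands `Σᵢⱼ aGᵢⱼ ∂ᵢv ∂ⱼη` and `Σᵢⱼ aᵢⱼ ∂ᵢv ∂ⱼη` coincide everywhere (off `tsupport η`, `Dη = 0`).
[cite: GilbargTrudinger2001, Theorem 8.19 pp.198–199 (proof: from local Harnack to the strong maximum principle)] -/
theorem integrand_congr_coeff {Ω : Set (EuclideanSpace ℝ (Fin n))}
    {a aG : EuclideanSpace ℝ (Fin n) → Matrix (Fin n) (Fin n) ℝ} (haG : ∀ y ∈ Ω, aG y = a y)
    (v η : EuclideanSpace ℝ (Fin n) → ℝ) (hηΩ : tsupport η ⊆ Ω) :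
    (fun y => ∑ i, ∑ j, aG y i j * fderiv ℝ v y (EuclideanSpace.single i 1) *
        fderiv ℝ η y (EuclideanSpace.single j 1)) =
      fun y => ∑ i, ∑ j, a y i j * fderiv ℝ v y (EuclideanSpace.single i 1) *
        fderiv ℝ η y (EuclideanSpace.single j 1) := by
  funext y
  by_cases hy : y ∈ Ω
  · rw [haG y hy]
  · have hη0 : fderiv ℝ η y = 0 := fderiv_of_notMem_tsupport ℝ (fun h => hy (hηΩ h))
    simp [hη0]

/-- **Globalisation of a local weak solution by a cutoff.**  Let `Ω ⊆ ℝⁿ` be open, `a` a coefficient field with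
measurable entries which is symmetric, `λ`-elliptic (`λ > 0`) and `Λ`-bounded ON `Ω`, `v ∈ C¹(Ω)` with `v ≥ 1` on `Ω`
a weak solution of `div(a∇v) = 0` in `Ω` (tests `η ∈ C¹_c` with `tsupport η ⊆ Ω`), and `closedBall x₁ ρ ⊆ Ω`,
`ρ > 0`.  Then there are `aG`, `w` defined on all of `ℝⁿ` with: `aG` measurable, symmetric, `λ`-elliptic,
`|aGᵢⱼ| ≤ max Λ λ` everywhere and `aG = a` on `Ω`; `w ∈ C¹(ℝⁿ)`, `w ≥ 1` everywhere, `w = v` on `closedBall x₁ ρ`;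
and `∫ Σᵢⱼ aGᵢⱼ ∂ᵢw ∂ⱼη = 0` for every `η ∈ C¹_c(ℝⁿ)` with `tsupport η ⊆ ball x₁ ρ`.
[cite: GilbargTrudinger2001, Theorem 8.19 pp.198–199 (proof: from local Harnack to the strong maximum principle)] -/
theorem globalise_local_solution {Ω : Set (EuclideanSpace ℝ (Fin n))} (hΩ : IsOpen Ω)
    {a : EuclideanSpace ℝ (Fin n) → Matrix (Fin n) (Fin n) ℝ} {lam Λ : ℝ} (hlam : 0 < lam)
    (hmeas : ∀ i j, Measurable fun y => a y i j) (hsymm : ∀ y ∈ Ω, (a y).IsSymm)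
    (hell : ∀ y ∈ Ω, ∀ ξ : Fin n → ℝ, lam * (ξ ⬝ᵥ ξ) ≤ ξ ⬝ᵥ (a y *ᵥ ξ))
    (hbd : ∀ y ∈ Ω, ∀ i j, |a y i j| ≤ Λ)
    {v : EuclideanSpace ℝ (Fin n) → ℝ} (hv : ContDiffOn ℝ 1 v Ω) (hv1 : ∀ y ∈ Ω, 1 ≤ v y)
    (hweak : ∀ η : EuclideanSpace ℝ (Fin n) → ℝ, ContDiff ℝ 1 η → HasCompactSupport η →
      tsupport η ⊆ Ω →
      ∫ y, ∑ i, ∑ j, a y i j * fderiv ℝ v y (EuclideanSpace.single i 1) *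
        fderiv ℝ η y (EuclideanSpace.single j 1) = 0)
    {x₁ : EuclideanSpace ℝ (Fin n)} {ρ : ℝ} (hρ : 0 < ρ) (hB : closedBall x₁ ρ ⊆ Ω) :
    ∃ (aG : EuclideanSpace ℝ (Fin n) → Matrix (Fin n) (Fin n) ℝ) (w : EuclideanSpace ℝ (Fin n) → ℝ),
      (∀ i j, Measurable fun y => aG y i j) ∧ (∀ y, (aG y).IsSymm) ∧
      (∀ y (ξ : Fin n → ℝ), lam * (ξ ⬝ᵥ ξ) ≤ ξ ⬝ᵥ (aG y *ᵥ ξ)) ∧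
      (∀ y i j, |aG y i j| ≤ max Λ lam) ∧ (∀ y ∈ Ω, aG y = a y) ∧
      ContDiff ℝ 1 w ∧ (∀ y, 1 ≤ w y) ∧ (∀ y ∈ closedBall x₁ ρ, w y = v y) ∧
      (∀ η : EuclideanSpace ℝ (Fin n) → ℝ, ContDiff ℝ 1 η → HasCompactSupport η →
        tsupport η ⊆ ball x₁ ρ →
        ∫ y, ∑ i, ∑ j, aG y i j * fderiv ℝ w y (EuclideanSpace.single i 1) *
          fderiv ℝ η y (EuclideanSpace.single j 1) = 0) := by
  -- a margin `closedBall x₁ (δ + ρ) ⊆ Ω`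
  obtain ⟨δ, hδ, hδΩ⟩ := (isCompact_closedBall x₁ ρ).exists_cthickening_subset_open hΩ hB
  rw [cthickening_closedBall hδ.le hρ.le] at hδΩ
  -- the cutoff
  obtain ⟨C₀, -, hcut⟩ := exists_closedBall_cutoff n
  obtain ⟨χ, hχ, -, hχ01, hχ1, hχ0, -⟩ := hcut x₁ ρ (δ + ρ) hρ (by linarith)
  have hsupp : support χ ⊆ ball x₁ (δ + ρ) := fun y hy => by
    by_contra h
    exact hy (hχ0 y h)
  have hχΩ : tsupport χ ⊆ Ω :=
    (closure_mono hsupp).trans (closure_ball_subset_closedBall.trans hδΩ)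
  -- the extensions
  obtain ⟨aG, haGm, haGs, haGe, haGb, haGΩ⟩ := exists_global_coeff hΩ.measurableSet hlam hmeas hsymm hell hbd
  obtain ⟨w, hw⟩ : ∃ w : EuclideanSpace ℝ (Fin n) → ℝ, ∀ y, w y = 1 + χ y * (v y - 1) :=
    ⟨_, fun _ => rfl⟩
  have hwfun : w = fun y => 1 + χ y * (v y - 1) := funext hw
  have hwB : ∀ y ∈ closedBall x₁ ρ, w y = v y := fun y hy => by
    rw [hw, hχ1 y hy]; ring
  refine ⟨aG, w, haGm, haGs, haGe, haGb, haGΩ, ?_, ?_, hwB, ?_⟩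
  · -- `w ∈ C¹(ℝⁿ)`
    have hΩ' : ContDiffOn ℝ 1 w Ω := by
      rw [hwfun]
      exact contDiffOn_const.add (hχ.contDiffOn.mul (hv.sub contDiffOn_const))
    rw [contDiff_iff_contDiffAt]
    intro y
    by_cases hy : y ∈ Ω
    · exact hΩ'.contDiffAt (hΩ.mem_nhds hy)
    · have hy' : y ∉ tsupport χ := fun h => hy (hχΩ h)
      have hev : χ =ᶠ[𝓝 y] 0 := notMem_tsupport_iff_eventuallyEq.1 hy'
      have hev' : w =ᶠ[𝓝 y] fun _ => (1 : ℝ) := hev.mono fun z hz => by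
        rw [hw, hz, Pi.zero_apply, zero_mul, add_zero]
      exact contDiffAt_const.congr_of_eventuallyEq hev'
  · -- `w ≥ 1`
    intro y
    rw [hw]
    by_cases hy : y ∈ Ω
    · nlinarith [hv1 y hy, (hχ01 y).1]
    · have hy' : y ∉ tsupport χ := fun h => hy (hχΩ h)
      rw [image_eq_zero_of_notMem_tsupport hy']; simp
  · -- the weak equation against tests supported in `ball x₁ ρ`
    intro η hη hηc hηU
    have hwv : ∀ y ∈ ball x₁ ρ, fderiv ℝ w y = fderiv ℝ v y := by
      intro y hy
      refine Filter.EventuallyEq.fderiv_eq ?_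
      filter_upwards [isOpen_ball.mem_nhds hy] with z hz
      exact hwB z (ball_subset_closedBall hz)
    have hint : (fun y => ∑ i, ∑ j, aG y i j * fderiv ℝ w y (EuclideanSpace.single i 1) *
          fderiv ℝ η y (EuclideanSpace.single j 1)) =
        fun y => ∑ i, ∑ j, aG y i j * fderiv ℝ v y (EuclideanSpace.single i 1) *
          fderiv ℝ η y (EuclideanSpace.single j 1) := by
      funext y
      by_cases hy : y ∈ ball x₁ ρ
      · rw [hwv y hy]
      · have hη0 : fderiv ℝ η y = 0 := fderiv_of_notMem_tsupport ℝ (fun h => hy (hηU h))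
        simp [hη0]
    rw [hint, integrand_congr_coeff haGΩ v η (hηU.trans (ball_subset_closedBall.trans hB))]
    exact hweak η hη hηc (hηU.trans (ball_subset_closedBall.trans hB))

end Literature.Analysis.PDE.DivForm.StrongMaximumPrincipleGlobalise

end

end Part7

/-!
## Part 8 — port of `Summits/NavierStokesRegularity/NavierStokesRegularity/Theorems/PoloidalWindowDoorPoloidalWindowRigidityDivFormStrongMaximumPrincipleDescent.lean`

# Route `PoloidalWindowDoor`, crux K2 (stmt-NavierStokesRegularity-19708) — DESCENT `n + 1 ⇒ n` of the strong maximum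
# principle for `div(a∇u) = 0` (towards `divFormStrongMaximumPrinciple_holds`, Gilbarg–Trudinger Thm 8.19)

`P n` denotes the body of the named fact `Literature.Analysis.PDE.divFormStrongMaximumPrinciple` at a FIXED dimension
`n` (spelled out binder for binder, no new definition): on an open preconnected `Ω ⊆ ℝⁿ`, for symmetric
`λ`-elliptic `Λ`-bounded measurable coefficients on `Ω` and `u ∈ C¹(Ω)` a weak solution against tests with
`tsupport η ⊆ Ω`, an interior maximum point `x₀` forces `u ≡ u x₀` on `Ω`.  This file proves
`smp_descent : P (n + 1) → P n` — the local analogue of `…DivFormLiouvilleAll.liouville_descent`: the solution `u` on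
`Ω` lifts to `ũ = u ∘ π` on the tube `Ω̃ = π⁻¹(Ω)` (`π` = forget the last coordinate, `…DivFormDescent.proj`), which is
open and preconnected (the image of `Ω × ℝ` under `(x, t) ↦ ιx + t e_last`), `ũ ∈ C¹(Ω̃)` solves `div(ã∇ũ) = 0`
weakly in `Ω̃` for the lifted coefficients `ã = (a ∘ π) ⊕ 1` (`liftCoeff`, after the coefficients have been made
global by `…Globalise.exists_global_coeff`), and attains its maximum over `Ω̃` at `ι x₀`; so `P (n + 1)` gives
`ũ ≡ ũ(ι x₀)` on `Ω̃`, i.e. `u ≡ u x₀` on `Ω`.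

* `isPreconnected_preimage_proj` — the tube over a preconnected set is preconnected;
* `lift_integrand_eq_of_differentiableAt` — the lifted weak-form integrand at `z` equals the `n`-dimensional one for the
  slice test `η_{z_last}` at `πz` (the tree's `lift_integrand_eq` with `DifferentiableAt` in place of `ContDiff`);
* `lift_weak_local` — the Fubini step of `…DivFormLiouvilleAll.lift_weak` for a LOCAL solution `u ∈ C¹(Ω)` and tests
  with `tsupport η̃ ⊆ Ω̃` (whose slices have `tsupport ⊆ Ω`); integrability now comes from the boundedness of `Dũ`
  on the compact `tsupport η̃ ⊆ Ω̃` instead of global continuity;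
* `smp_descent` — `P (n + 1) → P n`.

Seat ns-in-ser-a g7 (cell pub/ns-inputs), width piece W3 of ns-in-ser-b g5's programme for
`divFormStrongMaximumPrinciple_holds` (interfaces fixed on pub/ns-inputs/STATUS 2026-08-28T18:22:32Z).  Adapted from
`…DivFormLiouvilleAll` (seat ns-poloidal-K2-p3; Fubini bookkeeping copied, hypotheses localised).

WHAT THIS IS NOT: not the strong maximum principle itself in any dimension (ser-b's local Harnack files give `P n` for
`n ≥ 3`; this file only transports it downwards); nothing here is specific to Navier–Stokes and no NS statement is
touched.
-/

section Part8

noncomputable section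

open _root_.MeasureTheory _root_.Set _root_.Function _root_.Filter _root_.Topology _root_.Metric _root_.Module
open scoped _root_.Matrix _root_.ENNReal _root_.NNReal

namespace Literature.Analysis.PDE.DivForm.StrongMaximumPrincipleDescent

open Literature.Analysis.PDE.DivForm.Caccioppoli
open Literature.Analysis.PDE.DivForm.Descent
open Literature.Analysis.PDE.DivForm.StrongMaximumPrincipleGlobalise

variable {n : ℕ}

/-! ### The tube over a preconnected set -/

/-- **The tube `π⁻¹(Ω)` over a preconnected `Ω ⊆ ℝⁿ` is preconnected**: it is the image of `Ω × ℝ` under the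
continuous map `(x, t) ↦ ιx + t e_last`.
[cite: GilbargTrudinger2001, Theorem 8.19 pp.198–199 (proof device: dimension descent)] -/
theorem isPreconnected_preimage_proj {Ω : Set (EuclideanSpace ℝ (Fin n))} (hΩ : IsPreconnected Ω) :
    IsPreconnected (proj n ⁻¹' Ω) := by
  have hg : Continuous fun p : EuclideanSpace ℝ (Fin n) × ℝ =>
      emb n p.1 + p.2 • EuclideanSpace.single (Fin.last n) (1 : ℝ) :=
    ((emb n).continuous.comp continuous_fst).add (continuous_snd.smul continuous_const)
  have himage : (fun p : EuclideanSpace ℝ (Fin n) × ℝ =>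
      emb n p.1 + p.2 • EuclideanSpace.single (Fin.last n) (1 : ℝ)) '' (Ω ×ˢ univ) = proj n ⁻¹' Ω := by
    ext z
    constructor
    · rintro ⟨⟨x, t⟩, ⟨hx, -⟩, rfl⟩
      simpa [proj_slice] using hx
    · intro hz
      exact ⟨(proj n z, z (Fin.last n)), ⟨hz, mem_univ _⟩, emb_proj_add z⟩
  rw [← himage]
  exact (hΩ.prod isPreconnected_univ).image _ hg.continuousOn

/-! ### The lifted weak-form integrand, local version -/

variable {a : EuclideanSpace ℝ (Fin n) → Matrix (Fin n) (Fin n) ℝ} {Λ : ℝ} {u : EuclideanSpace ℝ (Fin n) → ℝ}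

/-- Partial derivatives of `ũ = u ∘ π` at a point where `u` is differentiable: `Dũ(z)[v] = Du(πz)[πv]`.
[cite: GilbargTrudinger2001, Theorem 8.19 pp.198–199 (proof device: dimension descent)] -/
theorem fderiv_lift_of_differentiableAt {z : EuclideanSpace ℝ (Fin (n + 1))} (hu : DifferentiableAt ℝ u (proj n z))
    (v : EuclideanSpace ℝ (Fin (n + 1))) :
    fderiv ℝ (fun z => u (proj n z)) z v = fderiv ℝ u (proj n z) (proj n v) := by
  have h := hu.hasFDerivAt.comp z (proj n).hasFDerivAt
  rw [show (fun z => u (proj n z)) = u ∘ proj n from rfl, h.fderiv]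
  rfl

/-- **The lifted weak-form integrand equals the `n`-dimensional one on the slice through `z`** — the tree's
`lift_integrand_eq` with `u` only differentiable at `πz`.
[cite: GilbargTrudinger2001, Theorem 8.19 pp.198–199 (proof device: dimension descent)] -/
theorem lift_integrand_eq_of_differentiableAt {z : EuclideanSpace ℝ (Fin (n + 1))}
    (hu : DifferentiableAt ℝ u (proj n z)) {η : EuclideanSpace ℝ (Fin (n + 1)) → ℝ} (hη : ContDiff ℝ 1 η) :
    ∑ I, ∑ J, liftCoeff a z I J * fderiv ℝ (fun z => u (proj n z)) z (EuclideanSpace.single I 1) *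
        fderiv ℝ η z (EuclideanSpace.single J 1) =
      ∑ i, ∑ j, a (proj n z) i j * fderiv ℝ u (proj n z) (EuclideanSpace.single i 1) *
        fderiv ℝ (fun x => η (emb n x + z (Fin.last n) • EuclideanSpace.single (Fin.last n) (1 : ℝ))) (proj n z)
          (EuclideanSpace.single j 1) := by
  simp only [fderiv_lift_of_differentiableAt hu, fderiv_slice hη, emb_proj_add, Fin.sum_univ_castSucc,
    proj_single_castSucc, proj_single_last, map_zero, liftCoeff_castSucc_castSucc, liftCoeff_castSucc_last,
    liftCoeff_last_castSucc, liftCoeff_last_last, zero_mul, mul_zero, add_zero, Finset.sum_const_zero]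

/-- The slices `η_t = η̃(ι · + t e_last)` of a test `η̃` with `tsupport η̃ ⊆ π⁻¹(Ω)` have `tsupport η_t ⊆ Ω`.
[cite: GilbargTrudinger2001, Theorem 8.19 pp.198–199 (proof device: dimension descent)] -/
theorem tsupport_slice_subset {Ω : Set (EuclideanSpace ℝ (Fin n))} {η : EuclideanSpace ℝ (Fin (n + 1)) → ℝ}
    (hηΩ : tsupport η ⊆ proj n ⁻¹' Ω) (t : ℝ) :
    tsupport (fun x => η (emb n x + t • EuclideanSpace.single (Fin.last n) (1 : ℝ))) ⊆ Ω := by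
  intro x hx
  have hcont : Continuous fun x : EuclideanSpace ℝ (Fin n) =>
      emb n x + t • EuclideanSpace.single (Fin.last n) (1 : ℝ) := (emb n).continuous.add continuous_const
  have h1 : tsupport (fun x => η (emb n x + t • EuclideanSpace.single (Fin.last n) (1 : ℝ))) ⊆
      (fun x => emb n x + t • EuclideanSpace.single (Fin.last n) (1 : ℝ)) ⁻¹' tsupport η :=
    closure_minimal (fun y hy => subset_closure hy) ((isClosed_tsupport η).preimage hcont)
  have h2 := hηΩ (h1 hx)
  simpa [proj_slice] using h2

/-- **The lift `ũ = u ∘ π` of a LOCAL weak solution is a weak solution for `ã` in the tube.**  Let `u ∈ C¹(Ω)` (`Ω`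
open) solve `∫ Σᵢⱼ aᵢⱼ ∂ᵢu ∂ⱼη = 0` for all `η ∈ C¹_c` with `tsupport η ⊆ Ω`, where `a` has measurable entries with
`|aᵢⱼ| ≤ Λ` everywhere.  Then `∫ Σ_IJ ã_IJ ∂_I ũ ∂_J η̃ = 0` for every `η̃ ∈ C¹_c(ℝⁿ⁺¹)` with `tsupport η̃ ⊆ π⁻¹(Ω)`
(Fubini over the last coordinate; each slice `η̃_t` is an admissible `n`-dimensional test).
[cite: GilbargTrudinger2001, Theorem 8.19 pp.198–199 (proof device: dimension descent)] -/
theorem lift_weak_local {Ω : Set (EuclideanSpace ℝ (Fin n))} (hΩ : IsOpen Ω)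
    (hmeas : ∀ i j, Measurable fun y => a y i j) (hbd : ∀ y i j, |a y i j| ≤ Λ) (hu : ContDiffOn ℝ 1 u Ω)
    (hweak : ∀ η : EuclideanSpace ℝ (Fin n) → ℝ, ContDiff ℝ 1 η → HasCompactSupport η → tsupport η ⊆ Ω →
      ∫ y, ∑ i, ∑ j, a y i j * fderiv ℝ u y (EuclideanSpace.single i 1) *
        fderiv ℝ η y (EuclideanSpace.single j 1) = 0)
    (η : EuclideanSpace ℝ (Fin (n + 1)) → ℝ) (hη : ContDiff ℝ 1 η) (hηc : HasCompactSupport η)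
    (hηΩ : tsupport η ⊆ proj n ⁻¹' Ω) :
    ∫ z, ∑ I, ∑ J, liftCoeff a z I J * fderiv ℝ (fun z => u (proj n z)) z (EuclideanSpace.single I 1) *
      fderiv ℝ η z (EuclideanSpace.single J 1) = 0 := by
  -- the slice integrand `G0 t x = Σ aᵢⱼ(x) ∂ᵢu(x) ∂ⱼη_t(x)`
  obtain ⟨G0, hG0⟩ : ∃ G0 : ℝ → EuclideanSpace ℝ (Fin n) → ℝ, ∀ t x, G0 t x = ∑ i, ∑ j, a x i j *
      fderiv ℝ u x (EuclideanSpace.single i 1) *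
        fderiv ℝ (fun x => η (emb n x + t • EuclideanSpace.single (Fin.last n) (1 : ℝ))) x
          (EuclideanSpace.single j 1) := ⟨_, fun _ _ => rfl⟩
  have hslice0 : ∀ t, ∫ x, G0 t x = 0 := fun t => by
    simp only [hG0]
    exact hweak _ (contDiff_slice hη t) (hasCompactSupport_slice hηc t) (tsupport_slice_subset hηΩ t)
  -- the tube is open and `ũ ∈ C¹` on it
  have hΩt : IsOpen (proj n ⁻¹' Ω) := hΩ.preimage (proj n).continuous
  have hut : ContDiffOn ℝ 1 (fun z => u (proj n z)) (proj n ⁻¹' Ω) :=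
    hu.comp (proj n).contDiff.contDiffOn (fun z hz => hz)
  -- rewrite the lifted integrand as `G0 (z_last) (π z)`
  have hpt : ∀ z, ∑ I, ∑ J, liftCoeff a z I J * fderiv ℝ (fun z => u (proj n z)) z (EuclideanSpace.single I 1) *
      fderiv ℝ η z (EuclideanSpace.single J 1) = G0 (z (Fin.last n)) (proj n z) := by
    intro z
    rw [hG0]
    by_cases hz : z ∈ proj n ⁻¹' Ω
    · exact lift_integrand_eq_of_differentiableAt
        (((hu.differentiableOn one_ne_zero) (proj n z) hz).differentiableAt (hΩ.mem_nhds hz)) hη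
    · have hz' : z ∉ tsupport η := fun h => hz (hηΩ h)
      have h0 : fderiv ℝ η z = 0 := fderiv_of_notMem_tsupport ℝ hz'
      simp [fderiv_slice hη, emb_proj_add, h0]
  simp_rw [hpt]
  -- integrability of `z ↦ G0 (z_last) (πz)` on `ℝⁿ⁺¹`: undo the rewrite; `Dũ` is bounded on `tsupport η̃`
  have hInt : Integrable fun z : EuclideanSpace ℝ (Fin (n + 1)) => G0 (z (Fin.last n)) (proj n z) := by
    have heq : (fun z : EuclideanSpace ℝ (Fin (n + 1)) => G0 (z (Fin.last n)) (proj n z)) = fun z =>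
        ∑ I, ∑ J, liftCoeff a z I J * fderiv ℝ (fun z => u (proj n z)) z (EuclideanSpace.single I 1) *
          fderiv ℝ η z (EuclideanSpace.single J 1) := by
      funext z; rw [hpt z]
    rw [heq]
    -- a bound for `Dũ` on the compact `tsupport η̃ ⊆ π⁻¹(Ω)`
    have hcontOn : ContinuousOn (fderiv ℝ (fun z => u (proj n z))) (tsupport η) :=
      (hut.continuousOn_fderiv_of_isOpen hΩt le_rfl).mono hηΩ
    obtain ⟨C, hC⟩ := IsCompact.exists_bound_of_continuousOn hηc hcontOn
    refine integrable_finsetSum _ fun I _ => integrable_finsetSum _ fun J _ => ?_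
    set m : EuclideanSpace ℝ (Fin (n + 1)) → ℝ := (tsupport η).indicator fun z =>
      liftCoeff a z I J * fderiv ℝ (fun z => u (proj n z)) z (EuclideanSpace.single I 1) with hm
    have hmmeas : Measurable m :=
      (((measurable_liftCoeff hmeas I J).mul
        (measurable_fderiv_apply_const ℝ (fun z => u (proj n z)) (EuclideanSpace.single I 1))).indicator
        (isClosed_tsupport η).measurableSet)
    have hmle : ∀ z, |m z| ≤ max Λ 1 * (max C 0 * ‖(EuclideanSpace.single I (1 : ℝ) :
        EuclideanSpace ℝ (Fin (n + 1)))‖) := by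
      intro z
      by_cases hz : z ∈ tsupport η
      · rw [hm, indicator_of_mem hz, abs_mul]
        refine mul_le_mul (abs_liftCoeff_le hbd z I J) ?_ (abs_nonneg _) (le_trans (abs_nonneg _)
          (abs_liftCoeff_le hbd z I J))
        calc |fderiv ℝ (fun z => u (proj n z)) z (EuclideanSpace.single I 1)|
            ≤ ‖fderiv ℝ (fun z => u (proj n z)) z‖ * ‖(EuclideanSpace.single I (1 : ℝ) :
                EuclideanSpace ℝ (Fin (n + 1)))‖ := by
              rw [← Real.norm_eq_abs]; exact ContinuousLinearMap.le_opNorm _ _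
          _ ≤ max C 0 * ‖(EuclideanSpace.single I (1 : ℝ) : EuclideanSpace ℝ (Fin (n + 1)))‖ :=
              mul_le_mul_of_nonneg_right ((hC z hz).trans (le_max_left _ _)) (norm_nonneg _)
      · rw [hm, indicator_of_notMem hz, abs_zero]; positivity
    have hcη := continuous_fderiv_single hη J
    have hφc : HasCompactSupport fun z => fderiv ℝ η z (EuclideanSpace.single J 1) := by
      have h0 : HasCompactSupport (fderiv ℝ η) := hηc.fderiv (𝕜 := ℝ)
      exact h0.mono (Function.support_subset_iff'.2 fun z hz => by
        simp only [Function.mem_support, not_not] at hz; simp [hz])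
    have h := integrable_mul_of_le_continuous (n := n + 1) hmmeas continuous_const hmle hcη hφc
    refine h.congr (Eventually.of_forall fun z => ?_)
    by_cases hz : z ∈ tsupport η
    · simp only [hm, indicator_of_mem hz]
    · have h0 : fderiv ℝ η z = 0 := fderiv_of_notMem_tsupport ℝ hz
      simp [hm, indicator_of_notMem hz, h0]
  -- (1) to `Fin (n+1) → ℝ`
  set g : (Fin (n + 1) → ℝ) → ℝ := fun f => G0 (f (Fin.last n)) (WithLp.toLp 2 fun j => f (Fin.castSucc j)) with hg
  have hproj : ∀ z : EuclideanSpace ℝ (Fin (n + 1)), proj n z = WithLp.toLp 2 (fun j => z (Fin.castSucc j)) := fun z =>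
    PiLp.ext fun j => by simp
  have hGg : (fun z : EuclideanSpace ℝ (Fin (n + 1)) => G0 (z (Fin.last n)) (proj n z)) = g ∘ WithLp.ofLp := by
    funext z; simp only [Function.comp_apply, hg, hproj]
  have hmp1 : MeasurePreserving (MeasurableEquiv.toLp 2 (Fin (n + 1) → ℝ)).symm := by
    simpa [MeasurableEquiv.coe_toLp_symm] using PiLp.volume_preserving_ofLp (Fin (n + 1))
  have h1 : ∫ z : EuclideanSpace ℝ (Fin (n + 1)), G0 (z (Fin.last n)) (proj n z) = ∫ f : Fin (n + 1) → ℝ, g f := by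
    rw [hGg]
    exact hmp1.integral_comp' g
  have hIg : Integrable g := by
    have h := (hmp1.integrable_comp_emb (MeasurableEquiv.toLp 2 (Fin (n + 1) → ℝ)).symm.measurableEmbedding (g := g)).1
    apply h
    rw [MeasurableEquiv.coe_toLp_symm, ← hGg]
    exact hInt
  -- (2) split the last coordinate
  set e := MeasurableEquiv.piFinSuccAbove (fun _ : Fin (n + 1) => ℝ) (Fin.last n) with he
  have hmp2 : MeasurePreserving e.symm :=
    (volume_preserving_piFinSuccAbove (fun _ : Fin (n + 1) => ℝ) (Fin.last n)).symm _
  have hge : ∀ p : ℝ × (Fin n → ℝ), g (e.symm p) = G0 p.1 (WithLp.toLp 2 p.2) := by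
    rintro ⟨t, x⟩
    simp only [hg, he, MeasurableEquiv.piFinSuccAbove, MeasurableEquiv.symm_mk, MeasurableEquiv.coe_mk,
      Equiv.symm_symm, Fin.insertNthEquiv, Equiv.coe_fn_mk, Fin.insertNth_last', Fin.snoc_last]
    congr 2
    funext j
    rw [Fin.snoc_castSucc]
  have h2 : ∫ f : Fin (n + 1) → ℝ, g f = ∫ p : ℝ × (Fin n → ℝ), G0 p.1 (WithLp.toLp 2 p.2) := by
    rw [← hmp2.integral_comp' g]
    exact integral_congr_ae (Eventually.of_forall hge)
  have hIp : Integrable fun p : ℝ × (Fin n → ℝ) => G0 p.1 (WithLp.toLp 2 p.2) := by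
    have h := (hmp2.integrable_comp_emb e.symm.measurableEmbedding (g := g)).2 hIg
    exact h.congr (Eventually.of_forall hge)
  -- (3) Fubini and the slices
  have hmp3 : MeasurePreserving (MeasurableEquiv.toLp 2 (Fin n → ℝ)) := by
    simpa [MeasurableEquiv.coe_toLp] using PiLp.volume_preserving_toLp (Fin n)
  have h3 : ∫ p : ℝ × (Fin n → ℝ), G0 p.1 (WithLp.toLp 2 p.2) = ∫ t : ℝ, ∫ x : Fin n → ℝ, G0 t (WithLp.toLp 2 x) := by
    rw [← integral_prod _ hIp]; rfl
  have h4 : ∀ t : ℝ, ∫ x : Fin n → ℝ, G0 t (WithLp.toLp 2 x) = 0 := by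
    intro t
    have h := hmp3.integral_comp' (G0 t)
    rw [MeasurableEquiv.coe_toLp] at h
    rw [h]
    exact hslice0 t
  rw [h1, h2, h3]
  simp_rw [h4]
  simp

/-! ### Descent of the strong maximum principle -/

/-- **DESCENT `P (n + 1) → P n` for the strong maximum principle** (Gilbarg–Trudinger Thm 8.19 rendering = the body of
`Literature.Analysis.PDE.divFormStrongMaximumPrinciple` at a fixed dimension): if the strong maximum principle holds
for local `C¹` weak solutions of symmetric uniformly elliptic bounded measurable divergence-form equations on open
preconnected subsets of `ℝⁿ⁺¹`, it holds on open preconnected subsets of `ℝⁿ` — apply it on the tube `π⁻¹(Ω)` to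
`ũ = u ∘ π` and the lifted coefficients `(aG ∘ π) ⊕ 1` (`aG` = `a` made global off `Ω`), whose maximum over the
tube is attained at `ι x₀`. [cite: GilbargTrudinger2001, Theorem 8.19 pp.198–199 (proof device: dimension descent)] -/
theorem smp_descent
    (hP : ∀ (Ω : Set (EuclideanSpace ℝ (Fin (n + 1)))), IsOpen Ω → IsPreconnected Ω →
      ∀ (a : EuclideanSpace ℝ (Fin (n + 1)) → Matrix (Fin (n + 1)) (Fin (n + 1)) ℝ) (lam Λ : ℝ), 0 < lam →
      (∀ i j, Measurable fun y => a y i j) → (∀ y ∈ Ω, (a y).IsSymm) →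
      (∀ y ∈ Ω, ∀ ξ : Fin (n + 1) → ℝ, lam * (ξ ⬝ᵥ ξ) ≤ ξ ⬝ᵥ (a y *ᵥ ξ)) →
      (∀ y ∈ Ω, ∀ i j, |a y i j| ≤ Λ) →
      ∀ (u : EuclideanSpace ℝ (Fin (n + 1)) → ℝ), ContDiffOn ℝ 1 u Ω →
        (∀ η : EuclideanSpace ℝ (Fin (n + 1)) → ℝ, ContDiff ℝ 1 η → HasCompactSupport η → tsupport η ⊆ Ω →
          ∫ y, ∑ i, ∑ j, a y i j * fderiv ℝ u y (EuclideanSpace.single i 1) *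
            fderiv ℝ η y (EuclideanSpace.single j 1) = 0) →
        ∀ x₀ ∈ Ω, (∀ y ∈ Ω, u y ≤ u x₀) → ∀ y ∈ Ω, u y = u x₀)
    (Ω : Set (EuclideanSpace ℝ (Fin n))) (hΩ : IsOpen Ω) (hΩc : IsPreconnected Ω)
    (a : EuclideanSpace ℝ (Fin n) → Matrix (Fin n) (Fin n) ℝ) (lam Λ : ℝ) (hlam : 0 < lam)
    (hmeas : ∀ i j, Measurable fun y => a y i j) (hsymm : ∀ y ∈ Ω, (a y).IsSymm)
    (hell : ∀ y ∈ Ω, ∀ ξ : Fin n → ℝ, lam * (ξ ⬝ᵥ ξ) ≤ ξ ⬝ᵥ (a y *ᵥ ξ))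
    (hbd : ∀ y ∈ Ω, ∀ i j, |a y i j| ≤ Λ)
    (u : EuclideanSpace ℝ (Fin n) → ℝ) (hu : ContDiffOn ℝ 1 u Ω)
    (hweak : ∀ η : EuclideanSpace ℝ (Fin n) → ℝ, ContDiff ℝ 1 η → HasCompactSupport η → tsupport η ⊆ Ω →
      ∫ y, ∑ i, ∑ j, a y i j * fderiv ℝ u y (EuclideanSpace.single i 1) *
        fderiv ℝ η y (EuclideanSpace.single j 1) = 0)
    (x₀ : EuclideanSpace ℝ (Fin n)) (hx₀ : x₀ ∈ Ω) (hmax : ∀ y ∈ Ω, u y ≤ u x₀)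
    (y : EuclideanSpace ℝ (Fin n)) (hy : y ∈ Ω) : u y = u x₀ := by
  -- globalise the coefficients off `Ω`
  obtain ⟨aG, haGm, haGs, haGe, haGb, haGΩ⟩ := exists_global_coeff hΩ.measurableSet hlam hmeas hsymm hell hbd
  have hweakG : ∀ η : EuclideanSpace ℝ (Fin n) → ℝ, ContDiff ℝ 1 η → HasCompactSupport η → tsupport η ⊆ Ω →
      ∫ y, ∑ i, ∑ j, aG y i j * fderiv ℝ u y (EuclideanSpace.single i 1) *
        fderiv ℝ η y (EuclideanSpace.single j 1) = 0 := by
    intro η hη hηc hηΩ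
    rw [integrand_congr_coeff haGΩ u η hηΩ]
    exact hweak η hη hηc hηΩ
  -- the tube and the lifted data
  have hΩt : IsOpen (proj n ⁻¹' Ω) := hΩ.preimage (proj n).continuous
  have hΩtc : IsPreconnected (proj n ⁻¹' Ω) := isPreconnected_preimage_proj hΩc
  have hut : ContDiffOn ℝ 1 (fun z => u (proj n z)) (proj n ⁻¹' Ω) :=
    hu.comp (proj n).contDiff.contDiffOn (fun z hz => hz)
  have hx₀t : emb n x₀ ∈ proj n ⁻¹' Ω := by simpa using hx₀
  have hyt : emb n y ∈ proj n ⁻¹' Ω := by simpa using hy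
  have h := hP (proj n ⁻¹' Ω) hΩt hΩtc (liftCoeff aG) (min lam 1) (max (max Λ lam) 1) (lt_min hlam one_pos)
    (measurable_liftCoeff haGm) (fun z _ => isSymm_liftCoeff haGs z) (fun z _ ξ => liftCoeff_elliptic haGe z ξ)
    (fun z _ I J => abs_liftCoeff_le haGb z I J) (fun z => u (proj n z)) hut
    (fun η hη hηc hηΩ => lift_weak_local hΩ haGm haGb hu hweakG η hη hηc hηΩ)
    (emb n x₀) hx₀t (fun z hz => by simpa using hmax (proj n z) hz) (emb n y) hyt
  simpa using h

end Literature.Analysis.PDE.DivForm.StrongMaximumPrincipleDescent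

end

end Part8

/-!
## Part 9 — port of `Summits/NavierStokesRegularity/NavierStokesRegularity/Theorems/PoloidalWindowDoorPoloidalWindowRigidityDivFormStrongMaximumPrinciple.lean`

# Route `PoloidalWindowDoor`, crux K2 (stmt-NavierStokesRegularity-19708) — DISCHARGE of the named fact
# `Literature.Analysis.PDE.divFormStrongMaximumPrinciple` (Gilbarg–Trudinger 2001, Thm 8.19: the strong maximum principle
# for divergence-form equations with bounded measurable coefficients)

Assembly of the programme L1–L5 of cell pub/ns-inputs (seat ns-in-ser-b g5 with width from ns-in-ser-a g7):

* `smp_of_three_le` — the fact in dimension `n ≥ 3`.  Let `u ∈ C¹(Ω)` be a local weak solution attaining its supremum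
  at `x₀ ∈ Ω`.  At a point `x₁ ∈ Ω` with `u x₁ = u x₀` pick `B̄(x₁,ρ) ⊆ Ω`; for `ε > 0` the function
  `v_ε = ε⁻¹(u x₀ − u) + 1 ≥ 1` is again a local weak solution on `Ω`, which `…Globalise.globalise_local_solution`
  (ns-in-ser-a g7) turns into a pair `(aG, w)` satisfying the GLOBAL hypotheses of `…DivFormLocalHarnack.harnack_local` with
  `U = B(x₁,ρ)`; Harnack on `B̄(x₁,ρ/5)` against the point `x₁` (where `w = 1`) gives `u x₀ − u ≤ (C_H − 1)ε` there, so
  `u ≡ u x₀` near `x₁`: the coincidence set is open, and closed in `Ω` by continuity, hence all of the preconnected `Ω`.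
* `_root_.Literature.Analysis.PDE.DivForm.divFormStrongMaximumPrinciple_holds` — all dimensions: `n ≥ 3` as above, `n ≤ 2` by
  the descent `…Descent.smp_descent : P (n+1) → P n` (ns-in-ser-a g7; lift `u ∘ proj`), inducting downward as in
  `…DivFormLiouvilleAll.liouville_all`.

The engine is the K2-p3 De Giorgi–Nash–Moser chain `…DivForm{Caccioppoli,…,Harnack}` (entire solutions), localised in
`…DivFormLocal{Caccioppoli,ReverseHolder,Moser,LogOsc,HarnackInputs,Harnack}` with the Bombieri–Giusti lemma
(`Literature.Analysis.FunctionSpaces.bombieriGiusti`) replacing the John–Nirenberg crossover.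

WHAT THIS IS NOT: nothing here is specific to Navier–Stokes; no NS regularity statement is proved or touched — the fact is
an INPUT (consumer: line stub C1 `stub_ellipticThreadEmpty` of `Cruxes/PoloidalWindowRigidity/Lines/thread_type.lean`,
which becomes unconditional as typed).  The general `W^{1,2}` subsolution form of GT 8.19 (lower-order terms,
non-symmetric `a`) is not addressed (the named fact renders the `C¹` / pure-principal-part case).
-/

section Part9

noncomputable section

open _root_.MeasureTheory _root_.Set _root_.Function _root_.Filter _root_.Topology _root_.Metric _root_.Module
open scoped _root_.Matrix _root_.ENNReal _root_.NNReal

namespace Literature.Analysis.PDE.DivForm.StrongMaximumPrinciple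

open Literature.Analysis.PDE.DivForm.LocalHarnack
open Literature.Analysis.PDE.DivForm.StrongMaximumPrincipleGlobalise
open Literature.Analysis.PDE.DivForm.StrongMaximumPrincipleDescent

variable {n : ℕ}

/-- **GT 8.19 for `C¹` local weak solutions, `n ≥ 3`**: for `Ω ⊆ ℝⁿ` open preconnected, `a` measurable with
symmetric, `λ`-elliptic, `Λ`-bounded values on `Ω`, and `u ∈ C¹(Ω)` with `∫ Σ aᵢⱼ ∂ᵢu ∂ⱼη = 0` for every `η ∈ C¹_c`,
`tsupport η ⊆ Ω`: if `u` attains its supremum over `Ω` at `x₀ ∈ Ω` then `u ≡ u x₀` on `Ω`.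
[cite: GilbargTrudinger2001, Theorem 8.19 pp.198–199 (strong maximum principle)] -/
theorem smp_of_three_le (hn : 3 ≤ n) (Ω : Set (EuclideanSpace ℝ (Fin n))) (hΩ : IsOpen Ω) (hΩc : IsPreconnected Ω)
    (a : EuclideanSpace ℝ (Fin n) → Matrix (Fin n) (Fin n) ℝ) (lam Λ : ℝ) (hlam : 0 < lam)
    (hmeas : ∀ i j, Measurable fun y => a y i j) (hsymm : ∀ y ∈ Ω, (a y).IsSymm)
    (hell : ∀ y ∈ Ω, ∀ ξ : Fin n → ℝ, lam * (ξ ⬝ᵥ ξ) ≤ ξ ⬝ᵥ (a y *ᵥ ξ))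
    (hbd : ∀ y ∈ Ω, ∀ i j, |a y i j| ≤ Λ)
    (u : EuclideanSpace ℝ (Fin n) → ℝ) (hu : ContDiffOn ℝ 1 u Ω)
    (hweak : ∀ η : EuclideanSpace ℝ (Fin n) → ℝ, ContDiff ℝ 1 η → HasCompactSupport η → tsupport η ⊆ Ω →
      ∫ y, ∑ i, ∑ j, a y i j * fderiv ℝ u y (EuclideanSpace.single i 1) *
        fderiv ℝ η y (EuclideanSpace.single j 1) = 0)
    (x₀ : EuclideanSpace ℝ (Fin n)) (hx₀ : x₀ ∈ Ω) (hmax : ∀ y ∈ Ω, u y ≤ u x₀)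
    (y : EuclideanSpace ℝ (Fin n)) (hy : y ∈ Ω) : u y = u x₀ := by
  obtain ⟨C_H, hC0, hH⟩ := harnack_local hn hlam (max Λ lam)
  -- differentiability of `u` at points of the open set `Ω`
  have hdiff : ∀ z ∈ Ω, DifferentiableAt ℝ u z := fun z hz =>
    (hu.differentiableOn one_ne_zero z hz).differentiableAt (hΩ.mem_nhds hz)
  -- KEY: the coincidence set `{u = u x₀}` is open in `Ω`
  have key : ∀ x₁ ∈ Ω, u x₁ = u x₀ → ∃ r > 0, ball x₁ r ⊆ Ω ∧ ∀ z ∈ ball x₁ r, u z = u x₀ := by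
    intro x₁ hx₁ hux₁
    -- a closed ball inside `Ω`
    obtain ⟨ρ₀, hρ₀, hρ₀Ω⟩ := Metric.isOpen_iff.1 hΩ x₁ hx₁
    set ρ : ℝ := ρ₀ / 2 with hρ
    have hρpos : 0 < ρ := by positivity
    have hρΩ : closedBall x₁ ρ ⊆ Ω := (closedBall_subset_ball (by rw [hρ]; linarith)).trans hρ₀Ω
    set R : ℝ := ρ / 5 with hR
    have hRpos : 0 < R := by positivity
    have h4R : closedBall x₁ (4 * R) ⊆ ball x₁ ρ := closedBall_subset_ball (by rw [hR]; linarith)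
    have hRΩ : ball x₁ R ⊆ Ω :=
      (ball_subset_closedBall.trans (closedBall_subset_closedBall (by rw [hR]; linarith))).trans hρΩ
    refine ⟨R, hRpos, hRΩ, fun z hz => ?_⟩
    have hzΩ : z ∈ Ω := hRΩ hz
    -- for every `ε > 0`: `u x₀ − u z ≤ (C_H − 1) ε`
    have hε : ∀ ε : ℝ, 0 < ε → u x₀ - u z ≤ (C_H - 1) * ε := by
      intro ε hε
      set v : EuclideanSpace ℝ (Fin n) → ℝ := fun y => ε⁻¹ * (u x₀ - u y) + 1 with hv
      have hvC : ContDiffOn ℝ 1 v Ω := (contDiffOn_const.mul (contDiffOn_const.sub hu)).add contDiffOn_const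
      have hv1 : ∀ y ∈ Ω, 1 ≤ v y := fun y hy' => by
        have : 0 ≤ ε⁻¹ * (u x₀ - u y) := mul_nonneg (inv_nonneg.2 hε.le) (by linarith [hmax y hy'])
        rw [hv]; linarith
      -- `v` is again a local weak solution (linearity)
      have hdv : ∀ y ∈ Ω, ∀ e : EuclideanSpace ℝ (Fin n), fderiv ℝ v y e = -ε⁻¹ * fderiv ℝ u y e := by
        intro y hy' e
        have h := (((hdiff y hy').hasFDerivAt.const_sub (u x₀)).const_mul ε⁻¹).add_const (1 : ℝ)
        rw [show v = fun y => ε⁻¹ * (u x₀ - u y) + 1 from rfl, h.fderiv]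
        simp
      have hvweak : ∀ η : EuclideanSpace ℝ (Fin n) → ℝ, ContDiff ℝ 1 η → HasCompactSupport η → tsupport η ⊆ Ω →
          ∫ y, ∑ i, ∑ j, a y i j * fderiv ℝ v y (EuclideanSpace.single i 1) *
            fderiv ℝ η y (EuclideanSpace.single j 1) = 0 := by
        intro η hη hηc hηΩ
        have hpt : ∀ y, ∑ i, ∑ j, a y i j * fderiv ℝ v y (EuclideanSpace.single i 1) *
              fderiv ℝ η y (EuclideanSpace.single j 1) =
            (-ε⁻¹) * ∑ i, ∑ j, a y i j * fderiv ℝ u y (EuclideanSpace.single i 1) *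
              fderiv ℝ η y (EuclideanSpace.single j 1) := by
          intro y
          by_cases hy' : y ∈ Ω
          · simp only [hdv y hy', Finset.mul_sum]
            exact Finset.sum_congr rfl fun i _ => Finset.sum_congr rfl fun j _ => by ring
          · have hη0 : fderiv ℝ η y = 0 := fderiv_of_notMem_tsupport ℝ (fun h => hy' (hηΩ h))
            simp [hη0]
        simp_rw [hpt]
        rw [integral_const_mul, hweak η hη hηc hηΩ, mul_zero]
      -- globalise and apply Harnack on `B̄(x₁,R)` against the centre
      obtain ⟨aG, w, haGm, haGs, haGe, haGb, -, hwC, hw1, hwv, hwweak⟩ :=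
        globalise_local_solution hΩ hlam hmeas hsymm hell hbd hvC hv1 hvweak hρpos hρΩ
      have hHz := hH aG haGm haGs haGe haGb (ball x₁ ρ) w hwC hw1 hwweak x₁ R hRpos h4R z
        (ball_subset_closedBall hz) x₁ (mem_closedBall_self hRpos.le)
      have hzρ : z ∈ closedBall x₁ ρ := (ball_subset_closedBall.trans (closedBall_subset_closedBall
        (by rw [hR]; linarith))) hz
      rw [hwv z hzρ, hwv x₁ (mem_closedBall_self hρpos.le)] at hHz
      have hv₁ : v x₁ = 1 := by
        show ε⁻¹ * (u x₀ - u x₁) + 1 = 1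
        rw [hux₁, sub_self, mul_zero, zero_add]
      rw [hv₁, mul_one] at hHz
      -- `hHz : ε⁻¹ (u x₀ − u z) + 1 ≤ C_H`
      have h1 : ε⁻¹ * (u x₀ - u z) ≤ C_H - 1 := by
        have := hHz; simp only [hv] at this; linarith
      have h2 := mul_le_mul_of_nonneg_left h1 hε.le
      rwa [← mul_assoc, mul_inv_cancel₀ hε.ne', one_mul, mul_comm] at h2
    -- hence `u z = u x₀`
    have hge : 0 ≤ u x₀ - u z := by linarith [hmax z hzΩ]
    have hle : u x₀ - u z ≤ 0 := by
      refine le_of_forall_pos_le_add fun δ hδ => ?_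
      have h := hε (δ / (C_H + 1)) (by positivity)
      have h' : (C_H - 1) * (δ / (C_H + 1)) ≤ δ := by
        rw [mul_div_assoc', div_le_iff₀ (by positivity)]; nlinarith
      linarith
    linarith
  -- clopen argument in the preconnected `Ω`
  set Uo : Set (EuclideanSpace ℝ (Fin n)) := interior {x | u x = u x₀} with hUo
  set Vo : Set (EuclideanSpace ℝ (Fin n)) := Ω ∩ u ⁻¹' {t | t ≠ u x₀} with hVo
  have hUo_open : IsOpen Uo := isOpen_interior
  have hVo_open : IsOpen Vo := hu.continuousOn.isOpen_inter_preimage hΩ isOpen_ne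
  have hcover : Ω ⊆ Uo ∪ Vo := by
    intro x hx
    by_cases hux : u x = u x₀
    · obtain ⟨r, hr, -, hball⟩ := key x hx hux
      exact Or.inl (mem_interior.2 ⟨ball x r, fun z hz => hball z hz, isOpen_ball, mem_ball_self hr⟩)
    · exact Or.inr ⟨hx, hux⟩
  have hdisj : Disjoint Uo Vo := by
    rw [Set.disjoint_left]
    intro x hxU hxV
    have hx' : x ∈ {x | u x = u x₀} := interior_subset hxU
    exact hxV.2 hx'
  have hne : (Ω ∩ Uo).Nonempty := by
    obtain ⟨r, hr, -, hball⟩ := key x₀ hx₀ rfl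
    exact ⟨x₀, hx₀, mem_interior.2 ⟨ball x₀ r, fun z hz => hball z hz, isOpen_ball, mem_ball_self hr⟩⟩
  have hΩU : Ω ⊆ Uo := hΩc.subset_left_of_subset_union hUo_open hVo_open hdisj hcover hne
  have hyU : y ∈ {x | u x = u x₀} := interior_subset (hΩU hy)
  exact hyU

/-- **Discharge of the named fact `Literature.Analysis.PDE.divFormStrongMaximumPrinciple`** (Gilbarg–Trudinger 2001,
§8.7 Thm 8.19, in the tree's rendering: pure principal part, symmetric measurable uniformly elliptic bounded `a` on an
open preconnected `Ω ⊆ ℝⁿ`, `u ∈ C¹(Ω)` a weak solution against `C¹_c` tests supported in `Ω`, interior supremum ⇒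
constant).  `n ≥ 3`: `smp_of_three_le` (local De Giorgi–Nash–Moser / Bombieri–Giusti Harnack); `n ≤ 2`: descent from
`n + 1` (`…Descent.smp_descent`).  Cell pub/ns-inputs, seats ns-in-ser-b g5 (L1, L2, L3, L4, this file) and
ns-in-ser-a g7 (globalisation W2, descent W3), on the K2-p3 chain.
[cite: GilbargTrudinger2001, Theorem 8.19 pp.198–199 (strong maximum principle)] -/
theorem _root_.Literature.Analysis.PDE.DivForm.divFormStrongMaximumPrinciple_holds :
    Literature.Analysis.PDE.divFormStrongMaximumPrinciple := by
  intro n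
  -- `P m`: the fact in dimension `m`
  let P : ℕ → Prop := fun m => ∀ (Ω : Set (EuclideanSpace ℝ (Fin m))), IsOpen Ω → IsPreconnected Ω →
    ∀ (a : EuclideanSpace ℝ (Fin m) → Matrix (Fin m) (Fin m) ℝ) (lam Λ : ℝ), 0 < lam →
    (∀ i j, Measurable fun y => a y i j) → (∀ y ∈ Ω, (a y).IsSymm) →
    (∀ y ∈ Ω, ∀ ξ : Fin m → ℝ, lam * (ξ ⬝ᵥ ξ) ≤ ξ ⬝ᵥ (a y *ᵥ ξ)) →
    (∀ y ∈ Ω, ∀ i j, |a y i j| ≤ Λ) →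
    ∀ (u : EuclideanSpace ℝ (Fin m) → ℝ), ContDiffOn ℝ 1 u Ω →
      (∀ η : EuclideanSpace ℝ (Fin m) → ℝ, ContDiff ℝ 1 η → HasCompactSupport η → tsupport η ⊆ Ω →
        ∫ y, ∑ i, ∑ j, a y i j * fderiv ℝ u y (EuclideanSpace.single i 1) *
          fderiv ℝ η y (EuclideanSpace.single j 1) = 0) →
      ∀ x₀ ∈ Ω, (∀ y ∈ Ω, u y ≤ u x₀) → ∀ y ∈ Ω, u y = u x₀
  have hP : ∀ k m : ℕ, 3 ≤ m + k → P m := by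
    intro k
    induction k with
    | zero => intro m hm; exact fun Ω hΩ hΩc a lam Λ hlam hmeas hsymm hell hbd u hu hweak x₀ hx₀ hmax y hy =>
        smp_of_three_le (by omega) Ω hΩ hΩc a lam Λ hlam hmeas hsymm hell hbd u hu hweak x₀ hx₀ hmax y hy
    | succ k ih => intro m hm; exact fun Ω hΩ hΩc a lam Λ hlam hmeas hsymm hell hbd u hu hweak x₀ hx₀ hmax y hy =>
        smp_descent (ih (m + 1) (by omega)) Ω hΩ hΩc a lam Λ hlam hmeas hsymm hell hbd u hu hweak x₀ hx₀ hmax y hy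
  intro Ω hΩ hΩc a lam Λ hlam hmeas hsymm hell hbd u hu hweak x₀ hx₀ hmax y hy
  exact hP 3 n (by omega) Ω hΩ hΩc a lam Λ hlam hmeas hsymm hell hbd u hu hweak x₀ hx₀ hmax y hy

end Literature.Analysis.PDE.DivForm.StrongMaximumPrinciple

end

end Part9

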